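import Mathlib
import Literature.Analysis.SpecialFunctions.JacobiTripleProduct
import HarnessLib

/-!
# Müller–Schiemann, *Continuum limit of a hierarchical SU(2) lattice gauge theory in 4 dimensions*
# (CMP 110, 1987), APPENDIX LEMMA (i)–(ii) with (A.1)–(A.6): the `SU(2)` heat-kernel Gibbs factor
# `h(θ) = 𝒩 Σ_{l≥1} l e^{−l²/(4γ)} sin lθ / sin θ` (2.20)/(A.1) is POSITIVE for every real `θ` and STRICTLY
# DECREASING in the central angle `θ ∈ (0, π)` — PROVED (Jacobi's triple product BY NAME + termwise calculus);
# (v1.1) + (2.1)–(2.3) and «positive on G» ON `SU(2)` itself (§9), and (A.7)–(A.8) on the real axis by theta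
# inversion: `h(θ) sin θ = 𝒩′ Σ_{n∈ℤ} (θ − 2πn) e^{−γ(θ − 2πn)²}` (§10); (v1.2) + both normalisations in closed
# form, `𝒩 = (Σ_{l≥1} l² e^{−l²/(4γ)})⁻¹` (§11) and `𝒩′ = (Σ_{n∈ℤ} (1 − 8π²γn²) e^{−4π²γn²})⁻¹ ≥ 1` — (A.9) one-sided (§12);
# (v1.3) + (A.9) two-sided and explicit: `1 ≤ 𝒩′ ≤ 1 + 64π² γ e^{−4π²γ}` for `γ ≥ 1` (§13);
# (v1.4) + APPENDIX LEMMA (iii): `−ln h(θ) = (γ − ⅙ + ρ₁)θ² + ½(−1/90 + ρ₂)θ⁴ + ⅓(−1/945 + ρ₃)θ⁶ + O(θ⁸)` with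
# explicit `ρ_j(γ)` and `|ρ_j| ≤ C_j γ^{2j+1} e^{−4π²γ}` for `γ ≥ 1` — «ρ_j = O(γ^{2j+1}e^{−4π²γ}) for γ → ∞» (§§14–17)

statement-level skeleton of published theorems with citation tags; proofs where landed; nothing here is a claim about the Yang–Mills mass gap

**Citation header (reproduction of PUBLISHED work).** V. F. Müller, J. Schiemann, *Continuum limit of a hierarchical
SU(2) lattice gauge theory in 4 dimensions*, Commun. Math. Phys. **110** (1987) 261–286, doi 10.1007/BF01207367
[MullerSchiemann1987], Sect. 2 ((2.1), (2.10)–(2.12), (2.20), Proposition 1; pp. 263–266) and the APPENDIX (Lemma,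
(A.1)–(A.6); pp. 284–285). Loci `p.NNN L.nn` are journal page and text-layer line of the held Project Euclid scan
`paper:url-96df5da18d4c` (PDF page = journal page − 260); the displays, which the scan's text layer garbles, were read
on page renders (poppler/cairo of PDF pp. 3–6, 24–25). Third file of the `MullerSchiemann1987/` directory (Lean lane
of the lit-balaban YM LIT SWEEP CONTEXT row X1; register level, zero weight for any token of that table): the
companions `MS87CouplingFlow` / `MS87RecursionCoefficients` treat §6 Proposition 2 and the §3/§6 coefficient algebra;
this file treats the INITIAL CONDITION of the paper's analysis — the heat-kernel action (2.20) —, namely the two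
elementary properties the Appendix Lemma records first: positivity on the whole group (p.266 L.3 «The real-valued
function g_HK^{(0)} is positive on G, see Appendix») and monotone decrease in the central angle.

**What the paper prints (verbatim; displays image-read).**
* (2.1)–(2.3) p.263: *«g^{(n)}(e₀) = 1, g^{(n)}(vuv⁻¹) = g^{(n)}(u), g^{(n)}(u⁻¹) = g^{(n)}(u)»*.
* (2.10)–(2.12) p.264 L.20–27: *«h^{(n)}(z) := g̃^{(n)}(e₀, z), n ∈ ℕ₀ (2.10) are entire holomorphic in z ∈ ℂ,
  periodic with period 2π and even functions due to (2.9), h^{(n)}(z + π) = h^{(n)}(z − π), (2.11) h^{(n)}(z) =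
  h^{(n)}(−z). (2.12) The functions h^{(n)}(x) are the Gibbs factors, which are class functions, (2.2), expressed in
  terms of the central angle.»*; Proposition 1 (p.264): *«g̃^{(n)}(u, z) = h^{(n)}(θ) for u₀ > −½ … where θ² =
  θ²(u, z) = 4f(½{1 − u₀ cos z − u₃ sin z}), (2.13) … defined by inversion of η = sin²(θ/2) as a holomorphic
  function of θ², i.e. θ² = 4f(η)»* (so at `z = 0`: `cos θ = u₀`).
* (2.20) p.265 L.34 – p.266 L.3: *«Besides the Wilson action (2.5) we consider the heat kernel action (HK) in the
  initial Gibbs factor g_HK^{(0)}(u) = 𝒩 Σ_{j = 0, ½, 1, …} (2j + 1) e^{−(j+½)²/γ} χ_j(u), (2.20) with γ ∈ ℝ₊, the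
  characters χ_j of SU(2) and a normalization factor 𝒩 fixed by (2.1). The real-valued function g_HK^{(0)} is
  positive on G, see Appendix.»*
* Appendix, p.284 L.12–22: *«In this appendix we exhibit some properties of the heat kernel (2.20). We denote (2.20)
  by g(u) and by h(θ) and g̃(u, z) the related functions as defined in Sect. 2, suppressing the parameter γ ∈ ℝ₊.
  **Lemma.** For γ ∈ ℝ₊, (i) h(θ) > 0, ∀θ ∈ ℝ, (ii) h(θ) decreases monotonously in θ ∈ (0, π), (iii) −ln h(θ) =
  (γ − ⅙ + ρ₁)θ² + ½(−1/90 + ρ₂)θ⁴ + ⅓(−1/945 + ρ₃)θ⁶ + O(θ⁸) with ρ_j = O(γ^{2j+1}e^{−4π²γ}) for γ → ∞, (iv) in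
  {|θ| > β^{−α}, |Re θ| ≤ π, |Im θ| < (κ/2)β^{−α}}, |h(θ)| < exp{β(Im θ)² − pβ^{1−2α}} with a constant p = ⅝ and
  β := γ − ⅙ + ρ₁ large enough. (κ and α are defined in Sect. 3.)»*
* p.284 L.23 – p.285 L.7: *«Proof. From (2.20) we obtain the entire holomorphic function h(θ) = 𝒩 Σ_{l=1}^∞
  l e^{−l²/(4γ)} sin lθ / sin θ (A.1) with the positive normalization factor 𝒩 determined by h(0) = 1. Equation
  (A.1) can be expressed in terms of the theta-function ϑ₃, [14], writing q = exp{−1/(4γ)}, (A.2)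
  h(θ) = −(𝒩/2) (1/sin θ) (d/dθ) {1 + 2 Σ_{l=1}^∞ q^{l²} cos lθ} (A.3) = −(𝒩/2) (1/sin θ) (d/dθ) ϑ₃(θ/2, q). (A.4)
  From the product representation of ϑ₃, [14], we obtain h(θ) = 𝒩 q₀ Σ_{n=1}^∞ q^{2n−1} Π_{m≠n} {1 + 2q^{2m−1}
  cos θ + q^{4m−2}}, (A.5) q₀ = Π_{n=1}^∞ (1 − q^{2n}). (A.6) In (A.5) each factor is strictly positive ∀θ ∈ ℝ and
  decreases in (0, π), thus proving (i), (ii).»* ([14] = E. Hille, *Analytic Function Theory* II, Chap. 13.5.)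
* (A.7)–(A.8) p.285 L.7–14 (v1.1): *«Employing in (A.3) the Poisson summation formula we obtain, with δ > 0 small,
  in 𝒟 = {θ ∈ ℂ : |Re θ| ≤ π − δ}, h(θ) = 𝒩′ (θ/sin θ) e^{−γθ²} {1 + 2 Σ_{n=1}^∞ [cosh 4πγnθ − 2πnθ⁻¹ sinh 4πnγθ]
  · exp(−4π²γn²)}, (A.7) and with θ̌ = π − θ in 𝒟̌ = {θ̌ ∈ ℂ : |Re θ̌| ≤ π − δ}, h(θ) = 𝒩′ (θ̌/sin θ̌) e^{−γθ̌²}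
  Σ_{n=1}^∞ exp[−4π²γ(n−½)²] · {4π(n−½)θ̌⁻¹ sinh 4πγ(n−½)θ̌ − 2 cosh 4πγ(n−½)θ̌}. (A.8) Both representations are
  explicitly holomorphic in their respective domains.»*
* (A.9) p.285 L.14–17 (v1.2): *«For large values of γ the constant 𝒩′ determined by normalization of (A.7) is
  𝒩′ = 1 + 𝒪(γ exp{−4π²γ}). (A.9) From (A.7) we read off (iii).»* (display read on the page render; the scan's text
  layer has «JT' = \ + 0(y exp{−4π2y})», which v1.1 of this docstring misquoted as `½`).

**What is reproduced here (kernel-checked: zero `sorry`, zero named facts, axioms standard).** With the nome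
`q = e^{−1/(4γ)}` of (A.2) (`nome`; §§1–7 are stated for a general `0 < q < 1`) and all indices shifted to start at
`0` (print's `l, n, m ≥ 1` ↦ `l+1, n+1, m+1`):
* §1–§2 — the factors of (A.5) as functions of `c = cos θ`, `fac q m c = 1 + 2q^{2m+1}c + q^{4m+2} = (1 − q^{2m+1})²
  + 2q^{2m+1}(1 + c) ≥ (1 − q)² > 0` on `c ≥ −1`, increasing in `c` («each factor is strictly positive ∀θ ∈ ℝ and
  decreases in (0, π)»: `fac_pos`, `sq_le_fac`, `fac_mono`); `q₀ = Π (1 − q^{2n+2}) > 0` (A.6) (`q0`, `q0_pos`); all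
  the infinite products converge, as `exp Σ log` (`multipliable_fac`, `tprod_fac_eq_exp`, `tprod_fac_pos`).
* §3 — **(A.3) = (A.4)–(A.6)**: the cosine series `Θ_q(θ) = 1 + 2Σ_{l≥1} q^{l²} cos lθ` (`theta`) EQUALS
  `q₀ · Πₘ (1 + 2q^{2m+1} cos θ + q^{4m+2})` (`theta_eq_q0_mul_tprod`) — Jacobi's triple product taken BY NAME from
  the tree (`Literature.Analysis.SpecialFunctions.hasSum_jacobi_triple_product`, Whittaker–Watson §21.3 /
  Armitage–Eberlein (4.41)) at the real nome `q` and `w = e^{iθ}`, and transported to `ℝ` (`tripleProduct_factor_eq`,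
  `tripleProduct_eq_ofReal`, `hasSum_int_theta`); (A.4) in Mathlib's normalisation, `Θ_q(θ) = jacobiTheta₂ (θ/2π)
  (i/(4πγ))` (`theta_eq_jacobiTheta₂`); `Θ_q > 0` (`theta_pos`).
* §4 — **(A.3)**: `dΘ_q/dθ = −2 S_q` with `S_q(θ) = Σ_{l≥1} l q^{l²} sin lθ` (`S`, `hasDerivAt_theta`; termwise
  differentiation `hasDerivAt_tsum`, the derivatives being dominated by `l q^{l²} ≤ l q^l`).
* §5 — the derivative of the PRODUCT through its logarithm `L_q = Σₘ log fac_m` (`hasDerivAt_L`: `L′_q = −2 sin θ ·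
  R_q`, `R_q = Σₘ q^{2m+1}/fac_m`; `hasDerivAt_theta'`: `Θ′_q = Θ_q L′_q`), whence, by uniqueness of the
  derivative, **`S_q(θ) = sin θ · Θ_q(θ) · R_q(θ)`** (`S_eq`) — i.e. (A.1) = (A.5):
  `Σ l q^{l²} sin lθ = sin θ · q₀ Σₙ q^{2n+1} Π_{m≠n} fac_m`.
* §6 — the everywhere-defined Gibbs factor in the central angle `hk_q := Θ_q · R_q` (`hk`; `hk_mul_sin`,
  `hk_eq_S_div` = (A.1) off the zeros of `sin`, `hk_eq_A5` = (A.5)); **LEMMA (i)**: `hk_q(θ) > 0` for ALL real `θ`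
  (`hk_pos`); the class-function facts (2.10)–(2.12): `hk_congr_cos` (depends on `cos θ = u₀` only), `hk_neg`,
  `hk_add_two_pi`.
* §7 — **LEMMA (ii)**: `d hk_q/dθ = −2 sin θ · Θ_q · (R_q² − Σₘ aₘ²)` (`hasDerivAt_hk`, `hasDerivAt_R`,
  `aₘ = q^{2m+1}/fac_m`), `Σ aₘ² < (Σ aₘ)²` (`R2_lt_R_sq`), so the derivative is `< 0` on `(0, π)` (`deriv_hk_neg`)
  and `hk_q` is STRICTLY decreasing on `[0, π]` and on `(0, π)` (`hk_strictAntiOn`, `hk_strictAntiOn_Ioo`), with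
  its maximum at `θ = 0` (`hk_le_hk_zero`).
* §8 — the printed, normalised `h = 𝒩 · hk_q`, `𝒩 = 1/hk_q(0)` (`h`, `normN`, `normN_pos`): (2.1) `h(0) = 1`
  (`h_zero`); **(A.1)** `h(θ) · sin θ = 𝒩 Σ_{l≥1} l e^{−l²/(4γ)} sin lθ` (`h_mul_sin`; quotient form `h_eq_div`);
  **(A.3)** `h sin θ = −(𝒩/2) Θ′` (`h_mul_sin_eq_deriv`); **(A.5)–(A.6)** (`h_eq_A5`); **LEMMA (i)** `h(θ) > 0 ∀θ ∈ ℝ`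
  (`h_pos`); **LEMMA (ii)** `StrictAntiOn h (Ioo 0 π)` and on `Icc 0 π` (`h_strictAntiOn_Ioo`, `h_strictAntiOn`);
  (2.11), (2.12), `2π`-periodicity (`h_add_pi`, `h_neg`, `h_add_two_pi`); `0 < h ≤ 1 = h(0)` (`h_le_one`).
* §9 (v1.1) — ON THE GROUP `SU(2) = Matrix.specialUnitaryGroup (Fin 2) ℂ` (the carrier of the tree's
  `QuantumLattice.SU2Haar`): the central angle `θ(u) = arccos(½ Re tr u) ∈ [0, π]` (`centralAngle`) and
  `g_HK(u) := h(θ(u))` (`gHK`; (2.20) read through Proposition 1 at `z = 0`); **(2.1)** `g_HK(e₀) = 1` (`gHK_one`),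
  **(2.2)** `g_HK(vuv⁻¹) = g_HK(u)` (`gHK_conj`, `trace_conj`), **(2.3)** `g_HK(u⁻¹) = g_HK(u)` (`gHK_inv`, `trace_inv`),
  **«The real-valued function g_HK^{(0)} is positive on G»** (`gHK_pos`), `g_HK ≤ 1` (`gHK_le_one`), and Lemma (ii)
  on the group (`gHK_lt_of_centralAngle_lt`).
* §10 (v1.1) — **(A.7)–(A.8) by theta inversion** («Employing in (A.3) the Poisson summation formula»), on the REAL
  axis, from Mathlib's `jacobiTheta₂_functional_equation` / `jacobiTheta₂'_functional_equation` applied to (A.4):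
  `Θ_q(θ) = 2√(πγ) Σ_{n∈ℤ} e^{−γ(θ−2πn)²}` (`theta_eq_periodicGaussian`), `S_q(θ) = 2γ√(πγ) Σ_{n∈ℤ} (θ − 2πn)
  e^{−γ(θ−2πn)²}` (`S_eq_periodicGaussian`), hence with `𝒩′ = 2γ√(πγ)𝒩` (`normN'`)
  **`h(θ) sin θ = 𝒩′ Σ_{n∈ℤ} (θ − 2πn) e^{−γ(θ−2πn)²}`** (`h_mul_sin_eq_periodicGaussian`) and, the squares expanded,
  **(A.7)** `h(θ) sin θ = 𝒩′ e^{−γθ²}{θ + 2Σ_{n≥1}[θ cosh 4πγnθ − 2πn sinh 4πγnθ] e^{−4π²γn²}}` (`h_mul_sin_eq_A7`).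
* §11 (v1.2) — «the positive normalization factor 𝒩 determined by h(0) = 1» IN CLOSED FORM: `S′_q = Σ_{l≥1} l² q^{l²}
  cos lθ` (`hasDerivAt_S`, termwise), `hk_q(0) = Σ_{l≥1} l² q^{l²}` (`hk_zero_eq`, differentiating `hk_q sin = S_q`
  at `0`; `= Σ_j (2j+1)² e^{−(j+½)²/γ} = Σ_j (2j+1)e^{−(j+½)²/γ}χ_j(e₀)` of (2.20)/(2.1)), so
  **`𝒩 = (Σ_{l≥1} l² e^{−l²/(4γ)})⁻¹`** (`normN_eq`) and `𝒩′ = 2γ√(πγ)(Σ_{l≥1} l² e^{−l²/(4γ)})⁻¹` (`normN'_eq`).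
* §12 (v1.2) — **(A.9)**, «the constant 𝒩′ determined by normalization of (A.7)», IN CLOSED FORM: the first-moment
  series of §10 is differentiable at `0` term by term (`hasDerivAt_periodicMoment_zero`, dominated differentiation on
  `|θ| < 1` with the summable majorant `3e^{γ/2}e^{−γ|n|/2}`), whence, comparing with `S′_q(0) = hk_q(0) = 𝒩⁻¹`,
  **`𝒩′ = (Σ_{n∈ℤ} (1 − 8π²γn²) e^{−4π²γn²})⁻¹`** (`normN'_eq_inv_tsum`; in (A.7) at `θ → 0`: `cosh → 1`,
  `2πnθ⁻¹ sinh 4πnγθ → 8π²γn²`), and the ONE-SIDED form of (A.9): **`𝒩′ ≥ 1` for `γ ≥ 1/(8π²)`** (`one_le_normN'`;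
  every `n ≠ 0` term is `≤ 0`).
* §13 (v1.3) — **(A.9) «𝒩′ = 1 + 𝒪(γ exp{−4π²γ})» TWO-SIDED WITH AN EXPLICIT CONSTANT: `𝒩′ ≤ 1 + 64π² γ e^{−4π²γ}` for
  `γ ≥ 1`** (`normN'_le`): splitting the `ℤ`-series at `n = 0` (`tsum_of_add_one_of_neg_add_one`, evenness),
  `𝒩′⁻¹ = 1 + 2Σ_{n≥0} (1 − 8π²γ(n+1)²)e^{−4π²γ(n+1)²} ≥ 1 − 16π²γ Σ_{n≥0} (n+1)²e^{−4π²γ(n+1)²} ≥ 1 − 32π²γe^{−4π²γ}`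
  by the geometric majorant `(n+1)² e^{−4π²γ(n+1)²} ≤ e^{−4π²γ}(4e^{−8π²})ⁿ` (`(n+1)² ≤ 4ⁿ`, `γ((n+1)² − 1) ≥ 2n`,
  `Σ (4e^{−8π²})ⁿ ≤ 2`), and `32π²γe^{−4π²γ} ≤ ½` (`64π²γ ≤ e^{4π²γ}`), so `𝒩′ ≤ (1 − ε)⁻¹ ≤ 1 + 2ε`.

* §14 (v1.4) — Taylor polynomials with remainders from the even/odd power series (`Real.hasSum_cosh/sinh/sin` and
  `(2n)!·k! ≤ (2n+k)!`): `|cosh x − (1 + x²/2 + x⁴/24 + x⁶/720)| ≤ x⁸ cosh x/8!`, `|sinh x − (x + ⋯ + x⁷/5040)| ≤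
  |x|⁹ cosh x/9!`, `|sin x − (x − ⋯ − x⁷/5040)| ≤ |x|⁹ cosh x/9!` (`abs_tsum_tail_le`, `abs_cosh_sub_taylor_le`,
  `abs_sinh_sub_taylor_le`, `abs_sin_sub_taylor_le`).
* §15 (v1.4) — the brace of (A.7), `θ{1 + 2Σ_{n≥1}[cosh 4πγnθ − 2πnθ⁻¹ sinh 4πnγθ]e^{−4π²γn²}} = θ + 2T(θ)` (`braceT`,
  `h_mul_sin_eq_braceT`; `a_n = 4πγ(n+1)`, `s_n = 8π²γ(n+1)²`, `w_n = e^{−4π²γ(n+1)²}`), EXPANDED TERMWISE TO ORDER `θ⁶`: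
  `|θ + 2T(θ) − θ(1 + b₀ + b₁θ² + b₂θ⁴ + b₃θ⁶)| ≤ K|θ|⁹` on `|θ| ≤ 1` (`abs_brace_sub_poly_le`) with the Taylor
  coefficients `b_j = 2Σ_n a_n^{2j}/(2j)!·(1 − s_n/(2j+1))·w_n` (`bcoef`) and an explicit `K = K(γ)` (`remK`); every
  series converges because Gaussian decay beats any exponential (`summable_pow_mul_exp_mul_wSeq`).
* §16 (v1.4) — **LEMMA (iii)**: with `c_j = 𝒩′b_j` (`ccoef`; `𝒩′(1 + b₀) = 1` is `h(0) = 1`, `normN'_mul_one_add_bcoef_zero`)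
  and **`ρ₁ = −c₁`, `ρ₂ = c₁² − 2c₂`, `ρ₃ = −3c₃ + 3c₁c₂ − c₁³`** (`rho1`, `rho2`, `rho3`): for every `γ > 0` there are
  `θ₀ > 0`, `C` with **`|−ln h(θ) − [(γ − ⅙ + ρ₁)θ² + ½(−1/90 + ρ₂)θ⁴ + ⅓(−1/945 + ρ₃)θ⁶]| ≤ Cθ⁸` for `|θ| ≤ θ₀`**
  (`abs_neg_log_h_sub_taylor_le`), hence `= O(θ⁸)` at `θ → 0` (`neg_log_h_taylor_isBigO`). Route, as printed («From (A.7)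
  we read off (iii)»): `−ln h = γθ² + ln(sin θ/θ) − ln(1 + c₁θ² + c₂θ⁴ + c₃θ⁶ + O(θ⁸))`, `ln(sin θ/θ) = −θ²/6 − θ⁴/180
  − θ⁶/2835 + O(θ⁸)` (`abs_log_sin_div_add_le`, remainder `≤ θ⁸/400` on `0 < |θ| ≤ 1`), `ln(1 + u) = u − u²/2 + u³/3 +
  O(u⁴)` (`Real.abs_log_sub_add_sum_range_le`).
* §17 (v1.4) — **«ρ_j = O(γ^{2j+1}e^{−4π²γ}) for γ → ∞»**, explicit for `γ ≥ 1`: `|b_j| ≤ C_b(j)γ^{2j+1}e^{−4π²γ}`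
  (`abs_bcoef_le`, `j ≤ 3`, `C_b(j) = 483840·16π²(4π)^{2j}/(2j)!`, by `|1 − s_n/(2j+1)| ≤ 2s_n` and
  `Σ(n+1)^k w_n ≤ 8!·6·e^{−4π²γ}`, `k ≤ 8`), `𝒩′ ≤ 2` (`normN'_le_two`), so **`|ρ₁| ≤ 2C_b(1)γ³e^{−4π²γ}`,
  `|ρ₂| ≤ (4C_b(1)² + 4C_b(2))γ⁵e^{−4π²γ}`, `|ρ₃| ≤ (6C_b(3) + 12C_b(1)C_b(2) + 8C_b(1)³)γ⁷e^{−4π²γ}`** (`abs_rho1_le`,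
  `abs_rho2_le`, `abs_rho3_le`; `γe^{−4π²γ} ≤ 1` absorbs the products) and `ρ_j =O[atTop] γ^{2j+1}e^{−4π²γ}`
  (`rho1_isBigO`, `rho2_isBigO`, `rho3_isBigO`).

**Readings (declared).** (a) The print proves (ii) by reading (A.5) as a sum of products of positive factors each
decreasing on `(0, π)`; here the same derivative is computed through the logarithm of the product, `hk′_q = Θ_q(L′_q
R_q + R′_q) = −2 sin θ · Θ_q · ((Σ aₘ)² − Σ aₘ²)`, negative on `(0, π)` because at least two `aₘ` are positive — this
gives STRICT decrease, which «decreases monotonously» allows. (b) `h` is realised as `𝒩 · Θ_q R_q`, defined and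
differentiable for every REAL `θ`; that it is the function of (A.1) is `h_mul_sin` / `h_eq_div`, that it is (A.5) is
`h_eq_A5`; holomorphy in complex `θ` («entire holomorphic function») is not formalized. (c) The identification of
(A.1) with (2.20) — `l = 2j + 1`, `χ_j(u) = sin lθ / sin θ` at central angle `θ` (`u₀ = cos θ`), `e^{−(j+½)²/γ} =
e^{−l²/(4γ)} = q^{l²}` (`nome_pow_sq`) — is the print's «From (2.20) we obtain (A.1)» and is recorded, not re-derived
from a character theory of `SU(2)` (the tree's `QuantumLattice.HeatKernelGroup` keeps group heat kernels as a
hypothesis structure, with only the `U(1)` kernel explicit). (d) Hille's `ϑ₃(z, q) = 1 + 2Σ q^{n²} cos 2nz`, so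
`ϑ₃(θ/2, q) = Θ_q(θ)`; Mathlib's `jacobiTheta₂ z τ` is `ϑ₃(πz | τ)` (`theta_eq_jacobiTheta₂`).

**Readings (declared), continued.** (e) In (iii) the print does not say for which `θ` the `O(θ⁸)` holds nor whether
it is uniform in `γ`; here it is the Taylor remainder at `θ → 0` for each fixed `γ > 0` (the constant `C` of
`abs_neg_log_h_sub_taylor_le` depends on `γ`), and the `ρ_j` are DEFINED as the explicit coefficient combinations that
the computation «from (A.7)» produces (`rho1`–`rho3`); that these are the printed `ρ_j` is the content of the expansion
theorem (Taylor coefficients of `−ln h` at `0` are unique).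

**Not claimed.** Part (iv) of the Lemma, (A.7)–(A.8) for COMPLEX `θ` in the strips `𝒟`, `𝒟̌` (v1.1 gives
them on the real axis), (A.9) for `γ < 1` beyond `𝒩′ ≥ 1` (v1.3's two-sided bound is stated for `γ ≥ 1`, the print's
«large values of γ»), the `ρ_j`-rates for `γ < 1` (§17 is stated for `γ ≥ 1`, the print's «γ → ∞»), the large-`γ`
bounds (A.10)–(A.11), the induction hypotheses (A₁)–(A₃) for `g_HK` (last paragraph of the Appendix), holomorphy in
complex `θ`, the character expansion (2.20) ⇒ (A.1) itself (reading (c)), anything about the Wilson action (2.5), the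
Migdal recursion, or lattice Yang–Mills.

v1.1 (p12 gen 17, same day): §9–§10 APPENDED; §§0–8 byte-identical to v1.0 (p336653); module docstring extended.
v1.2 (p12 gen 17, same day): §11–§12 APPENDED (theorems only); §§0–10 byte-identical to v1.1 (p337442); module
docstring extended and its quotation of (A.9) corrected to the printed «𝒩′ = 1 + 𝒪(γ exp{−4π²γ})».
v1.3 (p12 gen 17, same day): §13 APPENDED (theorems only); §§0–12 byte-identical to v1.2 (p338117); module docstring
extended.
v1.4 (p12 gen 18, same day): §14–§17 APPENDED (defs `aSeq`, `sSeq`, `wSeq`, `braceT`, `bcoef`, `remK`, `ccoef`, `rho1`–`rho3`,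
`Cb` and theorems); §§0–13 byte-identical to v1.3 (p338637); module docstring extended (title, §14–§17 bullets, reading (e),
«Not claimed» narrowed from «Parts (iii)–(iv)» to «Part (iv)»).
-/

noncomputable section

open Real Filter Topology Set

namespace Literature.MathematicalPhysics.QuantumFieldTheory

namespace MullerSchiemann1987

namespace HeatKernel

/-! ## §0 The nome (A.2) and geometric summability -/

/-- (A.2) `q = exp{−1/(4γ)}`. [cite: MullerSchiemann1987, Appendix (A.2) p.284] -/
def nome (γ : ℝ) : ℝ := Real.exp (-(1 / (4 * γ)))

/-- `q > 0`. [cite: MullerSchiemann1987, Appendix (A.2) p.284] -/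
theorem nome_pos (γ : ℝ) : 0 < nome γ := Real.exp_pos _

/-- `q < 1` for `γ > 0`. [cite: MullerSchiemann1987, Appendix (A.2) p.284] -/
theorem nome_lt_one {γ : ℝ} (hγ : 0 < γ) : nome γ < 1 :=
  Real.exp_lt_one_iff.mpr (neg_lt_zero.mpr (by positivity))

/-- `q^{l²} = e^{−l²/(4γ)}`: the weights of (A.1) written in the nome (A.2).
[cite: MullerSchiemann1987, Appendix (A.1)–(A.3) p.284] -/
theorem nome_pow_sq (γ : ℝ) (l : ℕ) : nome γ ^ (l ^ 2) = Real.exp (-((l : ℝ) ^ 2 / (4 * γ))) := by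
  rw [nome, ← Real.exp_nat_mul]
  congr 1
  push_cast
  ring

variable {q : ℝ}

/-- `Σₙ q^{e(n)}` converges for `0 ≤ q < 1` and exponents `e(n) ≥ n`. [folklore] -/
private theorem summable_pow_of_le (hq0 : 0 ≤ q) (hq1 : q < 1) {e : ℕ → ℕ} (he : ∀ n, n ≤ e n) :
    Summable fun n : ℕ => q ^ e n :=
  Summable.of_nonneg_of_le (fun _ => pow_nonneg hq0 _)
    (fun n => pow_le_pow_of_le_one hq0 hq1.le (he n)) (summable_geometric_of_lt_one hq0 hq1)

/-! ## §1 The factors of (A.5): `1 + 2q^{2m+1} cos θ + q^{4m+2}` -/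

/-- The `m`-th factor of the product representation (A.5) as a function of `c = cos θ`
(indexed from `m = 0`; the print's `1 + 2q^{2m−1} cos θ + q^{4m−2}`, `m ≥ 1`).
[cite: MullerSchiemann1987, Appendix (A.5) p.285] -/
def fac (q : ℝ) (m : ℕ) (c : ℝ) : ℝ := 1 + 2 * q ^ (2 * m + 1) * c + q ^ (4 * m + 2)

/-- `fac = (1 − q^{2m+1})² + 2q^{2m+1}(1 + c)`. [cite: MullerSchiemann1987, Appendix (A.5) p.285] -/
theorem fac_eq_sq_add (q : ℝ) (m : ℕ) (c : ℝ) :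
    fac q m c = (1 - q ^ (2 * m + 1)) ^ 2 + 2 * q ^ (2 * m + 1) * (1 + c) := by
  unfold fac; ring

/-- `fac = 1 + (2q^{2m+1}c + q^{4m+2})`. [cite: MullerSchiemann1987, Appendix (A.5) p.285] -/
theorem fac_eq_one_add (q : ℝ) (m : ℕ) (c : ℝ) :
    fac q m c = 1 + (2 * q ^ (2 * m + 1) * c + q ^ (4 * m + 2)) := by
  unfold fac; ring

/-- `q^{2m+1} ≤ q` for `0 ≤ q < 1`. [folklore] -/
private theorem pow_odd_le (hq0 : 0 ≤ q) (hq1 : q < 1) (m : ℕ) : q ^ (2 * m + 1) ≤ q := by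
  simpa using pow_le_pow_of_le_one hq0 hq1.le (show 1 ≤ 2 * m + 1 by omega)

/-- The uniform lower bound `(1 − q)² ≤ 1 + 2q^{2m+1}c + q^{4m+2}` for `c ≥ −1` («each factor is strictly
positive ∀θ ∈ ℝ»). [cite: MullerSchiemann1987, Appendix p.285 L.6] -/
theorem sq_le_fac (hq0 : 0 ≤ q) (hq1 : q < 1) (m : ℕ) {c : ℝ} (hc : -1 ≤ c) :
    (1 - q) ^ 2 ≤ fac q m c := by
  rw [fac_eq_sq_add]
  have h1 : q ^ (2 * m + 1) ≤ q := pow_odd_le hq0 hq1 m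
  have h2 : 0 ≤ q ^ (2 * m + 1) := pow_nonneg hq0 _
  nlinarith [mul_nonneg (sub_nonneg.mpr h1) (sub_nonneg.mpr hq1.le),
    mul_nonneg (sub_nonneg.mpr h1) (sub_nonneg.mpr (h1.trans hq1.le)),
    mul_nonneg h2 (by linarith : (0 : ℝ) ≤ 1 + c)]

/-- «each factor is strictly positive ∀θ ∈ ℝ» (here for every `c ≥ −1`).
[cite: MullerSchiemann1987, Appendix p.285 L.6] -/
theorem fac_pos (hq0 : 0 ≤ q) (hq1 : q < 1) (m : ℕ) {c : ℝ} (hc : -1 ≤ c) : 0 < fac q m c :=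
  lt_of_lt_of_le (by have := sub_pos.mpr hq1; positivity) (sq_le_fac hq0 hq1 m hc)

/-- The factors at `c = cos θ` are positive. [cite: MullerSchiemann1987, Appendix p.285 L.6] -/
theorem fac_cos_pos (hq0 : 0 ≤ q) (hq1 : q < 1) (m : ℕ) (θ : ℝ) : 0 < fac q m (Real.cos θ) :=
  fac_pos hq0 hq1 m (Real.neg_one_le_cos θ)

/-- Each factor increases with `c = cos θ`, i.e. «decreases in (0, π)» as a function of `θ`.
[cite: MullerSchiemann1987, Appendix p.285 L.6] -/
theorem fac_mono (hq0 : 0 ≤ q) (m : ℕ) : Monotone (fac q m) := fun c₁ c₂ h => by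
  unfold fac
  have := pow_nonneg hq0 (2 * m + 1)
  nlinarith

/-! ## §2 (A.6) `q₀ = Π (1 − q^{2n})` and the convergence of the products -/

/-- (A.6) `q₀ = Π_{n ≥ 1} (1 − q^{2n})` (indexed from `0`: `Π_{n ≥ 0} (1 − q^{2n+2})`).
[cite: MullerSchiemann1987, Appendix (A.6) p.285] -/
def q0 (q : ℝ) : ℝ := ∏' n : ℕ, (1 - q ^ (2 * n + 2))

/-- `0 < 1 − q^{2n+2}`. [folklore] -/
private theorem one_sub_pow_pos (hq0 : 0 ≤ q) (hq1 : q < 1) (n : ℕ) : 0 < 1 - q ^ (2 * n + 2) :=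
  sub_pos.mpr (pow_lt_one₀ hq0 hq1 (by omega))

/-- `Σ log(1 − q^{2n+2})` converges. [folklore] -/
private theorem summable_log_one_sub_pow (hq0 : 0 ≤ q) (hq1 : q < 1) :
    Summable fun n : ℕ => Real.log (1 - q ^ (2 * n + 2)) := by
  have h := Real.summable_log_one_add_of_summable
    ((summable_pow_of_le hq0 hq1 (e := fun n => 2 * n + 2) (fun n => by omega)).neg)
  simpa [sub_eq_add_neg] using h

/-- (A.6) as a convergent product: `q₀ = exp Σ log(1 − q^{2n+2})`. [cite: MullerSchiemann1987, Appendix (A.6) p.285] -/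
theorem q0_eq_exp (hq0 : 0 ≤ q) (hq1 : q < 1) :
    q0 q = Real.exp (∑' n : ℕ, Real.log (1 - q ^ (2 * n + 2))) :=
  (Real.rexp_tsum_eq_tprod (one_sub_pow_pos hq0 hq1) (summable_log_one_sub_pow hq0 hq1)).symm

/-- `q₀ > 0`. [cite: MullerSchiemann1987, Appendix (A.5)–(A.6) p.285] -/
theorem q0_pos (hq0 : 0 ≤ q) (hq1 : q < 1) : 0 < q0 q := by
  rw [q0_eq_exp hq0 hq1]; exact Real.exp_pos _

/-- The product (A.6) `Π (1 − q^{2n+2})` converges. [cite: MullerSchiemann1987, Appendix (A.6) p.285] -/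
theorem multipliable_one_sub_pow (hq0 : 0 ≤ q) (hq1 : q < 1) :
    Multipliable fun n : ℕ => 1 - q ^ (2 * n + 2) :=
  Real.multipliable_of_summable_log (one_sub_pow_pos hq0 hq1) (summable_log_one_sub_pow hq0 hq1)

/-- `Σₘ (2q^{2m+1}c + q^{4m+2})` converges. [folklore] -/
private theorem summable_fac_sub_one (hq0 : 0 ≤ q) (hq1 : q < 1) (c : ℝ) :
    Summable fun m : ℕ => 2 * q ^ (2 * m + 1) * c + q ^ (4 * m + 2) := by
  have h1 : Summable fun m : ℕ => q ^ (2 * m + 1) := summable_pow_of_le hq0 hq1 fun n => by omega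
  have h2 : Summable fun m : ℕ => q ^ (4 * m + 2) := summable_pow_of_le hq0 hq1 fun n => by omega
  simpa [mul_assoc, mul_comm, mul_left_comm] using ((h1.mul_left 2).mul_right c).add h2

/-- `Σₘ log(1 + 2q^{2m+1}c + q^{4m+2})` converges (any real `c`; Mathlib's `log` is total). [folklore] -/
private theorem summable_log_fac (hq0 : 0 ≤ q) (hq1 : q < 1) (c : ℝ) :
    Summable fun m : ℕ => Real.log (fac q m c) := by
  have h := Real.summable_log_one_add_of_summable (summable_fac_sub_one hq0 hq1 c)
  simp_rw [fac_eq_one_add]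
  exact h

/-- The product `Πₘ (1 + 2q^{2m+1}c + q^{4m+2})` converges (`c ≥ −1`).
[cite: MullerSchiemann1987, Appendix (A.5) p.285] -/
theorem multipliable_fac (hq0 : 0 ≤ q) (hq1 : q < 1) {c : ℝ} (hc : -1 ≤ c) :
    Multipliable fun m : ℕ => fac q m c :=
  Real.multipliable_of_summable_log (fun m => fac_pos hq0 hq1 m hc) (summable_log_fac hq0 hq1 c)

/-- The product of (A.5) as `exp Σ log`: `Πₘ fac = exp Σₘ log fac`. [cite: MullerSchiemann1987, Appendix (A.5) p.285] -/
theorem tprod_fac_eq_exp (hq0 : 0 ≤ q) (hq1 : q < 1) {c : ℝ} (hc : -1 ≤ c) :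
    ∏' m : ℕ, fac q m c = Real.exp (∑' m : ℕ, Real.log (fac q m c)) :=
  (Real.rexp_tsum_eq_tprod (fun m => fac_pos hq0 hq1 m hc) (summable_log_fac hq0 hq1 c)).symm

/-- `Πₘ fac > 0`. [cite: MullerSchiemann1987, Appendix p.285 L.6] -/
theorem tprod_fac_pos (hq0 : 0 ≤ q) (hq1 : q < 1) {c : ℝ} (hc : -1 ≤ c) :
    0 < ∏' m : ℕ, fac q m c := by
  rw [tprod_fac_eq_exp hq0 hq1 hc]; exact Real.exp_pos _

/-! ## §3 (A.3)–(A.6): the cosine series `Θ` and Jacobi's triple product -/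

/-- The bracket of (A.3): `Θ_q(θ) = 1 + 2 Σ_{l ≥ 1} q^{l²} cos lθ` — Hille's `ϑ₃(θ/2, q)` of (A.4)
(index shifted: `l = l' + 1`). [cite: MullerSchiemann1987, Appendix (A.3)–(A.4) p.284] -/
def theta (q θ : ℝ) : ℝ := 1 + 2 * ∑' l : ℕ, q ^ ((l + 1) ^ 2) * Real.cos ((l + 1) * θ)

/-- The cosine series of (A.3) converges absolutely (`|q^{l²} cos lθ| ≤ q^{l²} ≤ q^l`). [cite: MullerSchiemann1987, Appendix (A.3) p.284] -/
theorem summable_theta_term (hq0 : 0 ≤ q) (hq1 : q < 1) (θ : ℝ) :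
    Summable fun l : ℕ => q ^ ((l + 1) ^ 2) * Real.cos ((l + 1) * θ) := by
  refine Summable.of_norm_bounded
    (summable_pow_of_le hq0 hq1 (e := fun l => (l + 1) ^ 2)
      (fun n => (Nat.le_succ n).trans (Nat.le_self_pow two_ne_zero _))) (fun l => ?_)
  rw [norm_mul, norm_pow, Real.norm_of_nonneg hq0, Real.norm_eq_abs]
  exact mul_le_of_le_one_right (pow_nonneg hq0 _) (Real.abs_cos_le_one _)

/-- `((Π' f : ℝ) : ℂ) = Π' (f : ℂ)` for a multipliable real sequence. [folklore] -/
private theorem ofReal_tprod {f : ℕ → ℝ} (hf : Multipliable f) :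
    (((∏' n, f n : ℝ)) : ℂ) = ∏' n, ((f n : ℝ) : ℂ) := by
  have h := hf.hasProd.map Complex.ofRealHom Complex.continuous_ofReal
  simpa [Function.comp_def] using h.tprod_eq.symm

/-- The general factor of Jacobi's triple product at a REAL nome `q` and `w = e^{iθ}` is the real number
`(1 − q^{2n+2})(1 + 2q^{2n+1} cos θ + q^{4n+2})`. [cite: MullerSchiemann1987, Appendix (A.4)–(A.5) p.284–285] -/
theorem tripleProduct_factor_eq (q θ : ℝ) (n : ℕ) :
    (1 - (q : ℂ) ^ (2 * n + 2)) * (1 + (q : ℂ) ^ (2 * n + 1) * Complex.exp (θ * Complex.I)) *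
        (1 + (q : ℂ) ^ (2 * n + 1) * (Complex.exp (θ * Complex.I))⁻¹)
      = (((1 - q ^ (2 * n + 2)) * fac q n (Real.cos θ) : ℝ) : ℂ) := by
  set w : ℂ := Complex.exp (θ * Complex.I) with hw
  have hww : w * Complex.exp (-(θ * Complex.I)) = 1 := by
    rw [hw, ← Complex.exp_add, add_neg_cancel, Complex.exp_zero]
  have hwinv : w⁻¹ = Complex.exp (-(θ * Complex.I)) := by rw [hw, Complex.exp_neg]
  have hcos : w + Complex.exp (-(θ * Complex.I)) = 2 * (Real.cos θ : ℂ) := by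
    rw [Complex.ofReal_cos, Complex.two_cos, neg_mul]
  have e1 : (1 + (q : ℂ) ^ (2 * n + 1) * w) * (1 + (q : ℂ) ^ (2 * n + 1) * w⁻¹)
      = 1 + (q : ℂ) ^ (2 * n + 1) * (w + w⁻¹) + ((q : ℂ) ^ (2 * n + 1)) ^ 2 * (w * w⁻¹) := by ring
  rw [mul_assoc, e1, hwinv, hww, hcos, fac]
  push_cast
  ring

/-- **(A.4)–(A.6), product side**: with `q` real and `w = e^{iθ}`, Jacobi's triple product
`Π (1 − q^{2n})(1 + q^{2n−1}w)(1 + q^{2n−1}w⁻¹)` is the real number `q₀ · Πₘ (1 + 2q^{2m−1} cos θ + q^{4m−2})`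
(«From the product representation of ϑ₃, [14]»). [cite: MullerSchiemann1987, Appendix (A.5)–(A.6) p.285] -/
theorem tripleProduct_eq_ofReal (hq0 : 0 ≤ q) (hq1 : q < 1) (θ : ℝ) :
    (∏' n : ℕ, (1 - (q : ℂ) ^ (2 * n + 2)) * (1 + (q : ℂ) ^ (2 * n + 1) * Complex.exp (θ * Complex.I)) *
        (1 + (q : ℂ) ^ (2 * n + 1) * (Complex.exp (θ * Complex.I))⁻¹))
      = (((q0 q * ∏' m : ℕ, fac q m (Real.cos θ)) : ℝ) : ℂ) := by
  have hg : Multipliable fun n : ℕ => (1 - q ^ (2 * n + 2)) * fac q n (Real.cos θ) :=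
    (multipliable_one_sub_pow hq0 hq1).mul (multipliable_fac hq0 hq1 (Real.neg_one_le_cos θ))
  rw [tprod_congr (tripleProduct_factor_eq q θ), ← ofReal_tprod hg, q0,
    ← (multipliable_one_sub_pow hq0 hq1).tprod_mul (multipliable_fac hq0 hq1 (Real.neg_one_le_cos θ))]

/-- **(A.3)–(A.4), series side**: with `q` real, `0 < q < 1`, and `w = e^{iθ}`, `Σ_{n ∈ ℤ} q^{n²} wⁿ` converges
to the real number `Θ_q(θ) = 1 + 2Σ_{l≥1} q^{l²} cos lθ`. [cite: MullerSchiemann1987, Appendix (A.3)–(A.4) p.284] -/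
theorem hasSum_int_theta (hq0 : 0 < q) (hq1 : q < 1) (θ : ℝ) :
    HasSum (fun n : ℤ => (q : ℂ) ^ (n ^ 2) * Complex.exp (θ * Complex.I) ^ n) ((theta q θ : ℝ) : ℂ) := by
  set Q : ℂ := (q : ℂ) with hQ
  set w : ℂ := Complex.exp (θ * Complex.I) with hw
  have hQn : ‖Q‖ < 1 := by
    rw [hQ, Complex.norm_real, Real.norm_of_nonneg hq0.le]; exact hq1
  have hQ0 : Q ≠ 0 := by rw [hQ]; exact_mod_cast hq0.ne'
  have hw0 : w ≠ 0 := Complex.exp_ne_zero _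
  have htp := Literature.Analysis.SpecialFunctions.hasSum_jacobi_triple_product hQn hQ0 hw0
  set F : ℤ → ℂ := fun n => Q ^ (n ^ 2) * w ^ n with hF
  have hFs : Summable F := htp.summable
  have h1 : Summable fun l : ℕ => F ((l : ℤ) + 1) :=
    hFs.comp_injective (i := fun l : ℕ => (l : ℤ) + 1) fun a b h => by simpa using h
  have h2 : Summable fun l : ℕ => F (-((l : ℤ) + 1)) :=
    hFs.comp_injective (i := fun l : ℕ => -((l : ℤ) + 1)) fun a b h => by simpa using h
  have hF0 : F 0 = 1 := by simp [hF]
  -- pair the terms `l + 1` and `−(l + 1)`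
  have hpair : ∀ l : ℕ, F ((l : ℤ) + 1) + F (-((l : ℤ) + 1))
      = ((2 * (q ^ ((l + 1) ^ 2) * Real.cos ((l + 1) * θ)) : ℝ) : ℂ) := by
    intro l
    have hz : ((l : ℤ) + 1) = ((l + 1 : ℕ) : ℤ) := by push_cast; ring
    have hsq : ((l : ℤ) + 1) ^ 2 = (((l + 1) ^ 2 : ℕ) : ℤ) := by push_cast; ring
    have hwl : w ^ (l + 1) = Complex.exp (((l : ℂ) + 1) * (θ * Complex.I)) := by
      rw [hw, ← Complex.exp_nat_mul]; push_cast; ring_nf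
    have hcosl : w ^ (l + 1) + (w ^ (l + 1))⁻¹ = 2 * (Real.cos (((l : ℝ) + 1) * θ) : ℂ) := by
      rw [hwl, ← Complex.exp_neg, Complex.ofReal_cos, Complex.two_cos]
      push_cast
      congr 1 <;> (congr 1; ring)
    calc F ((l : ℤ) + 1) + F (-((l : ℤ) + 1))
        = Q ^ ((l + 1) ^ 2) * w ^ (l + 1) + Q ^ ((l + 1) ^ 2) * (w ^ (l + 1))⁻¹ := by
          simp only [hF]
          rw [neg_sq, hsq, zpow_natCast, zpow_neg, hz, zpow_natCast]
      _ = Q ^ ((l + 1) ^ 2) * (w ^ (l + 1) + (w ^ (l + 1))⁻¹) := by ring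
      _ = ((2 * (q ^ ((l + 1) ^ 2) * Real.cos ((l + 1) * θ)) : ℝ) : ℂ) := by
          rw [hcosl, hQ]; push_cast; ring
  have hmm : (∑' l : ℕ, F ((l : ℤ) + 1)) + ∑' l : ℕ, F (-((l : ℤ) + 1))
      = (((2 * ∑' l : ℕ, q ^ ((l + 1) ^ 2) * Real.cos ((l + 1) * θ)) : ℝ) : ℂ) := by
    rw [← h1.tsum_add h2, tsum_congr hpair, ← Complex.ofReal_tsum, tsum_mul_left]
  convert h1.hasSum.of_add_one_of_neg_add_one h2.hasSum using 1
  rw [hF0, add_right_comm, hmm, theta]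
  push_cast
  ring

/-- **(A.3)–(A.6): `Θ_q(θ) = q₀ · Πₘ (1 + 2q^{2m+1} cos θ + q^{4m+2})`** — the cosine series of (A.3) equals
Hille's product for `ϑ₃(θ/2, q)` («Equation (A.1) can be expressed in terms of the theta-function ϑ₃, [14] …
From the product representation of ϑ₃, [14], we obtain (A.5), (A.6)»), by the tree's Jacobi triple product
`Literature.Analysis.SpecialFunctions.hasSum_jacobi_triple_product` at the real nome `q` and `w = e^{iθ}`.
[cite: MullerSchiemann1987, Appendix (A.3)–(A.6) pp.284–285] -/
theorem theta_eq_q0_mul_tprod (hq0 : 0 < q) (hq1 : q < 1) (θ : ℝ) :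
    theta q θ = q0 q * ∏' m : ℕ, fac q m (Real.cos θ) := by
  have hQn : ‖(q : ℂ)‖ < 1 := by
    rw [Complex.norm_real, Real.norm_of_nonneg hq0.le]; exact hq1
  have hQ0 : (q : ℂ) ≠ 0 := by exact_mod_cast hq0.ne'
  have hw0 : Complex.exp (θ * Complex.I) ≠ 0 := Complex.exp_ne_zero _
  have htp := Literature.Analysis.SpecialFunctions.hasSum_jacobi_triple_product hQn hQ0 hw0
  have h := (hasSum_int_theta hq0 hq1 θ).unique htp
  rw [tripleProduct_eq_ofReal hq0.le hq1 θ] at h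
  exact_mod_cast h

/-- `Θ_q = q₀ · exp Σₘ log(1 + 2q^{2m+1} cos θ + q^{4m+2})`. [cite: MullerSchiemann1987, Appendix (A.5)–(A.6) p.285] -/
theorem theta_eq_q0_mul_exp (hq0 : 0 < q) (hq1 : q < 1) (θ : ℝ) :
    theta q θ = q0 q * Real.exp (∑' m : ℕ, Real.log (fac q m (Real.cos θ))) := by
  rw [theta_eq_q0_mul_tprod hq0 hq1, ← tprod_fac_eq_exp hq0.le hq1 (Real.neg_one_le_cos θ)]

/-- **`Θ_q(θ) > 0` for all real `θ`** (`ϑ₃(θ/2, q) > 0`: «each factor is strictly positive ∀θ ∈ ℝ»).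
[cite: MullerSchiemann1987, Appendix p.285 L.6] -/
theorem theta_pos (hq0 : 0 < q) (hq1 : q < 1) (θ : ℝ) : 0 < theta q θ := by
  rw [theta_eq_q0_mul_tprod hq0 hq1]
  exact mul_pos (q0_pos hq0.le hq1) (tprod_fac_pos hq0.le hq1 (Real.neg_one_le_cos θ))

/-- `Θ_q(θ)` depends on `θ` only through `cos θ`. [cite: MullerSchiemann1987, Appendix (A.5) p.285] -/
theorem theta_congr_cos (hq0 : 0 < q) (hq1 : q < 1) {θ₁ θ₂ : ℝ} (h : Real.cos θ₁ = Real.cos θ₂) :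
    theta q θ₁ = theta q θ₂ := by
  rw [theta_eq_q0_mul_tprod hq0 hq1, theta_eq_q0_mul_tprod hq0 hq1, h]

/-- **(A.4)**: `Θ_q(θ) = ϑ₃(θ/2, q)` — in Mathlib's normalisation `jacobiTheta₂ z τ = Σₙ e^{2πinz + πin²τ}`
this reads `Θ_q(θ) = jacobiTheta₂ (θ/2π) (i/(4πγ))` for the nome `q = e^{−1/(4γ)} = e^{πiτ}`, `τ = i/(4πγ)`.
[cite: MullerSchiemann1987, Appendix (A.2)–(A.4) p.284] -/
theorem theta_eq_jacobiTheta₂ {γ : ℝ} (hγ : 0 < γ) (θ : ℝ) :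
    ((theta (nome γ) θ : ℝ) : ℂ) = jacobiTheta₂ (θ / (2 * π)) (Complex.I / (4 * π * γ)) := by
  have hπ : (π : ℂ) ≠ 0 := Complex.ofReal_ne_zero.mpr Real.pi_ne_zero
  have hγ' : (γ : ℂ) ≠ 0 := Complex.ofReal_ne_zero.mpr hγ.ne'
  have hq : Complex.exp (π * Complex.I * (Complex.I / (4 * π * γ))) = (nome γ : ℂ) := by
    rw [nome, Complex.ofReal_exp]
    congr 1
    have e : (π : ℂ) * Complex.I * (Complex.I / (4 * π * γ))
        = Complex.I * Complex.I * (π / (4 * π * γ)) := by ring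
    rw [e, Complex.I_mul_I]
    push_cast
    field_simp
  have hw : Complex.exp (2 * π * Complex.I * (θ / (2 * π))) = Complex.exp (θ * Complex.I) := by
    congr 1
    field_simp
  rw [jacobiTheta₂, ← (hasSum_int_theta (nome_pos γ) (nome_lt_one hγ) θ).tsum_eq]
  refine tsum_congr fun n => ?_
  rw [Literature.Analysis.SpecialFunctions.jacobiTheta₂_term_eq_zpow_mul_zpow, hq, hw]

/-! ## §4 (A.1), (A.3): the sine series `S` and `dΘ/dθ = −2S` -/

/-- `S_q(θ) = Σ_{l ≥ 1} l q^{l²} sin lθ` — the series of (A.1) multiplied by `sin θ` (and without `𝒩`):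
`h(θ) sin θ = 𝒩 S_q(θ)`. [cite: MullerSchiemann1987, Appendix (A.1) p.284] -/
def S (q θ : ℝ) : ℝ := ∑' l : ℕ, ((l : ℝ) + 1) * q ^ ((l + 1) ^ 2) * Real.sin ((l + 1) * θ)

/-- `Σ (l+1) q^{(l+1)²}` converges. [folklore] -/
private theorem summable_succ_mul_pow (hq0 : 0 ≤ q) (hq1 : q < 1) :
    Summable fun l : ℕ => ((l : ℝ) + 1) * q ^ ((l + 1) ^ 2) := by
  have h : Summable fun n : ℕ => (n : ℝ) ^ 1 * q ^ n :=
    summable_pow_mul_geometric_of_norm_lt_one 1 (by rwa [Real.norm_of_nonneg hq0])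
  have h' : Summable fun l : ℕ => (((l + 1 : ℕ) : ℝ)) ^ 1 * q ^ (l + 1) :=
    (summable_nat_add_iff (f := fun n : ℕ => (n : ℝ) ^ 1 * q ^ n) 1).mpr h
  refine Summable.of_nonneg_of_le (fun l => by positivity) (fun l => ?_) h'
  have hle : q ^ ((l + 1) ^ 2) ≤ q ^ (l + 1) :=
    pow_le_pow_of_le_one hq0 hq1.le (Nat.le_self_pow two_ne_zero _)
  have := mul_le_mul_of_nonneg_left hle (by positivity : (0 : ℝ) ≤ (l : ℝ) + 1)
  simpa using this

/-- The sine series of (A.1) converges absolutely (`|l q^{l²} sin lθ| ≤ l q^{l²}`). [cite: MullerSchiemann1987, Appendix (A.1) p.284] -/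
theorem summable_S_term (hq0 : 0 ≤ q) (hq1 : q < 1) (θ : ℝ) :
    Summable fun l : ℕ => ((l : ℝ) + 1) * q ^ ((l + 1) ^ 2) * Real.sin ((l + 1) * θ) := by
  refine Summable.of_norm_bounded (summable_succ_mul_pow hq0 hq1) (fun l => ?_)
  rw [norm_mul, Real.norm_of_nonneg (by positivity), Real.norm_eq_abs]
  exact mul_le_of_le_one_right (by positivity) (Real.abs_sin_le_one _)

/-- **(A.3): `dΘ_q/dθ = −2 S_q`**, i.e. `h(θ) sin θ = 𝒩 S_q(θ) = −(𝒩/2) (d/dθ){1 + 2Σ q^{l²} cos lθ}` (termwise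
differentiation of the uniformly convergent cosine series). [cite: MullerSchiemann1987, Appendix (A.3) p.284] -/
theorem hasDerivAt_theta (hq0 : 0 ≤ q) (hq1 : q < 1) (θ : ℝ) :
    HasDerivAt (theta q) (-2 * S q θ) θ := by
  have hterm : ∀ (l : ℕ) (y : ℝ), HasDerivAt (fun y => q ^ ((l + 1) ^ 2) * Real.cos ((l + 1) * y))
      (-(((l : ℝ) + 1) * q ^ ((l + 1) ^ 2) * Real.sin ((l + 1) * y))) y := by
    intro l y
    have h1 : HasDerivAt (fun y : ℝ => ((l : ℝ) + 1) * y) ((l : ℝ) + 1) y := by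
      simpa using (hasDerivAt_id y).const_mul ((l : ℝ) + 1)
    exact ((h1.cos).const_mul (q ^ ((l + 1) ^ 2))).congr_deriv (by ring)
  have hbound : ∀ (l : ℕ) (y : ℝ),
      ‖-(((l : ℝ) + 1) * q ^ ((l + 1) ^ 2) * Real.sin ((l + 1) * y))‖ ≤ ((l : ℝ) + 1) * q ^ ((l + 1) ^ 2) := by
    intro l y
    rw [norm_neg, norm_mul, Real.norm_of_nonneg (by positivity), Real.norm_eq_abs]
    exact mul_le_of_le_one_right (by positivity) (Real.abs_sin_le_one _)
  have h := hasDerivAt_tsum (summable_succ_mul_pow hq0 hq1) hterm hbound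
    (summable_theta_term hq0 hq1 0) θ
  have h' := (h.const_mul (2 : ℝ)).const_add (1 : ℝ)
  have h'' : HasDerivAt (fun x => 1 + 2 * ∑' l : ℕ, q ^ ((l + 1) ^ 2) * Real.cos ((l + 1) * x))
      (-2 * S q θ) θ := by
    refine h'.congr_deriv ?_
    rw [tsum_neg, S]
    ring
  exact h''

/-! ## §5 The logarithm of the product, the series `R`, and `S = sin θ · Θ · R` -/

/-- `L_q(θ) = Σₘ log(1 + 2q^{2m+1} cos θ + q^{4m+2})`, the logarithm of the product in (A.5) (without `q₀`).
[cite: MullerSchiemann1987, Appendix (A.5) p.285] -/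
def L (q θ : ℝ) : ℝ := ∑' m : ℕ, Real.log (fac q m (Real.cos θ))

/-- `a_{q,m}(θ) = q^{2m+1} / (1 + 2q^{2m+1} cos θ + q^{4m+2})`: the `m`-th term of (A.5) divided by the full product.
[cite: MullerSchiemann1987, Appendix (A.5) p.285] -/
def a (q : ℝ) (m : ℕ) (θ : ℝ) : ℝ := q ^ (2 * m + 1) * (fac q m (Real.cos θ))⁻¹

/-- `R_q(θ) = Σₘ a_{q,m}(θ)`. [cite: MullerSchiemann1987, Appendix (A.5) p.285] -/
def R (q θ : ℝ) : ℝ := ∑' m : ℕ, a q m θ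

/-- `R₂ = Σₘ a_{q,m}²` (enters `dR/dθ` in the proof of (ii)). [cite: MullerSchiemann1987, Appendix (A.5) p.285] -/
def R2 (q θ : ℝ) : ℝ := ∑' m : ℕ, a q m θ ^ 2

/-- `d/dθ (1 + 2q^{2m+1} cos θ + q^{4m+2}) = −2q^{2m+1} sin θ` — the factors of (A.5) «decrease in (0, π)».
[cite: MullerSchiemann1987, Appendix (A.5) p.285 L.6] -/
theorem hasDerivAt_fac_cos (q : ℝ) (m : ℕ) (θ : ℝ) :
    HasDerivAt (fun y => fac q m (Real.cos y)) (-(2 * q ^ (2 * m + 1) * Real.sin θ)) θ := by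
  have h := (((Real.hasDerivAt_cos θ).const_mul (2 * q ^ (2 * m + 1))).const_add (1 : ℝ)).add_const
    (q ^ (4 * m + 2))
  exact h.congr_deriv (by ring)

/-- `a_{q,m} > 0`. [cite: MullerSchiemann1987, Appendix p.285 L.6] -/
theorem a_pos (hq0 : 0 < q) (hq1 : q < 1) (m : ℕ) (θ : ℝ) : 0 < a q m θ :=
  mul_pos (pow_pos hq0 _) (inv_pos.mpr (fac_cos_pos hq0.le hq1 m θ))

/-- `a_{q,m} ≤ q^{2m+1}/(1 − q)²`. [folklore] -/
private theorem a_le (hq0 : 0 ≤ q) (hq1 : q < 1) (m : ℕ) (θ : ℝ) :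
    a q m θ ≤ q ^ (2 * m + 1) * ((1 - q) ^ 2)⁻¹ := by
  unfold a
  have hsq : 0 < (1 - q) ^ 2 := by have := sub_pos.mpr hq1; positivity
  exact mul_le_mul_of_nonneg_left (inv_anti₀ hsq (sq_le_fac hq0 hq1 m (Real.neg_one_le_cos θ)))
    (pow_nonneg hq0 _)

/-- `a_{q,m}² ≤ q^{4m+2}/(1 − q)⁴`. [folklore] -/
private theorem a_sq_le (hq0 : 0 ≤ q) (hq1 : q < 1) (m : ℕ) (θ : ℝ) :
    a q m θ ^ 2 ≤ q ^ (4 * m + 2) * ((1 - q) ^ 4)⁻¹ := by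
  have h0 : 0 ≤ a q m θ := mul_nonneg (pow_nonneg hq0 _) (inv_pos.mpr (fac_cos_pos hq0 hq1 m θ)).le
  have h := pow_le_pow_left₀ h0 (a_le hq0 hq1 m θ) 2
  calc a q m θ ^ 2 ≤ (q ^ (2 * m + 1) * ((1 - q) ^ 2)⁻¹) ^ 2 := h
    _ = q ^ (4 * m + 2) * ((1 - q) ^ 4)⁻¹ := by rw [mul_pow, ← pow_mul, inv_pow, ← pow_mul]; ring_nf

/-- `Σₘ q^{2m+1} · k` converges. [folklore] -/
private theorem summable_pow_odd_mul (hq0 : 0 ≤ q) (hq1 : q < 1) (k : ℝ) :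
    Summable fun m : ℕ => q ^ (2 * m + 1) * k :=
  (summable_pow_of_le hq0 hq1 (e := fun m => 2 * m + 1) fun n => by omega).mul_right k

/-- `Σₘ q^{4m+2} · k` converges. [folklore] -/
private theorem summable_pow_four_mul (hq0 : 0 ≤ q) (hq1 : q < 1) (k : ℝ) :
    Summable fun m : ℕ => q ^ (4 * m + 2) * k :=
  (summable_pow_of_le hq0 hq1 (e := fun m => 4 * m + 2) fun n => by omega).mul_right k

/-- `Σₘ a_{q,m}` converges (so the sum in (A.5) converges: `Σₙ q^{2n+1} Π_{m≠n} fac_m = (Πₘ fac_m) Σₙ aₙ`).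
[cite: MullerSchiemann1987, Appendix (A.5) p.285] -/
theorem summable_a (hq0 : 0 < q) (hq1 : q < 1) (θ : ℝ) : Summable fun m : ℕ => a q m θ :=
  Summable.of_nonneg_of_le (fun m => (a_pos hq0 hq1 m θ).le) (fun m => a_le hq0.le hq1 m θ)
    (summable_pow_odd_mul hq0.le hq1 _)

/-- `Σₘ a_{q,m}²` converges. [folklore] -/
private theorem summable_a_sq (hq0 : 0 < q) (hq1 : q < 1) (θ : ℝ) : Summable fun m : ℕ => a q m θ ^ 2 :=
  Summable.of_nonneg_of_le (fun _ => sq_nonneg _) (fun m => a_sq_le hq0.le hq1 m θ)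
    (summable_pow_four_mul hq0.le hq1 _)

/-- `R_q(θ) > 0`. [cite: MullerSchiemann1987, Appendix p.285 L.6] -/
theorem R_pos (hq0 : 0 < q) (hq1 : q < 1) (θ : ℝ) : 0 < R q θ :=
  (summable_a hq0 hq1 θ).tsum_pos (fun m => (a_pos hq0 hq1 m θ).le) 0 (a_pos hq0 hq1 0 θ)

/-- `Σₘ log fac` converges at `c = cos θ`. [folklore] -/
private theorem summable_L_term (hq0 : 0 ≤ q) (hq1 : q < 1) (θ : ℝ) :
    Summable fun m : ℕ => Real.log (fac q m (Real.cos θ)) :=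
  summable_log_fac hq0 hq1 (Real.cos θ)

/-- **`dL_q/dθ = −2 sin θ · R_q(θ)`** (termwise differentiation; the derivatives are dominated by
`2q^{2m+1}/(1 − q)²`). [cite: MullerSchiemann1987, Appendix (A.5) p.285] -/
theorem hasDerivAt_L (hq0 : 0 < q) (hq1 : q < 1) (θ : ℝ) :
    HasDerivAt (L q) (-2 * Real.sin θ * R q θ) θ := by
  have hterm : ∀ (m : ℕ) (y : ℝ), HasDerivAt (fun y => Real.log (fac q m (Real.cos y)))
      (-(2 * q ^ (2 * m + 1) * Real.sin y) / fac q m (Real.cos y)) y :=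
    fun m y => (hasDerivAt_fac_cos q m y).log (fac_cos_pos hq0.le hq1 m y).ne'
  have hsq : 0 < (1 - q) ^ 2 := by have := sub_pos.mpr hq1; positivity
  have hbound : ∀ (m : ℕ) (y : ℝ),
      ‖-(2 * q ^ (2 * m + 1) * Real.sin y) / fac q m (Real.cos y)‖ ≤ q ^ (2 * m + 1) * (2 * ((1 - q) ^ 2)⁻¹) := by
    intro m y
    have hf := fac_cos_pos hq0.le hq1 m y
    rw [Real.norm_eq_abs, abs_div, abs_neg, abs_of_pos hf, abs_mul,
      abs_of_nonneg (by positivity : (0 : ℝ) ≤ 2 * q ^ (2 * m + 1)), div_eq_mul_inv]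
    have h1 : |Real.sin y| ≤ 1 := Real.abs_sin_le_one y
    have h2 : (fac q m (Real.cos y))⁻¹ ≤ ((1 - q) ^ 2)⁻¹ :=
      inv_anti₀ hsq (sq_le_fac hq0.le hq1 m (Real.neg_one_le_cos y))
    have h3 : 0 ≤ (fac q m (Real.cos y))⁻¹ := (inv_pos.mpr hf).le
    calc 2 * q ^ (2 * m + 1) * |Real.sin y| * (fac q m (Real.cos y))⁻¹
        ≤ 2 * q ^ (2 * m + 1) * 1 * ((1 - q) ^ 2)⁻¹ := by gcongr
      _ = q ^ (2 * m + 1) * (2 * ((1 - q) ^ 2)⁻¹) := by ring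
  have h := hasDerivAt_tsum (summable_pow_odd_mul hq0.le hq1 _) hterm hbound
    (summable_L_term hq0.le hq1 0) θ
  have h' : HasDerivAt (fun z => ∑' m : ℕ, Real.log (fac q m (Real.cos z)))
      (-2 * Real.sin θ * R q θ) θ := by
    refine h.congr_deriv ?_
    rw [R, ← tsum_mul_left]
    exact tsum_congr fun m => by rw [a, div_eq_mul_inv]; ring
  exact h'

/-- `Θ_q = q₀ e^{L_q}` as functions. [cite: MullerSchiemann1987, Appendix (A.5)–(A.6) p.285] -/
theorem theta_eq_q0_mul_exp_L (hq0 : 0 < q) (hq1 : q < 1) (θ : ℝ) :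
    theta q θ = q0 q * Real.exp (L q θ) :=
  theta_eq_q0_mul_exp hq0 hq1 θ

/-- `dΘ_q/dθ = Θ_q · (−2 sin θ · R_q)` — the derivative of the PRODUCT (A.5) («(d/dθ) ϑ₃(θ/2, q)» computed
factor by factor). [cite: MullerSchiemann1987, Appendix (A.4)–(A.5) pp.284–285] -/
theorem hasDerivAt_theta' (hq0 : 0 < q) (hq1 : q < 1) (θ : ℝ) :
    HasDerivAt (theta q) (theta q θ * (-2 * Real.sin θ * R q θ)) θ := by
  have h := ((hasDerivAt_L hq0 hq1 θ).exp).const_mul (q0 q)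
  have h' : HasDerivAt (theta q) (q0 q * (Real.exp (L q θ) * (-2 * Real.sin θ * R q θ))) θ :=
    h.congr_of_eventuallyEq (Eventually.of_forall fun y => theta_eq_q0_mul_exp_L hq0 hq1 y)
  refine h'.congr_deriv ?_
  rw [theta_eq_q0_mul_exp_L hq0 hq1 θ]
  ring

/-- **(A.1) = (A.5): `S_q(θ) = sin θ · Θ_q(θ) · R_q(θ)`**, i.e. `Σ l q^{l²} sin lθ = sin θ · q₀ Σₙ q^{2n+1}
Π_{m ≠ n}(1 + 2q^{2m+1} cos θ + q^{4m+2})` — the two expressions (A.3) and (A.5) for `−½ dΘ/dθ` agree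
(uniqueness of the derivative). [cite: MullerSchiemann1987, Appendix (A.1)–(A.5) pp.284–285] -/
theorem S_eq (hq0 : 0 < q) (hq1 : q < 1) (θ : ℝ) :
    S q θ = Real.sin θ * (theta q θ * R q θ) := by
  have h := (hasDerivAt_theta hq0.le hq1 θ).unique (hasDerivAt_theta' hq0 hq1 θ)
  linear_combination (-1 / 2 : ℝ) * h

/-! ## §6 The heat kernel in the central angle; Lemma (i) -/

/-- **The (un-normalised) heat-kernel Gibbs factor as a function of the central angle**,
`hk_q(θ) := Θ_q(θ) · R_q(θ) = q₀ Σₙ q^{2n+1} Π_{m ≠ n} (1 + 2q^{2m+1} cos θ + q^{4m+2})` — the right-hand side of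
(A.5) without `𝒩`; by `S_eq` it is the function `(Σ_{l≥1} l q^{l²} sin lθ)/sin θ` of (A.1) wherever
`sin θ ≠ 0`, and it is defined (and real-analytic) for every real `θ`. [cite: MullerSchiemann1987, Appendix (A.1), (A.5) pp.284–285] -/
def hk (q θ : ℝ) : ℝ := theta q θ * R q θ

/-- (A.1) ⟷ (A.5): `hk_q(θ) · sin θ = Σ_{l≥1} l q^{l²} sin lθ`. [cite: MullerSchiemann1987, Appendix (A.1), (A.5) pp.284–285] -/
theorem hk_mul_sin (hq0 : 0 < q) (hq1 : q < 1) (θ : ℝ) : hk q θ * Real.sin θ = S q θ := by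
  rw [hk, S_eq hq0 hq1 θ]; ring

/-- (A.1): off the zeros of `sin`, `hk_q(θ) = (Σ_{l≥1} l q^{l²} sin lθ) / sin θ`.
[cite: MullerSchiemann1987, Appendix (A.1) p.284] -/
theorem hk_eq_S_div (hq0 : 0 < q) (hq1 : q < 1) {θ : ℝ} (hθ : Real.sin θ ≠ 0) :
    hk q θ = S q θ / Real.sin θ := by
  rw [← hk_mul_sin hq0 hq1 θ, mul_div_cancel_right₀ _ hθ]

/-- **(A.5)**: `hk_q(θ) = q₀ Σₙ q^{2n+1} · [Πₘ fac_m / fac_n]` (= `q₀ Σₙ q^{2n+1} Π_{m≠n} fac_m`; index from `0`).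
[cite: MullerSchiemann1987, Appendix (A.5) p.285] -/
theorem hk_eq_A5 (hq0 : 0 < q) (hq1 : q < 1) (θ : ℝ) :
    hk q θ = q0 q * ∑' n : ℕ, q ^ (2 * n + 1) *
      ((∏' m : ℕ, fac q m (Real.cos θ)) * (fac q n (Real.cos θ))⁻¹) := by
  rw [hk, theta_eq_q0_mul_tprod hq0 hq1, R, mul_assoc, ← tsum_mul_left]
  congr 1
  refine tsum_congr fun n => ?_
  rw [a]
  ring

/-- **APPENDIX LEMMA (i)** (un-normalised form): `hk_q(θ) > 0` for ALL real `θ` («h(θ) > 0, ∀θ ∈ ℝ»; «In (A.5)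
each factor is strictly positive ∀θ ∈ ℝ … thus proving (i)»). [cite: MullerSchiemann1987, Appendix Lemma (i) p.284, proof p.285 L.6] -/
theorem hk_pos (hq0 : 0 < q) (hq1 : q < 1) (θ : ℝ) : 0 < hk q θ :=
  mul_pos (theta_pos hq0 hq1 θ) (R_pos hq0 hq1 θ)

/-- `hk_q` depends on `θ` only through `cos θ` (it is a class function of `u ∈ SU(2)`, `u₀ = cos θ`).
[cite: MullerSchiemann1987, (2.2), (2.10) pp.263–264; Appendix (A.5) p.285] -/
theorem hk_congr_cos (hq0 : 0 < q) (hq1 : q < 1) {θ₁ θ₂ : ℝ} (h : Real.cos θ₁ = Real.cos θ₂) :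
    hk q θ₁ = hk q θ₂ := by
  unfold hk R a
  rw [theta_congr_cos hq0 hq1 h, h]

/-- (2.12) evenness: `hk_q(−θ) = hk_q(θ)`. [cite: MullerSchiemann1987, (2.12) p.264] -/
theorem hk_neg (hq0 : 0 < q) (hq1 : q < 1) (θ : ℝ) : hk q (-θ) = hk q θ :=
  hk_congr_cos hq0 hq1 (Real.cos_neg θ)

/-- `2π`-periodicity: `hk_q(θ + 2π) = hk_q(θ)`. [cite: MullerSchiemann1987, (2.10)–(2.11) p.264] -/
theorem hk_add_two_pi (hq0 : 0 < q) (hq1 : q < 1) (θ : ℝ) : hk q (θ + 2 * π) = hk q θ :=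
  hk_congr_cos hq0 hq1 (Real.cos_add_two_pi θ)

/-! ## §7 APPENDIX LEMMA (ii): strict decrease on `(0, π)` -/

/-- `da_{q,m}/dθ = 2 sin θ · a_{q,m}²` (step of the proof of (ii) via (A.5)). [cite: MullerSchiemann1987, Appendix p.285 L.6–7] -/
theorem hasDerivAt_a (hq0 : 0 < q) (hq1 : q < 1) (m : ℕ) (θ : ℝ) :
    HasDerivAt (a q m) (2 * Real.sin θ * a q m θ ^ 2) θ := by
  have hf := (fac_cos_pos hq0.le hq1 m θ).ne'
  have h := ((hasDerivAt_fac_cos q m θ).inv hf).const_mul (q ^ (2 * m + 1))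
  refine h.congr_deriv ?_
  rw [a, neg_neg, div_eq_mul_inv, mul_pow, inv_pow]
  ring

/-- **`dR_q/dθ = 2 sin θ · R₂`** (termwise; derivatives dominated by `2q^{4m+2}/(1 − q)⁴`; step of the proof of (ii)
via (A.5)). [cite: MullerSchiemann1987, Appendix p.285 L.6–7] -/
theorem hasDerivAt_R (hq0 : 0 < q) (hq1 : q < 1) (θ : ℝ) :
    HasDerivAt (R q) (2 * Real.sin θ * R2 q θ) θ := by
  have hbound : ∀ (m : ℕ) (y : ℝ),
      ‖2 * Real.sin y * a q m y ^ 2‖ ≤ q ^ (4 * m + 2) * (2 * ((1 - q) ^ 4)⁻¹) := by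
    intro m y
    rw [Real.norm_eq_abs, abs_mul, abs_mul, abs_of_nonneg (by norm_num : (0 : ℝ) ≤ 2),
      abs_of_nonneg (sq_nonneg (a q m y))]
    have h1 : |Real.sin y| ≤ 1 := Real.abs_sin_le_one y
    have h2 := a_sq_le hq0.le hq1 m y
    have h3 : 0 ≤ a q m y ^ 2 := sq_nonneg _
    calc 2 * |Real.sin y| * a q m y ^ 2 ≤ 2 * 1 * (q ^ (4 * m + 2) * ((1 - q) ^ 4)⁻¹) := by gcongr
      _ = q ^ (4 * m + 2) * (2 * ((1 - q) ^ 4)⁻¹) := by ring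
  have h := hasDerivAt_tsum (summable_pow_four_mul hq0.le hq1 _) (fun m y => hasDerivAt_a hq0 hq1 m y)
    hbound (summable_a hq0 hq1 0) θ
  have h' : HasDerivAt (fun z => ∑' m : ℕ, a q m z) (2 * Real.sin θ * R2 q θ) θ := by
    refine h.congr_deriv ?_
    rw [R2, ← tsum_mul_left]
  exact h'

/-- `R₂ < R²`: `Σ aₘ² < (Σ aₘ)²` for the positive sequence `aₘ` (at least two terms are positive) — the sign
behind «thus proving (ii)». [cite: MullerSchiemann1987, Appendix p.285 L.6–7] -/
theorem R2_lt_R_sq (hq0 : 0 < q) (hq1 : q < 1) (θ : ℝ) : R2 q θ < R q θ ^ 2 := by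
  have hs := summable_a hq0 hq1 θ
  have ha := fun m => a_pos hq0 hq1 m θ
  have h0 : a q 0 θ < R q θ := by
    have h1 : Summable fun m : ℕ => a q (m + 1) θ := (summable_nat_add_iff 1).mpr hs
    have h2 : 0 < ∑' m : ℕ, a q (m + 1) θ := h1.tsum_pos (fun m => (ha _).le) 0 (ha 1)
    rw [R, hs.tsum_eq_zero_add]
    linarith
  have hle : ∀ m, a q m θ ^ 2 ≤ a q m θ * R q θ := fun m => by
    rw [sq]
    exact mul_le_mul_of_nonneg_left (hs.le_tsum m fun j _ => (ha j).le) (ha m).le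
  have hlt : a q 0 θ ^ 2 < a q 0 θ * R q θ := by
    rw [sq]
    exact mul_lt_mul_of_pos_left h0 (ha 0)
  calc R2 q θ = ∑' m : ℕ, a q m θ ^ 2 := rfl
    _ < ∑' m : ℕ, a q m θ * R q θ := (summable_a_sq hq0 hq1 θ).tsum_lt_tsum hle hlt (hs.mul_right _)
    _ = R q θ ^ 2 := by rw [tsum_mul_right, sq, R]

/-- **`d hk_q/dθ = −2 sin θ · Θ_q · (R_q² − R₂)`** (the product rule on (A.5): `Θ' R + Θ R'`).
[cite: MullerSchiemann1987, Appendix (A.5) p.285] -/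
theorem hasDerivAt_hk (hq0 : 0 < q) (hq1 : q < 1) (θ : ℝ) :
    HasDerivAt (hk q) (-2 * Real.sin θ * theta q θ * (R q θ ^ 2 - R2 q θ)) θ := by
  have h := (hasDerivAt_theta' hq0 hq1 θ).mul (hasDerivAt_R hq0 hq1 θ)
  exact h.congr_deriv (by ring)

/-- `hk_q` is continuous (indeed differentiable) on `ℝ` («the entire holomorphic function (A.1)», here on the
real axis). [cite: MullerSchiemann1987, Appendix (A.1) p.284] -/
theorem continuous_hk (hq0 : 0 < q) (hq1 : q < 1) : Continuous (hk q) :=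
  continuous_iff_continuousAt.mpr fun θ => (hasDerivAt_hk hq0 hq1 θ).continuousAt

/-- The derivative is strictly negative on `(0, π)` («each factor … decreases in (0, π)»).
[cite: MullerSchiemann1987, Appendix p.285 L.6] -/
theorem deriv_hk_neg (hq0 : 0 < q) (hq1 : q < 1) {θ : ℝ} (h0 : 0 < θ) (hπ : θ < π) :
    deriv (hk q) θ < 0 := by
  rw [(hasDerivAt_hk hq0 hq1 θ).deriv]
  have hs : 0 < Real.sin θ := Real.sin_pos_of_pos_of_lt_pi h0 hπ
  have hΘ := theta_pos hq0 hq1 θ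
  have hR := sub_pos.mpr (R2_lt_R_sq hq0 hq1 θ)
  have := mul_pos (mul_pos hs hΘ) hR
  nlinarith

/-- **APPENDIX LEMMA (ii)** (un-normalised form): `hk_q` «decreases monotonously in θ ∈ (0, π)» — indeed it is
STRICTLY decreasing on the closed interval `[0, π]`. [cite: MullerSchiemann1987, Appendix Lemma (ii) p.284, proof p.285 L.6] -/
theorem hk_strictAntiOn (hq0 : 0 < q) (hq1 : q < 1) : StrictAntiOn (hk q) (Set.Icc 0 π) :=
  strictAntiOn_of_deriv_neg (convex_Icc 0 π) (continuous_hk hq0 hq1).continuousOn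
    fun θ hθ => by
      rw [interior_Icc] at hθ
      exact deriv_hk_neg hq0 hq1 hθ.1 hθ.2

/-- Lemma (ii) verbatim on the open interval. [cite: MullerSchiemann1987, Appendix Lemma (ii) p.284] -/
theorem hk_strictAntiOn_Ioo (hq0 : 0 < q) (hq1 : q < 1) : StrictAntiOn (hk q) (Set.Ioo 0 π) :=
  (hk_strictAntiOn hq0 hq1).mono Set.Ioo_subset_Icc_self

/-- The maximum is at the unit element: `hk_q(θ) ≤ hk_q(0)` for every real `θ` (from (ii), evenness and
periodicity). [cite: MullerSchiemann1987, (2.1) p.263; Appendix Lemma (i)–(ii) p.284] -/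
theorem hk_le_hk_zero (hq0 : 0 < q) (hq1 : q < 1) (θ : ℝ) : hk q θ ≤ hk q 0 := by
  have hc : Real.cos (Real.arccos (Real.cos θ)) = Real.cos θ :=
    Real.cos_arccos (Real.neg_one_le_cos θ) (Real.cos_le_one θ)
  rw [← hk_congr_cos hq0 hq1 hc]
  rcases eq_or_lt_of_le (Real.arccos_nonneg (Real.cos θ)) with h0 | h0
  · rw [← h0]
  · exact (hk_strictAntiOn hq0 hq1 (Set.left_mem_Icc.mpr Real.pi_pos.le)
      ⟨Real.arccos_nonneg _, Real.arccos_le_pi _⟩ h0).le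

/-! ## §8 The printed, normalised Gibbs factor `h(θ)` of (A.1) and the Lemma as printed -/

/-- The normalisation `𝒩 = 1/hk_q(0)` of (A.1) («the positive normalization factor 𝒩 determined by
h(0) = 1»), `q = e^{−1/(4γ)}`. [cite: MullerSchiemann1987, Appendix (A.1) p.284; (2.1) p.263] -/
def normN (γ : ℝ) : ℝ := (hk (nome γ) 0)⁻¹

/-- **The heat-kernel Gibbs factor in the central angle, (A.1)**: `h(θ) = 𝒩 Σ_{l≥1} l e^{−l²/(4γ)} sin lθ / sin θ`,
realised as the everywhere-defined `𝒩 · hk_q(θ)` (see `h_mul_sin`, `h_eq_div` for the printed quotient form).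
This is (2.20) `g_HK(u) = 𝒩 Σ_{j = 0, ½, 1, …} (2j+1) e^{−(j+½)²/γ} χ_j(u)` read at `u₀ = cos θ` (`l = 2j + 1`,
`χ_j = sin lθ / sin θ`). [cite: MullerSchiemann1987, (2.20) p.265, Appendix (A.1) p.284] -/
def h (γ θ : ℝ) : ℝ := normN γ * hk (nome γ) θ

variable {γ : ℝ}

/-- «the positive normalization factor 𝒩». [cite: MullerSchiemann1987, Appendix (A.1) p.284] -/
theorem normN_pos (hγ : 0 < γ) : 0 < normN γ :=
  inv_pos.mpr (hk_pos (nome_pos γ) (nome_lt_one hγ) 0)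

/-- (2.1): `h(0) = 1` («𝒩 determined by h(0) = 1»). [cite: MullerSchiemann1987, (2.1) p.263, Appendix (A.1) p.284] -/
theorem h_zero (hγ : 0 < γ) : h γ 0 = 1 :=
  inv_mul_cancel₀ (hk_pos (nome_pos γ) (nome_lt_one hγ) 0).ne'

/-- **(A.1)**: `h(θ) · sin θ = 𝒩 Σ_{l ≥ 1} l e^{−l²/(4γ)} sin lθ` (index `l = l' + 1`).
[cite: MullerSchiemann1987, Appendix (A.1) p.284] -/
theorem h_mul_sin (hγ : 0 < γ) (θ : ℝ) :
    h γ θ * Real.sin θ = normN γ *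
      ∑' l : ℕ, ((l : ℝ) + 1) * Real.exp (-(((l : ℝ) + 1) ^ 2 / (4 * γ))) * Real.sin ((l + 1) * θ) := by
  rw [h, mul_assoc, hk_mul_sin (nome_pos γ) (nome_lt_one hγ), S]
  congr 1
  refine tsum_congr fun l => ?_
  rw [← Nat.cast_succ, nome_pow_sq γ (l + 1)]

/-- **(A.1)** in quotient form, off the zeros of `sin`: `h(θ) = 𝒩 (Σ_{l≥1} l e^{−l²/(4γ)} sin lθ)/sin θ`.
[cite: MullerSchiemann1987, Appendix (A.1) p.284] -/
theorem h_eq_div (hγ : 0 < γ) {θ : ℝ} (hθ : Real.sin θ ≠ 0) :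
    h γ θ = normN γ *
      (∑' l : ℕ, ((l : ℝ) + 1) * Real.exp (-(((l : ℝ) + 1) ^ 2 / (4 * γ))) * Real.sin ((l + 1) * θ)) /
        Real.sin θ := by
  rw [eq_div_iff hθ, h_mul_sin hγ θ]

/-- **(A.3)**: `h(θ) sin θ = −(𝒩/2) (d/dθ){1 + 2 Σ_{l≥1} q^{l²} cos lθ}`. [cite: MullerSchiemann1987, Appendix (A.3) p.284] -/
theorem h_mul_sin_eq_deriv (hγ : 0 < γ) (θ : ℝ) :
    h γ θ * Real.sin θ = -(normN γ / 2) * deriv (theta (nome γ)) θ := by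
  rw [(hasDerivAt_theta (nome_pos γ).le (nome_lt_one hγ) θ).deriv, h, mul_assoc,
    hk_mul_sin (nome_pos γ) (nome_lt_one hγ)]
  ring

/-- **(A.5)–(A.6)**: `h(θ) = 𝒩 q₀ Σₙ q^{2n+1} Π_{m≠n} (1 + 2q^{2m+1} cos θ + q^{4m+2})` (the product over `m ≠ n`
written as the full product divided by the `n`-th factor; indices from `0`).
[cite: MullerSchiemann1987, Appendix (A.5)–(A.6) p.285] -/
theorem h_eq_A5 (hγ : 0 < γ) (θ : ℝ) :
    h γ θ = normN γ * (q0 (nome γ) * ∑' n : ℕ, nome γ ^ (2 * n + 1) *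
      ((∏' m : ℕ, fac (nome γ) m (Real.cos θ)) * (fac (nome γ) n (Real.cos θ))⁻¹)) := by
  rw [h, hk_eq_A5 (nome_pos γ) (nome_lt_one hγ)]

/-- **APPENDIX LEMMA (i): `h(θ) > 0` for all `θ ∈ ℝ`** — hence «The real-valued function g_HK^{(0)} is positive
on G» (p.266), `g_HK(u) = h(θ)` at `u₀ = cos θ`. [cite: MullerSchiemann1987, Appendix Lemma (i) p.284; p.266 L.3] -/
theorem h_pos (hγ : 0 < γ) (θ : ℝ) : 0 < h γ θ :=
  mul_pos (normN_pos hγ) (hk_pos (nome_pos γ) (nome_lt_one hγ) θ)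

/-- **APPENDIX LEMMA (ii): `h(θ)` decreases (strictly) monotonously in `θ ∈ (0, π)`.**
[cite: MullerSchiemann1987, Appendix Lemma (ii) p.284] -/
theorem h_strictAntiOn_Ioo (hγ : 0 < γ) : StrictAntiOn (h γ) (Set.Ioo 0 π) := fun _ ha _ hb hab =>
  mul_lt_mul_of_pos_left (hk_strictAntiOn_Ioo (nome_pos γ) (nome_lt_one hγ) ha hb hab) (normN_pos hγ)

/-- Lemma (ii) on the closed interval `[0, π]`. [cite: MullerSchiemann1987, Appendix Lemma (ii) p.284] -/
theorem h_strictAntiOn (hγ : 0 < γ) : StrictAntiOn (h γ) (Set.Icc 0 π) := fun _ ha _ hb hab =>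
  mul_lt_mul_of_pos_left (hk_strictAntiOn (nome_pos γ) (nome_lt_one hγ) ha hb hab) (normN_pos hγ)

/-- (2.12): `h` is even. [cite: MullerSchiemann1987, (2.12) p.264] -/
theorem h_neg (hγ : 0 < γ) (θ : ℝ) : h γ (-θ) = h γ θ := by
  rw [h, h, hk_neg (nome_pos γ) (nome_lt_one hγ)]

/-- `h` is `2π`-periodic («periodic with period 2π», p.264). [cite: MullerSchiemann1987, (2.10) p.264] -/
theorem h_add_two_pi (hγ : 0 < γ) (θ : ℝ) : h γ (θ + 2 * π) = h γ θ := by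
  rw [h, h, hk_add_two_pi (nome_pos γ) (nome_lt_one hγ)]

/-- (2.11): `h(z + π) = h(z − π)`. [cite: MullerSchiemann1987, (2.11) p.264] -/
theorem h_add_pi (hγ : 0 < γ) (θ : ℝ) : h γ (θ + π) = h γ (θ - π) := by
  rw [show θ + π = (θ - π) + 2 * π by ring, h_add_two_pi hγ]

/-- `0 < h ≤ 1 = h(0)`: the Gibbs factor is maximal at the unit element. [cite: MullerSchiemann1987, (2.1) p.263, Appendix Lemma p.284] -/
theorem h_le_one (hγ : 0 < γ) (θ : ℝ) : h γ θ ≤ 1 := by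
  rw [← h_zero hγ]
  exact mul_le_mul_of_nonneg_left (hk_le_hk_zero (nome_pos γ) (nome_lt_one hγ) θ) (normN_pos hγ).le

/-! ## §9 (v1.1) On the group: `g_HK(u) = h(θ(u))`, (2.1)–(2.3) and «positive on G» -/

section OnTheGroup

/-- The central angle `θ(u) ∈ [0, π]` of `u ∈ SU(2)`: `cos θ(u) = u₀ = ½ Re tr u` (p.264: «Parametrizing u ∈ SU(2)
by u = u₀σ₀ + iu·σ with {u₀, u} ∈ S³»; Proposition 1 at `z = 0`: `η = sin²(θ/2) = ½(1 − u₀)`).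
[cite: MullerSchiemann1987, (2.13) and Proposition 1 p.264] -/
def centralAngle (U : (Matrix.specialUnitaryGroup (Fin 2) ℂ)) : ℝ :=
  Real.arccos ((Matrix.trace (U : Matrix (Fin 2) (Fin 2) ℂ)).re / 2)

/-- **(2.20) on the group**: the heat-kernel Gibbs factor `g_HK(u) = h(θ(u))` — «the class function on G represented
by h(x) as a function of the central angle» (p.264 L.26–27). [cite: MullerSchiemann1987, (2.10), (2.20) pp.264–265] -/
def gHK (γ : ℝ) (U : (Matrix.specialUnitaryGroup (Fin 2) ℂ)) : ℝ := h γ (centralAngle U)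

/-- The trace is a class function: `tr(v u v⁻¹) = tr u` on `SU(2)`. [cite: MullerSchiemann1987, (2.2) p.263] -/
theorem trace_conj (U V : (Matrix.specialUnitaryGroup (Fin 2) ℂ)) :
    Matrix.trace ((V * U * V⁻¹ : (Matrix.specialUnitaryGroup (Fin 2) ℂ)) : Matrix (Fin 2) (Fin 2) ℂ) =
      Matrix.trace (U : Matrix (Fin 2) (Fin 2) ℂ) := by
  have hVV : ((V⁻¹ : (Matrix.specialUnitaryGroup (Fin 2) ℂ)) : Matrix (Fin 2) (Fin 2) ℂ) * (V : Matrix (Fin 2) (Fin 2) ℂ) = 1 := by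
    rw [← Submonoid.coe_mul, inv_mul_cancel, Submonoid.coe_one]
  rw [Submonoid.coe_mul, Submonoid.coe_mul, Matrix.trace_mul_cycle, hVV, one_mul]

/-- `tr(u⁻¹) = conj (tr u)` on `SU(2)` (`u⁻¹ = u*`). [cite: MullerSchiemann1987, (2.3) p.263] -/
theorem trace_inv (U : (Matrix.specialUnitaryGroup (Fin 2) ℂ)) :
    Matrix.trace ((U⁻¹ : (Matrix.specialUnitaryGroup (Fin 2) ℂ)) : Matrix (Fin 2) (Fin 2) ℂ) = star (Matrix.trace (U : Matrix (Fin 2) (Fin 2) ℂ)) := by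
  rw [← Matrix.star_eq_inv, Matrix.specialUnitaryGroup.coe_star, Matrix.star_eq_conjTranspose,
    Matrix.trace_conjTranspose]

/-- (2.2): `g_HK(vuv⁻¹) = g_HK(u)`. [cite: MullerSchiemann1987, (2.2) p.263] -/
theorem gHK_conj (γ : ℝ) (U V : (Matrix.specialUnitaryGroup (Fin 2) ℂ)) : gHK γ (V * U * V⁻¹) = gHK γ U := by
  rw [gHK, gHK, centralAngle, centralAngle, trace_conj]

/-- (2.3): `g_HK(u⁻¹) = g_HK(u)`. [cite: MullerSchiemann1987, (2.3) p.263] -/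
theorem gHK_inv (γ : ℝ) (U : (Matrix.specialUnitaryGroup (Fin 2) ℂ)) : gHK γ U⁻¹ = gHK γ U := by
  rw [gHK, gHK, centralAngle, centralAngle, trace_inv, Complex.star_def, Complex.conj_re]

/-- (2.1): `g_HK(e₀) = 1` («a normalization factor 𝒩 fixed by (2.1)»). [cite: MullerSchiemann1987, (2.1) p.263, (2.20) p.266 L.2] -/
theorem gHK_one (hγ : 0 < γ) : gHK γ 1 = 1 := by
  rw [gHK, centralAngle, Submonoid.coe_one, Matrix.trace_one, Fintype.card_fin]
  norm_num
  exact h_zero hγ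

/-- **«The real-valued function g_HK^{(0)} is positive on G»** (p.266 L.3) — Appendix Lemma (i) on the group.
[cite: MullerSchiemann1987, p.266 L.3; Appendix Lemma (i) p.284] -/
theorem gHK_pos (hγ : 0 < γ) (U : (Matrix.specialUnitaryGroup (Fin 2) ℂ)) : 0 < gHK γ U :=
  h_pos hγ _

/-- `g_HK ≤ 1 = g_HK(e₀)`: the Gibbs factor is maximal at the unit element. [cite: MullerSchiemann1987, (2.1) p.263; Appendix Lemma (ii) p.284] -/
theorem gHK_le_one (hγ : 0 < γ) (U : (Matrix.specialUnitaryGroup (Fin 2) ℂ)) : gHK γ U ≤ 1 :=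
  h_le_one hγ _

/-- Lemma (ii) on the group: `g_HK` is a strictly decreasing function of the central angle `θ(u) ∈ [0, π]`.
[cite: MullerSchiemann1987, Appendix Lemma (ii) p.284] -/
theorem gHK_lt_of_centralAngle_lt (hγ : 0 < γ) {U V : (Matrix.specialUnitaryGroup (Fin 2) ℂ)} (h : centralAngle U < centralAngle V) :
    gHK γ V < gHK γ U :=
  h_strictAntiOn hγ ⟨Real.arccos_nonneg _, Real.arccos_le_pi _⟩ ⟨Real.arccos_nonneg _, Real.arccos_le_pi _⟩ h

end OnTheGroup

/-! ## §10 (v1.1) (A.7)–(A.8): theta inversion — the periodised-Gaussian form on the real axis -/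

section Poisson

variable {γ : ℝ}

/-- `ϑ`-terms at imaginary arguments are real: `e^{2πin(iy) + πin²(iT)} = e^{−(2πny + πn²T)}`. [folklore] -/
private theorem jacobiTheta₂_term_I (n : ℤ) (y T : ℝ) :
    jacobiTheta₂_term n (y * Complex.I) (T * Complex.I) =
      ((Real.exp (-(2 * π * n * y + π * n ^ 2 * T)) : ℝ) : ℂ) := by
  rw [jacobiTheta₂_term, Complex.ofReal_exp]
  congr 1
  push_cast
  linear_combination (2 * ↑π * (n : ℂ) * (y : ℂ) + ↑π * (n : ℂ) ^ 2 * (T : ℂ)) * Complex.I_mul_I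

/-- `0 < Im(iT)` for `T > 0`. [folklore] -/
private theorem im_T_I_pos {T : ℝ} (hT : 0 < T) : 0 < (T * Complex.I : ℂ).im := by simpa using hT

/-- `ϑ(iy, iT) = Σₙ e^{−(2πny + πn²T)}` as a real series. [folklore] -/
private theorem jacobiTheta₂_I_eq (y T : ℝ) :
    jacobiTheta₂ (y * Complex.I) (T * Complex.I) =
      (((∑' n : ℤ, Real.exp (-(2 * π * n * y + π * n ^ 2 * T))) : ℝ) : ℂ) := by
  rw [jacobiTheta₂, Complex.ofReal_tsum]
  exact tsum_congr fun n => jacobiTheta₂_term_I n y T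

/-- The real series `Σₙ e^{−(2πny + πn²T)}` converges (`T > 0`). [folklore] -/
private theorem summable_exp_I (y : ℝ) {T : ℝ} (hT : 0 < T) :
    Summable fun n : ℤ => Real.exp (-(2 * π * n * y + π * n ^ 2 * T)) := by
  have h := (hasSum_jacobiTheta₂_term (y * Complex.I) (im_T_I_pos hT)).summable
  simp_rw [jacobiTheta₂_term_I] at h
  exact Complex.summable_ofReal.mp h

/-- `ϑ'(iy, iT) = 2πi Σₙ n e^{−(2πny + πn²T)}`. [folklore] -/
private theorem jacobiTheta₂'_I_eq (y T : ℝ) :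
    jacobiTheta₂' (y * Complex.I) (T * Complex.I) =
      2 * π * Complex.I *
        (((∑' n : ℤ, (n : ℝ) * Real.exp (-(2 * π * n * y + π * n ^ 2 * T))) : ℝ) : ℂ) := by
  rw [jacobiTheta₂', Complex.ofReal_tsum, ← tsum_mul_left]
  refine tsum_congr fun n => ?_
  rw [jacobiTheta₂'_term, jacobiTheta₂_term_I]
  push_cast
  ring

/-- The real series `Σₙ n e^{−(2πny + πn²T)}` converges (`T > 0`). [folklore] -/
private theorem summable_int_mul_exp_I (y : ℝ) {T : ℝ} (hT : 0 < T) :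
    Summable fun n : ℤ => (n : ℝ) * Real.exp (-(2 * π * n * y + π * n ^ 2 * T)) := by
  have h := (hasSum_jacobiTheta₂'_term (y * Complex.I) (im_T_I_pos hT)).summable
  have h' : Summable fun n : ℤ => (2 * π * Complex.I) *
      ((((n : ℝ) * Real.exp (-(2 * π * n * y + π * n ^ 2 * T))) : ℝ) : ℂ) := by
    refine h.congr fun n => ?_
    rw [jacobiTheta₂'_term, jacobiTheta₂_term_I]
    push_cast
    ring
  have h2 : (2 * π * Complex.I : ℂ) ≠ 0 :=
    mul_ne_zero (mul_ne_zero two_ne_zero (Complex.ofReal_ne_zero.mpr Real.pi_ne_zero)) Complex.I_ne_zero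
  exact Complex.summable_ofReal.mp ((summable_mul_left_iff h2).mp h')

/-- The modulus `τ = i/(4πγ)` of (A.4) and its companions: `1/(−iτ)^{1/2} = 2√(πγ)`. [folklore] -/
private theorem prefactor_eq (hγ : 0 < γ) :
    1 / (-Complex.I * (Complex.I / (4 * π * γ))) ^ (1 / 2 : ℂ) = ((2 * Real.sqrt (π * γ) : ℝ) : ℂ) := by
  have hπ : (π : ℂ) ≠ 0 := Complex.ofReal_ne_zero.mpr Real.pi_ne_zero
  have hγ' : (γ : ℂ) ≠ 0 := Complex.ofReal_ne_zero.mpr hγ.ne'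
  have hc : 0 < 1 / (4 * π * γ) := by positivity
  have e : -Complex.I * (Complex.I / (4 * π * γ)) = ((1 / (4 * π * γ) : ℝ) : ℂ) := by
    have : -Complex.I * (Complex.I / (4 * π * γ)) = -(Complex.I * Complex.I) / (4 * π * γ) := by ring
    rw [this, Complex.I_mul_I]
    push_cast
    ring
  have hs : Real.sqrt (1 / (4 * π * γ)) = 1 / (2 * Real.sqrt (π * γ)) := by
    rw [Real.sqrt_eq_iff_mul_self_eq_of_pos (by positivity)]
    have h4 : Real.sqrt (π * γ) * Real.sqrt (π * γ) = π * γ := Real.mul_self_sqrt (by positivity)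
    field_simp
    nlinarith [h4]
  rw [e, show (1 / 2 : ℂ) = ((1 / 2 : ℝ) : ℂ) by
      rw [Complex.ofReal_div, Complex.ofReal_one, Complex.ofReal_ofNat], ← Complex.ofReal_cpow hc.le,
    ← Real.sqrt_eq_rpow, hs]
  have h2 : (2 * Real.sqrt (π * γ) : ℝ) ≠ 0 := by positivity
  push_cast
  field_simp

/-- The Gaussian prefactor: `exp(−πi z²/τ) = e^{−γθ²}` at `z = θ/2π`, `τ = i/(4πγ)`. [folklore] -/
private theorem gaussFactor_eq (hγ : 0 < γ) (θ : ℝ) :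
    Complex.exp (-π * Complex.I * ((θ : ℂ) / (2 * π)) ^ 2 / (Complex.I / (4 * π * γ))) =
      ((Real.exp (-(γ * θ ^ 2)) : ℝ) : ℂ) := by
  have hπ : (π : ℂ) ≠ 0 := Complex.ofReal_ne_zero.mpr Real.pi_ne_zero
  have hγ' : (γ : ℂ) ≠ 0 := Complex.ofReal_ne_zero.mpr hγ.ne'
  rw [Complex.ofReal_exp]
  congr 1
  push_cast
  field_simp
  ring

/-- `τ⁻¹ = −4πγ i`. [folklore] -/
private theorem tau_inv_eq (hγ : 0 < γ) :
    (Complex.I / (4 * π * γ))⁻¹ = -(4 * π * γ) * Complex.I := by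
  have hπ : (π : ℂ) ≠ 0 := Complex.ofReal_ne_zero.mpr Real.pi_ne_zero
  have hγ' : (γ : ℂ) ≠ 0 := Complex.ofReal_ne_zero.mpr hγ.ne'
  rw [inv_div, div_eq_mul_inv, Complex.inv_I]
  ring

/-- `z/τ = −2γθ · i`. [folklore] -/
private theorem z_div_tau_eq (hγ : 0 < γ) (θ : ℝ) :
    ((θ : ℂ) / (2 * π)) / (Complex.I / (4 * π * γ)) = ((-(2 * γ * θ) : ℝ) : ℂ) * Complex.I := by
  have hπ : (π : ℂ) ≠ 0 := Complex.ofReal_ne_zero.mpr Real.pi_ne_zero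
  rw [div_eq_mul_inv _ (Complex.I / (4 * π * γ)), tau_inv_eq hγ]
  push_cast
  field_simp
  ring

/-- `−1/τ = 4πγ · i`. [folklore] -/
private theorem neg_one_div_tau_eq (hγ : 0 < γ) :
    -1 / (Complex.I / (4 * π * γ)) = ((4 * π * γ : ℝ) : ℂ) * Complex.I := by
  rw [div_eq_mul_inv, tau_inv_eq hγ]
  push_cast
  ring

/-- The periodised-Gaussian series `Σₙ e^{−γ(θ − 2πn)²}` of (A.7) converges. [cite: MullerSchiemann1987, Appendix (A.7) p.285] -/
theorem summable_periodicGaussian (hγ : 0 < γ) (θ : ℝ) :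
    Summable fun n : ℤ => Real.exp (-(γ * (θ - 2 * π * n) ^ 2)) := by
  have h := (summable_exp_I (-(2 * γ * θ)) (by positivity : 0 < 4 * π * γ)).mul_left
    (Real.exp (-(γ * θ ^ 2)))
  refine h.congr fun n => ?_
  rw [← Real.exp_add]
  congr 1
  ring

/-- **(A.4) inverted — theta inversion / Poisson summation («Employing in (A.3) the Poisson summation formula we
obtain …»)**: for `q = e^{−1/(4γ)}`,
`Θ_q(θ) = 1 + 2Σ_{l≥1} e^{−l²/(4γ)} cos lθ = 2√(πγ) · Σ_{n ∈ ℤ} e^{−γ(θ − 2πn)²}` for every real `θ` — the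
bracket of (A.7) before differentiation (`e^{−γθ²}{1 + 2Σ cosh(4πγnθ) e^{−4π²γn²}}` with the square expanded).
[cite: MullerSchiemann1987, Appendix (A.7) p.285] -/
theorem theta_eq_periodicGaussian (hγ : 0 < γ) (θ : ℝ) :
    theta (nome γ) θ = 2 * Real.sqrt (π * γ) * ∑' n : ℤ, Real.exp (-(γ * (θ - 2 * π * n) ^ 2)) := by
  have h := theta_eq_jacobiTheta₂ hγ θ
  rw [jacobiTheta₂_functional_equation, prefactor_eq hγ, gaussFactor_eq hγ, z_div_tau_eq hγ,
    neg_one_div_tau_eq hγ, jacobiTheta₂_I_eq] at h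
  have h' : theta (nome γ) θ = 2 * Real.sqrt (π * γ) * Real.exp (-(γ * θ ^ 2)) *
      ∑' n : ℤ, Real.exp (-(2 * π * n * (-(2 * γ * θ)) + π * n ^ 2 * (4 * π * γ))) := by
    exact_mod_cast h
  rw [h', mul_assoc, ← tsum_mul_left]
  congr 1
  refine tsum_congr fun n => ?_
  rw [← Real.exp_add]
  congr 1
  ring

/-- `Θ_q` as a complex-valued function of the real variable has derivative `(1/2π) ϑ'(θ/2π, τ)` — the chain rule on
(A.4). [cite: MullerSchiemann1987, Appendix (A.3)–(A.4) p.284] -/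
private theorem hasDerivAt_theta_complex (hγ : 0 < γ) (θ : ℝ) :
    HasDerivAt (fun t : ℝ => ((theta (nome γ) t : ℝ) : ℂ))
      (jacobiTheta₂' ((θ : ℂ) / (2 * π)) (Complex.I / (4 * π * γ)) * (1 / (2 * π))) θ := by
  have hπ : (π : ℂ) ≠ 0 := Complex.ofReal_ne_zero.mpr Real.pi_ne_zero
  have hτ : 0 < (Complex.I / (4 * π * γ)).im := by
    have : Complex.I / (4 * π * γ) = ((1 / (4 * π * γ) : ℝ) : ℂ) * Complex.I := by
      push_cast
      field_simp
    rw [this]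
    simpa using (by positivity : 0 < 1 / (4 * π * γ))
  have h1 : HasDerivAt (fun w : ℂ => w / (2 * π)) (1 / (2 * π)) (θ : ℂ) := by
    simpa [div_eq_mul_inv, one_div] using (hasDerivAt_id (θ : ℂ)).mul_const ((2 * (π : ℂ))⁻¹)
  have h2 := (hasDerivAt_jacobiTheta₂_fst ((θ : ℂ) / (2 * π)) hτ).comp (θ : ℂ) h1
  have h3 := h2.comp_ofReal
  refine h3.congr_of_eventuallyEq (Eventually.of_forall fun t => ?_)
  simp only [Function.comp_def]
  exact theta_eq_jacobiTheta₂ hγ t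

/-- **(A.3) inverted**: `S_q(θ) = Σ_{l≥1} l q^{l²} sin lθ = 2γ√(πγ) · Σ_{n∈ℤ} (θ − 2πn) e^{−γ(θ − 2πn)²}` for every
real `θ` (the derivative of the periodised Gaussian; the functional equation of `ϑ'`).
[cite: MullerSchiemann1987, Appendix (A.3), (A.7) pp.284–285] -/
theorem S_eq_periodicGaussian (hγ : 0 < γ) (θ : ℝ) :
    S (nome γ) θ = 2 * γ * Real.sqrt (π * γ) *
      ∑' n : ℤ, (θ - 2 * π * n) * Real.exp (-(γ * (θ - 2 * π * n) ^ 2)) := by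
  have hπ : (π : ℂ) ≠ 0 := Complex.ofReal_ne_zero.mpr Real.pi_ne_zero
  have hγ' : (γ : ℂ) ≠ 0 := Complex.ofReal_ne_zero.mpr hγ.ne'
  -- the two derivatives of `t ↦ Θ(t)` (as a complex-valued function) agree
  have hD := ((hasDerivAt_theta (nome_pos γ).le (nome_lt_one hγ) θ).ofReal_comp).unique
    (hasDerivAt_theta_complex hγ θ)
  -- transform `ϑ'` by its functional equation and evaluate at the imaginary arguments
  rw [jacobiTheta₂'_functional_equation, prefactor_eq hγ, gaussFactor_eq hγ, z_div_tau_eq hγ,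
    neg_one_div_tau_eq hγ, jacobiTheta₂_I_eq, jacobiTheta₂'_I_eq, div_eq_mul_inv _ (Complex.I / (4 * π * γ)),
    tau_inv_eq hγ] at hD
  set P₀ : ℝ := ∑' n : ℤ, Real.exp (-(2 * π * n * (-(2 * γ * θ)) + π * n ^ 2 * (4 * π * γ))) with hP₀
  set P₁ : ℝ := ∑' n : ℤ, (n : ℝ) * Real.exp (-(2 * π * n * (-(2 * γ * θ)) + π * n ^ 2 * (4 * π * γ)))
    with hP₁
  -- extract the real identity `−2 S = 2√(πγ) e^{−γθ²} · 2γ (2π P₁ − θ P₀)`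
  have hreal : -2 * S (nome γ) θ =
      2 * Real.sqrt (π * γ) * Real.exp (-(γ * θ ^ 2)) * (2 * γ) * (2 * π * P₁ - θ * P₀) := by
    have step : ∀ A B c d p₁ t p₀ w : ℂ,
        A * B * (-c * Complex.I) * (d * Complex.I * p₁ - d * Complex.I * t * p₀) * w
          = A * B * (-c) * d * (Complex.I * Complex.I) * (p₁ - t * p₀) * w := by
      intros; ring
    have e : ((-2 * S (nome γ) θ : ℝ) : ℂ) =
        ((2 * Real.sqrt (π * γ) * Real.exp (-(γ * θ ^ 2)) * (2 * γ) * (2 * π * P₁ - θ * P₀) : ℝ) : ℂ) := by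
      rw [hD, step, Complex.I_mul_I]
      push_cast
      field_simp
      ring
    exact_mod_cast e
  -- combine the two series
  have hs₀ := summable_exp_I (-(2 * γ * θ)) (by positivity : 0 < 4 * π * γ)
  have hs₁ := summable_int_mul_exp_I (-(2 * γ * θ)) (by positivity : 0 < 4 * π * γ)
  have hcomb : θ * P₀ - 2 * π * P₁ = ∑' n : ℤ, (θ - 2 * π * n) *
      Real.exp (-(2 * π * n * (-(2 * γ * θ)) + π * n ^ 2 * (4 * π * γ))) := by
    rw [hP₀, hP₁, ← tsum_mul_left, ← tsum_mul_left, ← (hs₀.mul_left θ).tsum_sub (hs₁.mul_left (2 * π))]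
    exact tsum_congr fun n => by ring
  have hfin : S (nome γ) θ =
      2 * γ * Real.sqrt (π * γ) * (Real.exp (-(γ * θ ^ 2)) * (θ * P₀ - 2 * π * P₁)) := by
    linarith [hreal]
  rw [hfin, hcomb, ← tsum_mul_left]
  congr 1
  refine tsum_congr fun n => ?_
  rw [mul_left_comm, ← Real.exp_add]
  congr 2
  ring

/-- `𝒩′ = 2γ√(πγ) · 𝒩` — the normalisation of (A.7). [cite: MullerSchiemann1987, Appendix (A.7), (A.9) p.285] -/
def normN' (γ : ℝ) : ℝ := 2 * γ * Real.sqrt (π * γ) * normN γ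

/-- **(A.7)/(A.8) on the real axis, periodised form**: `h(θ) · sin θ = 𝒩′ Σ_{n ∈ ℤ} (θ − 2πn) e^{−γ(θ − 2πn)²}` —
expanding the squares, `= 𝒩′ e^{−γθ²} {θ + 2Σ_{n≥1} [θ cosh 4πγnθ − 2πn sinh 4πγnθ] e^{−4π²γn²}}`, which is (A.7)
multiplied by `sin θ` (and, re-centred at `θ = π`, (A.8)); the print states these for complex `θ` in the strips `𝒟`,
`𝒟̌`, here `θ ∈ ℝ`. [cite: MullerSchiemann1987, Appendix (A.7)–(A.8) p.285] -/
theorem h_mul_sin_eq_periodicGaussian (hγ : 0 < γ) (θ : ℝ) :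
    h γ θ * Real.sin θ = normN' γ * ∑' n : ℤ, (θ - 2 * π * n) * Real.exp (-(γ * (θ - 2 * π * n) ^ 2)) := by
  rw [h, mul_assoc, hk_mul_sin (nome_pos γ) (nome_lt_one hγ), S_eq_periodicGaussian hγ, normN']
  ring

/-- The series of (A.7) with the square expanded: `Σ_{n∈ℤ} (θ − 2πn) e^{4πγnθ − 4π²γn²}` converges. [folklore] -/
private theorem summable_moment_expanded (hγ : 0 < γ) (θ : ℝ) :
    Summable fun n : ℤ => (θ - 2 * π * n) * Real.exp (4 * π * γ * n * θ - 4 * π ^ 2 * γ * n ^ 2) := by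
  have hs₀ := summable_exp_I (-(2 * γ * θ)) (by positivity : 0 < 4 * π * γ)
  have hs₁ := summable_int_mul_exp_I (-(2 * γ * θ)) (by positivity : 0 < 4 * π * γ)
  refine ((hs₀.mul_left θ).sub (hs₁.mul_left (2 * π))).congr fun n => ?_
  have hE : -(2 * π * (n : ℝ) * (-(2 * γ * θ)) + π * (n : ℝ) ^ 2 * (4 * π * γ))
      = 4 * π * γ * n * θ - 4 * π ^ 2 * γ * n ^ 2 := by ring
  rw [hE]
  ring

/-- `e^{−γ(θ−2πn)²} = e^{−γθ²} e^{4πγnθ − 4π²γn²}`. [folklore] -/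
private theorem exp_periodic_eq (γ θ : ℝ) (n : ℤ) :
    Real.exp (-(γ * (θ - 2 * π * n) ^ 2)) =
      Real.exp (-(γ * θ ^ 2)) * Real.exp (4 * π * γ * n * θ - 4 * π ^ 2 * γ * n ^ 2) := by
  rw [← Real.exp_add]
  congr 1
  ring

/-- **(A.7) as printed (multiplied by `sin θ`), for real `θ`**:
`h(θ) sin θ = 𝒩′ e^{−γθ²} {θ + 2 Σ_{n≥1} [θ cosh 4πγnθ − 2πn sinh 4πγnθ] e^{−4π²γn²}}`
(= `𝒩′ θ e^{−γθ²}{1 + 2Σ_{n≥1}[cosh 4πγnθ − 2πnθ⁻¹ sinh 4πnγθ] exp(−4π²γn²)}` of the print, `θ ≠ 0`).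
[cite: MullerSchiemann1987, Appendix (A.7) p.285] -/
theorem h_mul_sin_eq_A7 (hγ : 0 < γ) (θ : ℝ) :
    h γ θ * Real.sin θ = normN' γ * Real.exp (-(γ * θ ^ 2)) *
      (θ + 2 * ∑' n : ℕ, (θ * Real.cosh (4 * π * γ * (n + 1) * θ)
        - 2 * π * (n + 1) * Real.sinh (4 * π * γ * (n + 1) * θ)) * Real.exp (-(4 * π ^ 2 * γ * (n + 1) ^ 2))) := by
  set g : ℤ → ℝ := fun n => (θ - 2 * π * n) * Real.exp (4 * π * γ * n * θ - 4 * π ^ 2 * γ * n ^ 2) with hg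
  have hgs : Summable g := summable_moment_expanded hγ θ
  have h1 : Summable fun l : ℕ => g ((l : ℤ) + 1) :=
    hgs.comp_injective (i := fun l : ℕ => (l : ℤ) + 1) fun a b hab => by simpa using hab
  have h2 : Summable fun l : ℕ => g (-((l : ℤ) + 1)) :=
    hgs.comp_injective (i := fun l : ℕ => -((l : ℤ) + 1)) fun a b hab => by simpa using hab
  have hg0 : g 0 = θ := by simp [hg]
  have hpair : ∀ l : ℕ, g ((l : ℤ) + 1) + g (-((l : ℤ) + 1)) =
      2 * ((θ * Real.cosh (4 * π * γ * (l + 1) * θ)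
        - 2 * π * (l + 1) * Real.sinh (4 * π * γ * (l + 1) * θ)) * Real.exp (-(4 * π ^ 2 * γ * (l + 1) ^ 2))) := by
    intro l
    simp only [hg, Real.cosh_eq, Real.sinh_eq]
    push_cast
    have e1 : Real.exp (4 * π * γ * ((l : ℝ) + 1) * θ - 4 * π ^ 2 * γ * ((l : ℝ) + 1) ^ 2)
        = Real.exp (4 * π * γ * ((l : ℝ) + 1) * θ) * Real.exp (-(4 * π ^ 2 * γ * ((l : ℝ) + 1) ^ 2)) := by
      rw [← Real.exp_add, sub_eq_add_neg]
    have e2 : Real.exp (4 * π * γ * (-((l : ℝ) + 1)) * θ - 4 * π ^ 2 * γ * (-((l : ℝ) + 1)) ^ 2)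
        = Real.exp (-(4 * π * γ * ((l : ℝ) + 1) * θ)) * Real.exp (-(4 * π ^ 2 * γ * ((l : ℝ) + 1) ^ 2)) := by
      have : 4 * π * γ * (-((l : ℝ) + 1)) * θ - 4 * π ^ 2 * γ * (-((l : ℝ) + 1)) ^ 2
          = -(4 * π * γ * ((l : ℝ) + 1) * θ) + -(4 * π ^ 2 * γ * ((l : ℝ) + 1) ^ 2) := by ring
      rw [this, Real.exp_add]
    rw [e1, e2]
    ring
  have hsplit := tsum_of_add_one_of_neg_add_one h1 h2
  have hmm : (∑' l : ℕ, g ((l : ℤ) + 1)) + ∑' l : ℕ, g (-((l : ℤ) + 1)) =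
      2 * ∑' n : ℕ, (θ * Real.cosh (4 * π * γ * (n + 1) * θ)
        - 2 * π * (n + 1) * Real.sinh (4 * π * γ * (n + 1) * θ)) * Real.exp (-(4 * π ^ 2 * γ * (n + 1) ^ 2)) := by
    rw [← h1.tsum_add h2, tsum_congr hpair, tsum_mul_left]
  have hfac : ∀ n : ℤ, (θ - 2 * π * n) * Real.exp (-(γ * (θ - 2 * π * n) ^ 2))
      = Real.exp (-(γ * θ ^ 2)) * g n := by
    intro n
    rw [exp_periodic_eq, hg]
    ring
  rw [h_mul_sin_eq_periodicGaussian hγ, tsum_congr hfac, tsum_mul_left, hsplit, hg0, add_right_comm, hmm]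
  ring

end Poisson


/-! ## §11 (v1.2) The normalisation `𝒩` of (2.20)/(A.1) in closed form: `𝒩 = 1 / Σ_{l≥1} l² e^{−l²/(4γ)}` -/

section Normalisation

variable {q : ℝ}

/-- `Σ (l+1)² q^{(l+1)²}` converges. [folklore] -/
private theorem summable_sq_mul_pow (hq0 : 0 ≤ q) (hq1 : q < 1) :
    Summable fun l : ℕ => ((l : ℝ) + 1) ^ 2 * q ^ ((l + 1) ^ 2) := by
  have h : Summable fun n : ℕ => (n : ℝ) ^ 2 * q ^ n :=
    summable_pow_mul_geometric_of_norm_lt_one 2 (by rwa [Real.norm_of_nonneg hq0])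
  have h' : Summable fun l : ℕ => (((l + 1 : ℕ) : ℝ)) ^ 2 * q ^ (l + 1) :=
    (summable_nat_add_iff (f := fun n : ℕ => (n : ℝ) ^ 2 * q ^ n) 1).mpr h
  refine Summable.of_nonneg_of_le (fun l => by positivity) (fun l => ?_) h'
  have hle : q ^ ((l + 1) ^ 2) ≤ q ^ (l + 1) :=
    pow_le_pow_of_le_one hq0 hq1.le (Nat.le_self_pow two_ne_zero _)
  have := mul_le_mul_of_nonneg_left hle (by positivity : (0 : ℝ) ≤ ((l : ℝ) + 1) ^ 2)
  simpa using this

/-- `dS_q/dθ = Σ_{l≥1} l² q^{l²} cos lθ` (termwise differentiation of (A.1)·`sin θ`).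
[cite: MullerSchiemann1987, Appendix (A.1) p.284] -/
theorem hasDerivAt_S (hq0 : 0 ≤ q) (hq1 : q < 1) (θ : ℝ) :
    HasDerivAt (S q) (∑' l : ℕ, ((l : ℝ) + 1) ^ 2 * q ^ ((l + 1) ^ 2) * Real.cos ((l + 1) * θ)) θ := by
  have hterm : ∀ (l : ℕ) (y : ℝ),
      HasDerivAt (fun y => ((l : ℝ) + 1) * q ^ ((l + 1) ^ 2) * Real.sin ((l + 1) * y))
        (((l : ℝ) + 1) ^ 2 * q ^ ((l + 1) ^ 2) * Real.cos ((l + 1) * y)) y := by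
    intro l y
    have h1 : HasDerivAt (fun y : ℝ => ((l : ℝ) + 1) * y) ((l : ℝ) + 1) y := by
      simpa using (hasDerivAt_id y).const_mul ((l : ℝ) + 1)
    exact ((h1.sin).const_mul (((l : ℝ) + 1) * q ^ ((l + 1) ^ 2))).congr_deriv (by ring)
  have hbound : ∀ (l : ℕ) (y : ℝ),
      ‖((l : ℝ) + 1) ^ 2 * q ^ ((l + 1) ^ 2) * Real.cos ((l + 1) * y)‖ ≤ ((l : ℝ) + 1) ^ 2 * q ^ ((l + 1) ^ 2) := by
    intro l y
    rw [norm_mul, Real.norm_of_nonneg (by positivity), Real.norm_eq_abs]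
    exact mul_le_of_le_one_right (by positivity) (Real.abs_cos_le_one _)
  have h := hasDerivAt_tsum (summable_sq_mul_pow hq0 hq1) hterm hbound (summable_S_term hq0 hq1 0) θ
  exact h

/-- **`hk_q(0) = Σ_{l≥1} l² q^{l²}`** — the value at the unit element (differentiate `hk_q · sin = S_q` at `θ = 0`;
`χ_j(e₀) = 2j + 1 = l` in (2.20)). [cite: MullerSchiemann1987, (2.1) p.263, (2.20) p.265, Appendix (A.1) p.284] -/
theorem hk_zero_eq (hq0 : 0 < q) (hq1 : q < 1) :
    hk q 0 = ∑' l : ℕ, ((l : ℝ) + 1) ^ 2 * q ^ ((l + 1) ^ 2) := by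
  have h1 : HasDerivAt (fun θ => hk q θ * Real.sin θ) (hk q 0) 0 := by
    have h := (hasDerivAt_hk hq0 hq1 0).mul (Real.hasDerivAt_sin 0)
    refine h.congr_deriv ?_
    simp
  have h2 : HasDerivAt (fun θ => hk q θ * Real.sin θ)
      (∑' l : ℕ, ((l : ℝ) + 1) ^ 2 * q ^ ((l + 1) ^ 2) * Real.cos ((l + 1) * 0)) 0 := by
    have hfun : (fun θ => hk q θ * Real.sin θ) = S q := funext fun θ => hk_mul_sin hq0 hq1 θ
    rw [hfun]
    exact hasDerivAt_S hq0.le hq1 0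
  rw [h1.unique h2]
  exact tsum_congr fun l => by simp

variable {γ : ℝ}

/-- **The normalisation of (2.20)/(A.1) in closed form**: `𝒩 = 1 / Σ_{l≥1} l² e^{−l²/(4γ)}` («a normalization factor 𝒩
fixed by (2.1)», «determined by h(0) = 1»; `χ_j(e₀) = 2j + 1`).
[cite: MullerSchiemann1987, (2.1) p.263, (2.20) p.265–266, Appendix (A.1) p.284] -/
theorem normN_eq (hγ : 0 < γ) :
    normN γ = (∑' l : ℕ, ((l : ℝ) + 1) ^ 2 * Real.exp (-(((l : ℝ) + 1) ^ 2 / (4 * γ))))⁻¹ := by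
  rw [normN, hk_zero_eq (nome_pos γ) (nome_lt_one hγ)]
  congr 1
  refine tsum_congr fun l => ?_
  rw [← Nat.cast_succ, nome_pow_sq γ (l + 1)]

/-- `𝒩′ = 2γ√(πγ) / Σ_{l≥1} l² e^{−l²/(4γ)}` — the constant of (A.7) in closed form (the print's (A.9) states its
large-`γ` asymptotics). [cite: MullerSchiemann1987, Appendix (A.7), (A.9) p.285] -/
theorem normN'_eq (hγ : 0 < γ) :
    normN' γ = 2 * γ * Real.sqrt (π * γ) *
      (∑' l : ℕ, ((l : ℝ) + 1) ^ 2 * Real.exp (-(((l : ℝ) + 1) ^ 2 / (4 * γ))))⁻¹ := by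
  rw [normN', normN_eq hγ]

end Normalisation

/-! ## §12 (v1.2) The constant `𝒩′` of (A.7), (A.9): `𝒩′ = (Σ_{n∈ℤ} (1 − 8π²γn²) e^{−4π²γn²})⁻¹ ≥ 1` -/

section NormalisationPrime

variable {γ : ℝ}

/-- `(1 + 2a) e^{−a} ≤ 3 e^{−a/2}` for `a ≥ 0`. [folklore] -/
private theorem one_add_two_mul_exp_le {a : ℝ} (ha : 0 ≤ a) :
    (1 + 2 * a) * Real.exp (-a) ≤ 3 * Real.exp (-(a / 2)) := by
  have h1 : 1 + a / 2 + (a / 2) ^ 2 / 2 ≤ Real.exp (a / 2) :=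
    Real.quadratic_le_exp_of_nonneg (by positivity)
  have h2 : Real.exp (-a) = Real.exp (-(a / 2)) * Real.exp (-(a / 2)) := by
    rw [← Real.exp_add]; congr 1; ring
  have h3 : Real.exp (-(a / 2)) * Real.exp (a / 2) = 1 := by
    rw [← Real.exp_add, neg_add_cancel, Real.exp_zero]
  have hpos : 0 < Real.exp (-(a / 2)) := Real.exp_pos _
  rw [h2]
  -- (1 + 2a) e^{-a/2} ≤ 3  ⟸  (1 + 2a) ≤ 3 e^{a/2}
  have h4 : (1 + 2 * a) * Real.exp (-(a / 2)) ≤ 3 := by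
    have : (1 + 2 * a) ≤ 3 * Real.exp (a / 2) := by nlinarith [h1, sq_nonneg a]
    calc (1 + 2 * a) * Real.exp (-(a / 2))
        ≤ (3 * Real.exp (a / 2)) * Real.exp (-(a / 2)) :=
          mul_le_mul_of_nonneg_right this hpos.le
      _ = 3 := by rw [mul_assoc, mul_comm (Real.exp (a / 2)), h3, mul_one]
  calc (1 + 2 * a) * (Real.exp (-(a / 2)) * Real.exp (-(a / 2)))
      = ((1 + 2 * a) * Real.exp (-(a / 2))) * Real.exp (-(a / 2)) := by ring
    _ ≤ 3 * Real.exp (-(a / 2)) := mul_le_mul_of_nonneg_right h4 hpos.le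

/-- For `|y| < 1` and every `n ∈ ℤ`: `(2π|n| − 1)² − 1 ≤ (y − 2πn)²`. [folklore] -/
private theorem sq_lower (n : ℤ) {y : ℝ} (hy : |y| < 1) :
    (2 * π * |(n : ℝ)| - 1) ^ 2 - 1 ≤ (y - 2 * π * n) ^ 2 := by
  rcases eq_or_ne n 0 with rfl | hn
  · simpa using sq_nonneg y
  · have hn1 : (1 : ℝ) ≤ |(n : ℝ)| := by
      rw [← Int.cast_abs]; exact_mod_cast Int.one_le_abs hn
    have hπ3 : (3 : ℝ) < π := Real.pi_gt_three
    have hpos : 0 ≤ 2 * π * |(n : ℝ)| - 1 := by nlinarith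
    have htri : 2 * π * |(n : ℝ)| - 1 ≤ |y - 2 * π * n| := by
      have h1 : |2 * π * (n : ℝ)| - |y| ≤ |y - 2 * π * n| := by
        have := abs_sub_abs_le_abs_sub (2 * π * (n : ℝ)) y
        rwa [abs_sub_comm] at this
      have h2 : |2 * π * (n : ℝ)| = 2 * π * |(n : ℝ)| := by
        rw [abs_mul, abs_of_pos (by positivity : (0 : ℝ) < 2 * π)]
      linarith
    have hsq : (2 * π * |(n : ℝ)| - 1) ^ 2 ≤ |y - 2 * π * n| ^ 2 := pow_le_pow_left₀ hpos htri 2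
    rw [sq_abs] at hsq
    linarith

/-- `|n| ≤ (2π|n| − 1)² − 1` for every `n ∈ ℤ`. [folklore] -/
private theorem abs_le_sq_sub_one (n : ℤ) : |(n : ℝ)| ≤ (2 * π * |(n : ℝ)| - 1) ^ 2 - 1 := by
  rcases eq_or_ne n 0 with rfl | hn
  · simp
  · have hn1 : (1 : ℝ) ≤ |(n : ℝ)| := by
      rw [← Int.cast_abs]; exact_mod_cast Int.one_le_abs hn
    have hπ3 : (3 : ℝ) < π := Real.pi_gt_three
    set m : ℝ := |(n : ℝ)| with hm
    have h5 : 5 * m ≤ 2 * π * m - 1 := by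
      nlinarith [mul_nonneg (sub_nonneg.mpr hπ3.le) (sub_nonneg.mpr hn1)]
    have h25 : (5 * m) ^ 2 ≤ (2 * π * m - 1) ^ 2 := pow_le_pow_left₀ (by positivity) h5 2
    have hm2 : m ≤ m ^ 2 := by nlinarith
    calc m ≤ 25 * m ^ 2 - 1 := by nlinarith
      _ = (5 * m) ^ 2 - 1 := by ring
      _ ≤ (2 * π * m - 1) ^ 2 - 1 := by linarith

/-- The dominating sequence `3 e^{γ/2} e^{−γ|n|/2}` is summable over `ℤ`. [folklore] -/
private theorem summable_dominating (hγ : 0 < γ) :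
    Summable fun n : ℤ => 3 * Real.exp (γ / 2) * Real.exp (-(γ / 2 * |(n : ℝ)|)) := by
  have hr : Real.exp (-(γ / 2)) < 1 := Real.exp_lt_one_iff.mpr (by linarith)
  have hr0 : 0 ≤ Real.exp (-(γ / 2)) := (Real.exp_pos _).le
  have hgeo : Summable fun n : ℕ => 3 * Real.exp (γ / 2) * Real.exp (-(γ / 2)) ^ n :=
    (summable_geometric_of_lt_one hr0 hr).mul_left _
  have hnat : Summable fun n : ℕ => 3 * Real.exp (γ / 2) * Real.exp (-(γ / 2 * (n : ℝ))) := by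
    refine hgeo.congr fun n => ?_
    rw [← Real.exp_nat_mul]
    congr 2
    ring
  refine Summable.of_nat_of_neg ?_ ?_
  · refine hnat.congr fun n => ?_
    simp
  · refine hnat.congr fun n => ?_
    simp

/-- **The first-moment periodised Gaussian is differentiable at `0` term by term**:
`(d/dθ)|₀ Σ_{n∈ℤ} (θ − 2πn) e^{−γ(θ−2πn)²} = Σ_{n∈ℤ} (1 − 8π²γn²) e^{−4π²γn²}` (dominated termwise differentiation on
`|θ| < 1`). [cite: MullerSchiemann1987, Appendix (A.7), (A.9) p.285] -/
theorem hasDerivAt_periodicMoment_zero (hγ : 0 < γ) :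
    HasDerivAt (fun θ : ℝ => ∑' n : ℤ, (θ - 2 * π * n) * Real.exp (-(γ * (θ - 2 * π * n) ^ 2)))
      (∑' n : ℤ, (1 - 8 * π ^ 2 * γ * n ^ 2) * Real.exp (-(4 * π ^ 2 * γ * n ^ 2))) 0 := by
  set g : ℤ → ℝ → ℝ := fun n y => (y - 2 * π * n) * Real.exp (-(γ * (y - 2 * π * n) ^ 2)) with hg
  set g' : ℤ → ℝ → ℝ := fun n y => (1 - 2 * γ * (y - 2 * π * n) ^ 2) * Real.exp (-(γ * (y - 2 * π * n) ^ 2))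
    with hg'
  have hderiv : ∀ (n : ℤ) (y : ℝ), y ∈ Set.Ioo (-1 : ℝ) 1 → HasDerivAt (g n) (g' n y) y := by
    intro n y _
    have h1 : HasDerivAt (fun y : ℝ => y - 2 * π * n) 1 y := (hasDerivAt_id y).sub_const _
    have h2 := ((h1.fun_pow 2).const_mul γ).fun_neg
    have h3 := h1.mul h2.exp
    refine h3.congr_deriv ?_
    simp only [hg', show (2 : ℕ) - 1 = 1 from rfl, pow_one, Nat.cast_ofNat]
    ring
  have hbound : ∀ (n : ℤ) (y : ℝ), y ∈ Set.Ioo (-1 : ℝ) 1 →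
      ‖g' n y‖ ≤ 3 * Real.exp (γ / 2) * Real.exp (-(γ / 2 * |(n : ℝ)|)) := by
    intro n y hy
    have hy' : |y| < 1 := abs_lt.mpr hy
    set a : ℝ := γ * (y - 2 * π * n) ^ 2 with ha
    have ha0 : 0 ≤ a := by positivity
    have e1 : ‖g' n y‖ ≤ (1 + 2 * a) * Real.exp (-a) := by
      simp only [hg', Real.norm_eq_abs, abs_mul, Real.abs_exp]
      refine mul_le_mul_of_nonneg_right ?_ (Real.exp_pos _).le
      calc |1 - 2 * γ * (y - 2 * π * ↑n) ^ 2| ≤ |(1 : ℝ)| + |2 * γ * (y - 2 * π * ↑n) ^ 2| := abs_sub _ _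
        _ = 1 + 2 * a := by rw [abs_one, abs_of_nonneg (by positivity), ha]; ring
    have e2 : (1 + 2 * a) * Real.exp (-a) ≤ 3 * Real.exp (-(a / 2)) := one_add_two_mul_exp_le ha0
    have e3 : Real.exp (-(a / 2)) ≤ Real.exp (γ / 2) * Real.exp (-(γ / 2 * |(n : ℝ)|)) := by
      rw [← Real.exp_add]
      apply Real.exp_le_exp.mpr
      have h1 := sq_lower n hy'
      have h2 := abs_le_sq_sub_one n
      have h3 : γ * |(n : ℝ)| ≤ γ * (y - 2 * π * n) ^ 2 := by nlinarith
      rw [ha]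
      linarith
    calc ‖g' n y‖ ≤ (1 + 2 * a) * Real.exp (-a) := e1
      _ ≤ 3 * Real.exp (-(a / 2)) := e2
      _ ≤ 3 * (Real.exp (γ / 2) * Real.exp (-(γ / 2 * |(n : ℝ)|))) :=
          mul_le_mul_of_nonneg_left e3 (by norm_num)
      _ = 3 * Real.exp (γ / 2) * Real.exp (-(γ / 2 * |(n : ℝ)|)) := by ring
  have h0mem : (0 : ℝ) ∈ Set.Ioo (-1 : ℝ) 1 := by constructor <;> norm_num
  have hg0 : Summable fun n : ℤ => g n 0 := by
    have h := (summable_moment_expanded hγ 0).mul_left (Real.exp (-(γ * (0 : ℝ) ^ 2)))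
    refine h.congr fun n => ?_
    simp only [hg]
    rw [exp_periodic_eq]
    ring
  have h := hasDerivAt_tsum_of_isPreconnected (summable_dominating hγ) isOpen_Ioo isPreconnected_Ioo
    hderiv hbound h0mem hg0 h0mem
  refine h.congr_deriv (tsum_congr fun n => ?_)
  simp only [hg']
  ring_nf

/-- **The constant `𝒩′` of (A.7) «determined by normalization of (A.7)» (`h(0) = 1`), in closed form:**
`𝒩′ = (Σ_{n∈ℤ} (1 − 8π²γn²) e^{−4π²γn²})⁻¹ = (1 + 2Σ_{n≥1}(1 − 8π²γn²)e^{−4π²γn²})⁻¹` — in (A.7) at `θ → 0`,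
`cosh 4πγnθ → 1` and `2πnθ⁻¹ sinh 4πnγθ → 8π²γn²`. Kernel route: the two derivatives at `0` of
`S_q = 2γ√(πγ) · Σ_{n∈ℤ} (θ − 2πn)e^{−γ(θ−2πn)²}` compared (`S′_q(0) = hk_q(0) = 𝒩⁻¹`, `hasDerivAt_periodicMoment_zero`).
The print's (A.9) «𝒩′ = 1 + 𝒪(γ exp{−4π²γ})» is the large-`γ` asymptotics of this value (one-sided form:
`one_le_normN'`). [cite: MullerSchiemann1987, Appendix (A.7), (A.9) p.285] -/
theorem normN'_eq_inv_tsum (hγ : 0 < γ) :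
    normN' γ = (∑' n : ℤ, (1 - 8 * π ^ 2 * γ * n ^ 2) * Real.exp (-(4 * π ^ 2 * γ * n ^ 2)))⁻¹ := by
  have hq0 := nome_pos γ
  have hq1 := nome_lt_one hγ
  have hc : 0 < 2 * γ * Real.sqrt (π * γ) := by positivity
  -- `P = S / (2γ√(πγ))` as functions
  have hP : (fun θ : ℝ => ∑' n : ℤ, (θ - 2 * π * n) * Real.exp (-(γ * (θ - 2 * π * n) ^ 2)))
      = fun θ => (2 * γ * Real.sqrt (π * γ))⁻¹ * S (nome γ) θ := by
    funext θ
    rw [S_eq_periodicGaussian hγ θ, ← mul_assoc, inv_mul_cancel₀ hc.ne', one_mul]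
  -- derivative of the right-hand side at 0
  have h1 : HasDerivAt (fun θ => (2 * γ * Real.sqrt (π * γ))⁻¹ * S (nome γ) θ)
      ((2 * γ * Real.sqrt (π * γ))⁻¹ * hk (nome γ) 0) 0 := by
    have h := (hasDerivAt_S hq0.le hq1 0).const_mul (2 * γ * Real.sqrt (π * γ))⁻¹
    refine h.congr_deriv ?_
    rw [hk_zero_eq hq0 hq1]
    congr 1
    exact tsum_congr fun l => by simp
  have h2 := hasDerivAt_periodicMoment_zero hγ
  rw [hP] at h2
  have hEq := h1.unique h2
  -- `𝒩′ = 2γ√(πγ)/hk(0)` and `hk(0)/(2γ√(πγ)) = Σ …`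
  rw [normN', normN, ← hEq]
  have hk0 : hk (nome γ) 0 ≠ 0 := (hk_pos hq0 hq1 0).ne'
  field_simp

/-- **(A.9), one-sided: `𝒩′ ≥ 1` for `γ ≥ 1/(8π²)`** — every `n ≠ 0` term of the series in `normN'_eq_inv_tsum` is
`≤ 0`, so the series is `≤ 1` and its inverse `𝒩′` is `≥ 1`: the correction in «𝒩′ = 1 + 𝒪(γ exp{−4π²γ})» is
nonnegative. (The two-sided rate `𝒪(γe^{−4π²γ})` is not claimed here.) [cite: MullerSchiemann1987, Appendix (A.9) p.285] -/
theorem one_le_normN' (hγ : 1 / (8 * π ^ 2) ≤ γ) : 1 ≤ normN' γ := by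
  have hπ : 0 < π := Real.pi_pos
  have hγ0 : 0 < γ := lt_of_lt_of_le (by positivity) hγ
  set f : ℤ → ℝ := fun n => (1 - 8 * π ^ 2 * γ * n ^ 2) * Real.exp (-(4 * π ^ 2 * γ * n ^ 2)) with hf
  have hpos : 0 < ∑' n : ℤ, f n := by
    have h := normN'_eq_inv_tsum hγ0
    have hN : 0 < normN' γ := by
      rw [normN']; exact mul_pos (by positivity) (normN_pos hγ0)
    rw [h] at hN
    exact inv_pos.mp hN
  have hsum : Summable f := by
    by_contra hns
    rw [tsum_eq_zero_of_not_summable hns] at hpos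
    exact lt_irrefl _ hpos
  have hle : ∑' n : ℤ, f n ≤ 1 := by
    rw [hsum.tsum_eq_add_tsum_ite 0]
    have hf0 : f 0 = 1 := by simp [hf]
    have hrest : ∑' n : ℤ, (if n = 0 then 0 else f n) ≤ 0 := by
      refine tsum_nonpos fun n => ?_
      split_ifs with hn
      · exact le_rfl
      · have hn1 : (1 : ℝ) ≤ (n : ℝ) ^ 2 := by
          have : (1 : ℤ) ≤ n ^ 2 := by nlinarith [Int.one_le_abs hn, sq_abs n]
          exact_mod_cast this
        have hcoef : 1 - 8 * π ^ 2 * γ * (n : ℝ) ^ 2 ≤ 0 := by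
          have : 1 ≤ 8 * π ^ 2 * γ := by
            rw [div_le_iff₀ (by positivity)] at hγ; linarith
          nlinarith [this, hn1, mul_nonneg (by positivity : (0:ℝ) ≤ 8 * π ^ 2 * γ) (sub_nonneg.mpr hn1)]
        exact mul_nonpos_of_nonpos_of_nonneg hcoef (Real.exp_pos _).le
    linarith
  rw [normN'_eq_inv_tsum hγ0]
  exact (one_le_inv_iff₀.mpr ⟨hpos, hle⟩)

end NormalisationPrime


/-! ## §13 (v1.3) (A.9) two-sided: `1 ≤ 𝒩′ ≤ 1 + 64π² γ e^{−4π²γ}` for `γ ≥ 1` -/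

section NormalisationPrimeRate

variable {γ : ℝ}

/-- `(n + 1)² ≤ 4ⁿ`. [folklore] -/
private theorem sq_succ_le_four_pow (n : ℕ) : (n + 1) ^ 2 ≤ 4 ^ n := by
  induction n with
  | zero => simp
  | succ k ih =>
    have h1 : (k + 2) ^ 2 ≤ 4 * (k + 1) ^ 2 :=
      calc (k + 2) ^ 2 ≤ (k + 2) ^ 2 + (3 * k ^ 2 + 4 * k) := Nat.le_add_right _ _
        _ = 4 * (k + 1) ^ 2 := by ring
    calc (k + 1 + 1) ^ 2 = (k + 2) ^ 2 := by ring
      _ ≤ 4 * (k + 1) ^ 2 := h1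
      _ ≤ 4 * 4 ^ k := Nat.mul_le_mul_left 4 ih
      _ = 4 ^ (k + 1) := by ring

/-- `4 e^{−8π²} ≤ 1/2`. [folklore] -/
private theorem four_mul_exp_le_half : 4 * Real.exp (-(8 * π ^ 2)) ≤ 1 / 2 := by
  have hπ3 : (3 : ℝ) < π := Real.pi_gt_three
  have ha : Real.exp (-(8 * π ^ 2)) ≤ 1 / 8 := by
    rw [Real.exp_neg, inv_le_comm₀ (Real.exp_pos _) (by norm_num : (0 : ℝ) < 1 / 8)]
    calc (1 / 8 : ℝ)⁻¹ = 8 := by norm_num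
      _ ≤ 8 * π ^ 2 + 1 := by nlinarith
      _ ≤ Real.exp (8 * π ^ 2) := Real.add_one_le_exp _
  linarith

/-- For `γ ≥ 1` and `n ∈ ℕ`: `(n+1)² e^{−4π²γ(n+1)²} ≤ e^{−4π²γ} (4e^{−8π²})ⁿ`. [folklore] -/
private theorem sq_mul_exp_le (hγ : 1 ≤ γ) (n : ℕ) :
    ((n : ℝ) + 1) ^ 2 * Real.exp (-(4 * π ^ 2 * γ * ((n : ℝ) + 1) ^ 2))
      ≤ Real.exp (-(4 * π ^ 2 * γ)) * (4 * Real.exp (-(8 * π ^ 2))) ^ n := by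
  have hπ : 0 < π := Real.pi_pos
  have h4 : ((n : ℝ) + 1) ^ 2 ≤ 4 ^ n := by exact_mod_cast sq_succ_le_four_pow n
  have hn : (0 : ℝ) ≤ n := n.cast_nonneg
  have hexp : Real.exp (-(4 * π ^ 2 * γ * ((n : ℝ) + 1) ^ 2))
      ≤ Real.exp (-(4 * π ^ 2 * γ)) * Real.exp (-(8 * π ^ 2)) ^ n := by
    rw [← Real.exp_nat_mul, ← Real.exp_add]
    apply Real.exp_le_exp.mpr
    have h1 : 2 * (n : ℝ) ≤ γ * ((n : ℝ) ^ 2 + 2 * n) := by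
      nlinarith [mul_nonneg (sub_nonneg.mpr hγ) (by positivity : (0 : ℝ) ≤ (n : ℝ) ^ 2 + 2 * n)]
    nlinarith [mul_le_mul_of_nonneg_left h1 (by positivity : (0 : ℝ) ≤ 4 * π ^ 2)]
  calc ((n : ℝ) + 1) ^ 2 * Real.exp (-(4 * π ^ 2 * γ * ((n : ℝ) + 1) ^ 2))
      ≤ 4 ^ n * (Real.exp (-(4 * π ^ 2 * γ)) * Real.exp (-(8 * π ^ 2)) ^ n) :=
        mul_le_mul h4 hexp (Real.exp_pos _).le (by positivity)
    _ = Real.exp (-(4 * π ^ 2 * γ)) * (4 * Real.exp (-(8 * π ^ 2))) ^ n := by rw [mul_pow]; ring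

/-- `64π²γ ≤ e^{4π²γ}` for `γ ≥ 1`. [folklore] -/
private theorem sixtyfour_le_exp (hγ : 1 ≤ γ) : 64 * π ^ 2 * γ ≤ Real.exp (4 * π ^ 2 * γ) := by
  have hπ3 : (3 : ℝ) < π := Real.pi_gt_three
  have hπ9 : (9 : ℝ) ≤ π ^ 2 := by nlinarith
  have ht : (8 : ℝ) ≤ π ^ 2 * γ := by nlinarith [mul_nonneg (sub_nonneg.mpr hπ9) (sub_nonneg.mpr hγ)]
  have hq := Real.quadratic_le_exp_of_nonneg (by positivity : (0 : ℝ) ≤ 4 * π ^ 2 * γ)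
  nlinarith [mul_nonneg (by positivity : (0 : ℝ) ≤ π ^ 2 * γ) (sub_nonneg.mpr ht),
    (by positivity : (0 : ℝ) ≤ 4 * π ^ 2 * γ)]

/-- **(A.9), two-sided: `𝒩′ ≤ 1 + 64π² γ e^{−4π²γ}` for `γ ≥ 1`** (with `one_le_normN'`:
`0 ≤ 𝒩′ − 1 ≤ 64π²γe^{−4π²γ}`, an explicit form of «𝒩′ = 1 + 𝒪(γ exp{−4π²γ})»). Proof: in
`𝒩′⁻¹ = 1 + 2Σ_{n≥1}(1 − 8π²γn²)e^{−4π²γn²}` each term is `≥ −8π²γ n²e^{−4π²γn²} ≥ −8π²γ e^{−4π²γ}(4e^{−8π²})^{n−1}`,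
so `𝒩′⁻¹ ≥ 1 − 32π²γe^{−4π²γ} ≥ ½`. [cite: MullerSchiemann1987, Appendix (A.9) p.285] -/
theorem normN'_le (hγ : 1 ≤ γ) :
    normN' γ ≤ 1 + 64 * π ^ 2 * γ * Real.exp (-(4 * π ^ 2 * γ)) := by
  have hπ : 0 < π := Real.pi_pos
  have hγ0 : 0 < γ := by linarith
  set f : ℤ → ℝ := fun n => (1 - 8 * π ^ 2 * γ * n ^ 2) * Real.exp (-(4 * π ^ 2 * γ * n ^ 2)) with hf
  have hN : normN' γ = (∑' n : ℤ, f n)⁻¹ := normN'_eq_inv_tsum hγ0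
  have hpos : 0 < ∑' n : ℤ, f n := by
    have hN' : 0 < normN' γ := by
      rw [normN']; exact mul_pos (by positivity) (normN_pos hγ0)
    rw [hN] at hN'
    exact inv_pos.mp hN'
  have hsum : Summable f := by
    by_contra hns
    rw [tsum_eq_zero_of_not_summable hns] at hpos
    exact lt_irrefl _ hpos
  -- the geometric majorant
  set r : ℝ := 4 * Real.exp (-(8 * π ^ 2)) with hr
  have hr0 : 0 ≤ r := by positivity
  have hr1 : r ≤ 1 / 2 := four_mul_exp_le_half
  have hgeo : Summable fun n : ℕ => r ^ n := summable_geometric_of_lt_one hr0 (by linarith)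
  have hgeo_le : ∑' n : ℕ, r ^ n ≤ 2 := by
    rw [tsum_geometric_of_lt_one hr0 (by linarith), inv_le_comm₀ (by linarith) (by norm_num : (0 : ℝ) < 2)]
    linarith
  set ε : ℝ := 32 * π ^ 2 * γ * Real.exp (-(4 * π ^ 2 * γ)) with hε
  have hε0 : 0 ≤ ε := by positivity
  -- ε ≤ 1/2
  have hε1 : ε ≤ 1 / 2 := by
    have hE := sixtyfour_le_exp hγ
    have hEpos : 0 < Real.exp (4 * π ^ 2 * γ) := Real.exp_pos _
    have hinv : Real.exp (-(4 * π ^ 2 * γ)) = (Real.exp (4 * π ^ 2 * γ))⁻¹ := Real.exp_neg _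
    rw [hε, hinv]
    rw [show 32 * π ^ 2 * γ * (Real.exp (4 * π ^ 2 * γ))⁻¹ = (32 * π ^ 2 * γ) / Real.exp (4 * π ^ 2 * γ)
      from div_eq_mul_inv _ _ |>.symm, div_le_iff₀ hEpos]
    linarith
  -- the positive-index part, summable and bounded below
  have hsum1 : Summable fun n : ℕ => f ((n : ℤ) + 1) := by
    have h := hsum.comp_injective (i := fun n : ℕ => (n : ℤ) + 1) fun a b hab => by simpa using hab
    exact h
  have hsum2 : Summable fun n : ℕ => f (-((n : ℤ) + 1)) := by
    refine hsum1.congr fun n => ?_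
    simp only [hf, Int.cast_neg, neg_sq]
  have hlow : ∀ n : ℕ, -(8 * π ^ 2 * γ * Real.exp (-(4 * π ^ 2 * γ))) * r ^ n ≤ f ((n : ℤ) + 1) := by
    intro n
    have h1 := sq_mul_exp_le hγ n
    have hcast : (((n : ℤ) + 1 : ℤ) : ℝ) = (n : ℝ) + 1 := by push_cast; ring
    simp only [hf, hcast]
    have hEpos : 0 < Real.exp (-(4 * π ^ 2 * γ * ((n : ℝ) + 1) ^ 2)) := Real.exp_pos _
    nlinarith [mul_le_mul_of_nonneg_left h1 (by positivity : (0 : ℝ) ≤ 8 * π ^ 2 * γ), hEpos]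
  have hS1 : -(16 * π ^ 2 * γ * Real.exp (-(4 * π ^ 2 * γ))) ≤ ∑' n : ℕ, f ((n : ℤ) + 1) := by
    have h := Summable.tsum_le_tsum hlow (hgeo.mul_left _) hsum1
    rw [tsum_mul_left] at h
    have hc : 0 ≤ 8 * π ^ 2 * γ * Real.exp (-(4 * π ^ 2 * γ)) := by positivity
    nlinarith [mul_le_mul_of_nonneg_left hgeo_le hc]
  -- assemble: Σ_ℤ f = Σ f(n+1) + f 0 + Σ f(-(n+1)) = 1 + 2 Σ f(n+1) ≥ 1 - ε
  have hsplit : ∑' n : ℤ, f n = (∑' n : ℕ, f ((n : ℤ) + 1)) + f 0 + ∑' n : ℕ, f (-((n : ℤ) + 1)) :=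
    tsum_of_add_one_of_neg_add_one hsum1 hsum2
  have hf0 : f 0 = 1 := by simp [hf]
  have hev : ∑' n : ℕ, f (-((n : ℤ) + 1)) = ∑' n : ℕ, f ((n : ℤ) + 1) :=
    tsum_congr fun n => by simp only [hf, Int.cast_neg, neg_sq]
  have hge : 1 - ε ≤ ∑' n : ℤ, f n := by
    rw [hsplit, hf0, hev, hε]
    linarith
  -- invert
  have h1ε : 0 < 1 - ε := by linarith
  rw [hN]
  calc (∑' n : ℤ, f n)⁻¹ ≤ (1 - ε)⁻¹ := inv_anti₀ h1ε hge
    _ ≤ 1 + 2 * ε := by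
        rw [← one_div, div_le_iff₀ h1ε]
        nlinarith
    _ = 1 + 64 * π ^ 2 * γ * Real.exp (-(4 * π ^ 2 * γ)) := by rw [hε]; ring

end NormalisationPrimeRate


/-! ## §14 (v1.4) Even/odd power-series tails: `cosh`, `sinh`, `sin` minus their Taylor polynomials -/

section Tails

/-- `a! · k! ≤ (a + k)!` (in `ℝ`). [folklore] -/
private theorem factorial_mul_factorial_le (a k : ℕ) :
    (a.factorial : ℝ) * (k.factorial : ℝ) ≤ ((a + k).factorial : ℝ) := by
  have h := Nat.le_of_dvd (Nat.factorial_pos _) (Nat.factorial_mul_factorial_dvd_factorial_add a k)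
  exact_mod_cast h

/-- The even power series of `cosh |x|` in the form used for domination: `Σ |x|^{2n}/(2n)! = cosh x`. [folklore] -/
private theorem hasSum_cosh_abs (x : ℝ) :
    HasSum (fun n : ℕ => |x| ^ (2 * n) / ((2 * n).factorial : ℝ)) (Real.cosh x) := by
  have h := Real.hasSum_cosh |x|
  rw [Real.cosh_abs] at h
  exact h

/-- **Generic tail bound.** For signs `|ε n| ≤ 1` and a shift `p`, the tail from index `k` of the power series
`Σ ε_n x^{2n+p}/(2n+p)!` is at most `|x|^{2k+p} cosh x / (2k+p)!` (because `(2n)! (2k+p)! ≤ (2n+2k+p)!` and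
`Σ |x|^{2n}/(2n)! = cosh x`). [folklore] -/
private theorem abs_tsum_tail_le (x : ℝ) (p k : ℕ) (ε : ℕ → ℝ) (hε : ∀ n, |ε n| ≤ 1) :
    |∑' n : ℕ, ε (n + k) * x ^ (2 * (n + k) + p) / ((2 * (n + k) + p).factorial : ℝ)|
      ≤ |x| ^ (2 * k + p) * Real.cosh x / ((2 * k + p).factorial : ℝ) := by
  set g : ℕ → ℝ := fun n => |x| ^ (2 * k + p) / ((2 * k + p).factorial : ℝ) * (|x| ^ (2 * n) / ((2 * n).factorial : ℝ)) with hg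
  have hgs : HasSum g (|x| ^ (2 * k + p) / ((2 * k + p).factorial : ℝ) * Real.cosh x) :=
    (hasSum_cosh_abs x).mul_left _
  have hle : ∀ n, |ε (n + k) * x ^ (2 * (n + k) + p) / ((2 * (n + k) + p).factorial : ℝ)| ≤ g n := by
    intro n
    have hfac : ((2 * n).factorial : ℝ) * ((2 * k + p).factorial : ℝ) ≤ ((2 * (n + k) + p).factorial : ℝ) := by
      have := factorial_mul_factorial_le (2 * n) (2 * k + p)
      have e : 2 * n + (2 * k + p) = 2 * (n + k) + p := by ring
      rwa [e] at this
    have hf1 : (0 : ℝ) < ((2 * n).factorial : ℝ) := by exact_mod_cast Nat.factorial_pos _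
    have hf2 : (0 : ℝ) < ((2 * k + p).factorial : ℝ) := by exact_mod_cast Nat.factorial_pos _
    have hf3 : (0 : ℝ) < ((2 * (n + k) + p).factorial : ℝ) := by exact_mod_cast Nat.factorial_pos _
    rw [abs_div, abs_mul, Nat.abs_cast, abs_pow]
    have hx : |ε (n + k)| * |x| ^ (2 * (n + k) + p) ≤ |x| ^ (2 * (n + k) + p) := by
      have := mul_le_mul_of_nonneg_right (hε (n + k)) (pow_nonneg (abs_nonneg x) (2 * (n + k) + p))
      simpa using this
    calc |ε (n + k)| * |x| ^ (2 * (n + k) + p) / ((2 * (n + k) + p).factorial : ℝ)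
        ≤ |x| ^ (2 * (n + k) + p) / ((2 * (n + k) + p).factorial : ℝ) := div_le_div_of_nonneg_right hx hf3.le
      _ ≤ |x| ^ (2 * (n + k) + p) / (((2 * n).factorial : ℝ) * ((2 * k + p).factorial : ℝ)) :=
          div_le_div_of_nonneg_left (pow_nonneg (abs_nonneg x) _) (mul_pos hf1 hf2) hfac
      _ = g n := by
          rw [hg]
          have e : |x| ^ (2 * (n + k) + p) = |x| ^ (2 * k + p) * |x| ^ (2 * n) := by
            rw [← pow_add]; congr 1; ring
          rw [e]
          field_simp
  have h := tsum_of_norm_bounded hgs (fun n => (Real.norm_eq_abs _).le.trans (hle n))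
  rw [Real.norm_eq_abs] at h
  calc |∑' n : ℕ, ε (n + k) * x ^ (2 * (n + k) + p) / ((2 * (n + k) + p).factorial : ℝ)|
      ≤ |x| ^ (2 * k + p) / ((2 * k + p).factorial : ℝ) * Real.cosh x := h
    _ = |x| ^ (2 * k + p) * Real.cosh x / ((2 * k + p).factorial : ℝ) := by ring

/-- **`cosh` to order 6 with remainder**: `|cosh x − (1 + x²/2 + x⁴/24 + x⁶/720)| ≤ x⁸ cosh x / 8!`. [folklore] -/
private theorem abs_cosh_sub_taylor_le (x : ℝ) :
    |Real.cosh x - (1 + x ^ 2 / 2 + x ^ 4 / 24 + x ^ 6 / 720)| ≤ x ^ 8 * Real.cosh x / 40320 := by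
  have hs := Real.hasSum_cosh x
  set f : ℕ → ℝ := fun n => x ^ (2 * n) / ((2 * n).factorial : ℝ) with hf
  have hsplit := hs.summable.sum_add_tsum_nat_add 4
  have hhead : ∑ i ∈ Finset.range 4, f i = 1 + x ^ 2 / 2 + x ^ 4 / 24 + x ^ 6 / 720 := by
    simp [hf, Finset.sum_range_succ, Nat.factorial]
  have htail : Real.cosh x - (1 + x ^ 2 / 2 + x ^ 4 / 24 + x ^ 6 / 720) = ∑' n, f (n + 4) := by
    rw [← hhead, ← hs.tsum_eq, ← hsplit]; ring
  have h := abs_tsum_tail_le x 0 4 (fun _ => 1) (fun _ => by simp)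
  simp only [one_mul, add_zero] at h
  rw [htail]
  calc |∑' n, f (n + 4)| = |∑' n : ℕ, x ^ (2 * (n + 4)) / ((2 * (n + 4)).factorial : ℝ)| := by rfl
    _ ≤ |x| ^ (2 * 4) * Real.cosh x / ((2 * 4).factorial : ℝ) := h
    _ = x ^ 8 * Real.cosh x / 40320 := by
        rw [show 2 * 4 = 8 by norm_num, pow_abs,
          abs_of_nonneg (by positivity : (0 : ℝ) ≤ x ^ 8)]
        norm_num [Nat.factorial]

/-- **`sinh` to order 7 with remainder**: `|sinh x − (x + x³/6 + x⁵/120 + x⁷/5040)| ≤ |x|⁹ cosh x / 9!`. [folklore] -/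
private theorem abs_sinh_sub_taylor_le (x : ℝ) :
    |Real.sinh x - (x + x ^ 3 / 6 + x ^ 5 / 120 + x ^ 7 / 5040)| ≤ |x| ^ 9 * Real.cosh x / 362880 := by
  have hs := Real.hasSum_sinh x
  set f : ℕ → ℝ := fun n => x ^ (2 * n + 1) / ((2 * n + 1).factorial : ℝ) with hf
  have hsplit := hs.summable.sum_add_tsum_nat_add 4
  have hhead : ∑ i ∈ Finset.range 4, f i = x + x ^ 3 / 6 + x ^ 5 / 120 + x ^ 7 / 5040 := by
    simp [hf, Finset.sum_range_succ, Nat.factorial]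
    norm_num
  have htail : Real.sinh x - (x + x ^ 3 / 6 + x ^ 5 / 120 + x ^ 7 / 5040) = ∑' n, f (n + 4) := by
    rw [← hhead, ← hs.tsum_eq, ← hsplit]; ring
  have h := abs_tsum_tail_le x 1 4 (fun _ => 1) (fun _ => by simp)
  simp only [one_mul] at h
  rw [htail]
  calc |∑' n, f (n + 4)| = |∑' n : ℕ, x ^ (2 * (n + 4) + 1) / ((2 * (n + 4) + 1).factorial : ℝ)| := by rfl
    _ ≤ |x| ^ (2 * 4 + 1) * Real.cosh x / ((2 * 4 + 1).factorial : ℝ) := h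
    _ = |x| ^ 9 * Real.cosh x / 362880 := by norm_num [Nat.factorial]

/-- **`sin` to order 7 with remainder**: `|sin x − (x − x³/6 + x⁵/120 − x⁷/5040)| ≤ |x|⁹ cosh x / 9!`. [folklore] -/
private theorem abs_sin_sub_taylor_le (x : ℝ) :
    |Real.sin x - (x - x ^ 3 / 6 + x ^ 5 / 120 - x ^ 7 / 5040)| ≤ |x| ^ 9 * Real.cosh x / 362880 := by
  have hs := Real.hasSum_sin x
  set f : ℕ → ℝ := fun n => (-1) ^ n * x ^ (2 * n + 1) / ((2 * n + 1).factorial : ℝ) with hf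
  have hsplit := hs.summable.sum_add_tsum_nat_add 4
  have hhead : ∑ i ∈ Finset.range 4, f i = x - x ^ 3 / 6 + x ^ 5 / 120 - x ^ 7 / 5040 := by
    simp [hf, Finset.sum_range_succ, Nat.factorial]
    norm_num
    ring
  have htail : Real.sin x - (x - x ^ 3 / 6 + x ^ 5 / 120 - x ^ 7 / 5040) = ∑' n, f (n + 4) := by
    rw [← hhead, ← hs.tsum_eq, ← hsplit]; ring
  have h := abs_tsum_tail_le x 1 4 (fun n => (-1) ^ n) (fun n => by simp)
  rw [htail]
  calc |∑' n, f (n + 4)|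
      = |∑' n : ℕ, (-1) ^ (n + 4) * x ^ (2 * (n + 4) + 1) / ((2 * (n + 4) + 1).factorial : ℝ)| := by rfl
    _ ≤ |x| ^ (2 * 4 + 1) * Real.cosh x / ((2 * 4 + 1).factorial : ℝ) := h
    _ = |x| ^ 9 * Real.cosh x / 362880 := by norm_num [Nat.factorial]

/-- `cosh x ≤ e^{|x|}`. [folklore] -/
private theorem cosh_le_exp_abs (x : ℝ) : Real.cosh x ≤ Real.exp |x| := by
  rw [Real.cosh_eq]
  have h1 : Real.exp x ≤ Real.exp |x| := Real.exp_le_exp.mpr (le_abs_self x)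
  have h2 : Real.exp (-x) ≤ Real.exp |x| := Real.exp_le_exp.mpr (neg_le_abs x)
  linarith

/-- `|sinh x| ≤ cosh x`. [folklore] -/
private theorem abs_sinh_le_cosh (x : ℝ) : |Real.sinh x| ≤ Real.cosh x := by
  rw [Real.sinh_eq, Real.cosh_eq, abs_le]
  constructor <;> nlinarith [Real.exp_pos x, Real.exp_pos (-x)]

end Tails


/-! ## §15 (v1.4) The brace of (A.7) to order `θ⁶`: `θ + 2T(θ) = θ(B₀ + b₁θ² + b₂θ⁴ + b₃θ⁶) + O(θ⁹)` -/

section Brace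

variable {γ : ℝ}

/-- `a_n = 4πγ(n+1)` — the frequencies `4πγn` of (A.7) (index shifted to start at `0`).
[cite: MullerSchiemann1987, Appendix (A.7) p.285] -/
noncomputable def aSeq (γ : ℝ) (n : ℕ) : ℝ := 4 * π * γ * (n + 1)

/-- `s_n = 8π²γ(n+1)² = 2π(n+1) · a_n` — the limits `2πnθ⁻¹ sinh 4πnγθ → 8π²γn²` of (A.7) at `θ → 0`.
[cite: MullerSchiemann1987, Appendix (A.7), (A.9) p.285] -/
noncomputable def sSeq (γ : ℝ) (n : ℕ) : ℝ := 8 * π ^ 2 * γ * (n + 1) ^ 2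

/-- `w_n = exp(−4π²γ(n+1)²)` — the Gaussian weights of (A.7). [cite: MullerSchiemann1987, Appendix (A.7) p.285] -/
noncomputable def wSeq (γ : ℝ) (n : ℕ) : ℝ := Real.exp (-(4 * π ^ 2 * γ * (n + 1) ^ 2))

/-- The series of (A.7) multiplied by `θ`: `T(θ) = Σ_{n≥0} (θ cosh(a_n θ) − 2π(n+1) sinh(a_n θ)) w_n`, so that
`h(θ) sin θ = 𝒩′ e^{−γθ²} (θ + 2T(θ))` (`h_mul_sin_eq_A7`). [cite: MullerSchiemann1987, Appendix (A.7) p.285] -/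
noncomputable def braceT (γ θ : ℝ) : ℝ :=
  ∑' n : ℕ, (θ * Real.cosh (aSeq γ n * θ) - 2 * π * (n + 1) * Real.sinh (aSeq γ n * θ)) * wSeq γ n

/-- The Taylor coefficients of the brace: `b_j = 2 Σ_{n≥0} a_n^{2j}/(2j)! · (1 − s_n/(2j+1)) · w_n`, `j = 0, 1, 2, 3, …`
(`1 + b₀ = 𝒩′⁻¹`, `normN'_mul_one_add_bcoef_zero`). [cite: MullerSchiemann1987, Appendix Lemma (iii) p.284, (A.7) p.285] -/
noncomputable def bcoef (γ : ℝ) (j : ℕ) : ℝ :=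
  2 * ∑' n : ℕ, aSeq γ n ^ (2 * j) / ((2 * j).factorial : ℝ) * (1 - sSeq γ n / (2 * j + 1)) * wSeq γ n

/-- An admissible constant for the `O(θ⁹)` remainder of the brace on `|θ| ≤ 1`:
`K = 2 Σ_n a_n⁸ e^{a_n} (1/8! + s_n/9!) w_n`. [folklore] -/
noncomputable def remK (γ : ℝ) : ℝ :=
  2 * ∑' n : ℕ, aSeq γ n ^ 8 * Real.exp (aSeq γ n) * (1 / 40320 + sSeq γ n / 362880) * wSeq γ n

/-- `a_n > 0` (`γ > 0`). [cite: MullerSchiemann1987, Appendix (A.7) p.285] -/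
theorem aSeq_pos (hγ : 0 < γ) (n : ℕ) : 0 < aSeq γ n := by
  unfold aSeq; positivity

/-- `s_n > 0` (`γ > 0`). [cite: MullerSchiemann1987, Appendix (A.7) p.285] -/
theorem sSeq_pos (hγ : 0 < γ) (n : ℕ) : 0 < sSeq γ n := by
  unfold sSeq; positivity

/-- `w_n > 0`. [cite: MullerSchiemann1987, Appendix (A.7) p.285] -/
theorem wSeq_pos (γ : ℝ) (n : ℕ) : 0 < wSeq γ n := Real.exp_pos _

/-- `2π(n+1) · a_n = s_n`. [cite: MullerSchiemann1987, Appendix (A.7) p.285] -/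
theorem two_pi_mul_aSeq (γ : ℝ) (n : ℕ) : 2 * π * (n + 1) * aSeq γ n = sSeq γ n := by
  unfold aSeq sSeq; ring

/-- **Summability engine**: `(n+1)^k e^{c(n+1)} e^{−4π²γ(n+1)²}` is summable for every `k ∈ ℕ`, `c ∈ ℝ`, `γ > 0`
(Gaussian decay beats any exponential: the terms are `≤ k!·e^{(c+2)²/(16π²γ)}·e^{−(n+1)}`) — the convergence
behind every series of (A.7) and of this section. [cite: MullerSchiemann1987, Appendix (A.7) p.285] -/
theorem summable_pow_mul_exp_mul_wSeq (hγ : 0 < γ) (k : ℕ) (c : ℝ) :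
    Summable fun n : ℕ => ((n : ℝ) + 1) ^ k * Real.exp (c * ((n : ℝ) + 1)) * wSeq γ n := by
  set d : ℝ := 4 * π ^ 2 * γ with hd
  have hd0 : 0 < d := by positivity
  set M : ℝ := (c + 2) ^ 2 / (4 * d) with hM
  set A : ℝ := (k.factorial : ℝ) * Real.exp M with hA
  have hr0 : 0 ≤ Real.exp (-1) := (Real.exp_pos _).le
  have hr1 : Real.exp (-1) < 1 := Real.exp_lt_one_iff.mpr (by norm_num)
  have hgeo : Summable fun n : ℕ => A * Real.exp (-1) * Real.exp (-1) ^ n :=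
    (summable_geometric_of_lt_one hr0 hr1).mul_left _
  refine Summable.of_nonneg_of_le (fun n => ?_) (fun n => ?_) hgeo
  · exact mul_nonneg (mul_nonneg (by positivity) (Real.exp_pos _).le) (wSeq_pos γ n).le
  · have hy : (0 : ℝ) ≤ (n : ℝ) + 1 := by positivity
    set y : ℝ := (n : ℝ) + 1 with hy'
    -- (n+1)^k ≤ k! e^{n+1}
    have h1 : y ^ k ≤ (k.factorial : ℝ) * Real.exp y := by
      have := Real.pow_div_factorial_le_exp y hy k
      have hk : (0 : ℝ) < k.factorial := by exact_mod_cast Nat.factorial_pos k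
      rwa [div_le_iff₀ hk, mul_comm] at this
    -- the exponent bound: y + c y − d y² ≤ M − y
    have h2 : y + c * y + -(d * y ^ 2) ≤ M + -1 + -1 * n := by
      have hsq : 0 ≤ d * (y - (c + 2) / (2 * d)) ^ 2 := by positivity
      have hexp : d * (y - (c + 2) / (2 * d)) ^ 2 = d * y ^ 2 - (c + 2) * y + M := by
        rw [hM]; field_simp; ring
      have hy1 : y = n + 1 := hy'
      nlinarith [hsq, hexp]
    have h3 : Real.exp y * Real.exp (c * y) * wSeq γ n ≤ Real.exp M * Real.exp (-1) * Real.exp (-1) ^ n := by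
      rw [wSeq, ← Real.exp_nat_mul, ← Real.exp_add, ← Real.exp_add, ← Real.exp_add, ← Real.exp_add]
      apply Real.exp_le_exp.mpr
      have : -(4 * π ^ 2 * γ * ((n : ℝ) + 1) ^ 2) = -(d * y ^ 2) := by rw [hd, hy']
      rw [this]
      linarith [h2]
    calc y ^ k * Real.exp (c * y) * wSeq γ n
        ≤ ((k.factorial : ℝ) * Real.exp y) * Real.exp (c * y) * wSeq γ n := by
          gcongr
          · exact (wSeq_pos γ n).le
      _ = (k.factorial : ℝ) * (Real.exp y * Real.exp (c * y) * wSeq γ n) := by ring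
      _ ≤ (k.factorial : ℝ) * (Real.exp M * Real.exp (-1) * Real.exp (-1) ^ n) :=
          mul_le_mul_of_nonneg_left h3 (by positivity)
      _ = A * Real.exp (-1) * Real.exp (-1) ^ n := by rw [hA]; ring

/-- `(n+1)^k w_n` is summable. [cite: MullerSchiemann1987, Appendix (A.7) p.285] -/
theorem summable_pow_mul_wSeq (hγ : 0 < γ) (k : ℕ) :
    Summable fun n : ℕ => ((n : ℝ) + 1) ^ k * wSeq γ n := by
  refine (summable_pow_mul_exp_mul_wSeq hγ k 0).congr fun n => ?_
  simp

/-- The coefficient series of `b_j` is summable. [cite: MullerSchiemann1987, Appendix Lemma (iii) p.284, (A.7) p.285] -/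
theorem summable_bcoef_term (hγ : 0 < γ) (j : ℕ) :
    Summable fun n : ℕ => aSeq γ n ^ (2 * j) / ((2 * j).factorial : ℝ) * (1 - sSeq γ n / (2 * j + 1)) * wSeq γ n := by
  have h1 := (summable_pow_mul_wSeq hγ (2 * j)).mul_left ((4 * π * γ) ^ (2 * j) / ((2 * j).factorial : ℝ))
  have h2 := (summable_pow_mul_wSeq hγ (2 * j + 2)).mul_left
    ((4 * π * γ) ^ (2 * j) / ((2 * j).factorial : ℝ) * (8 * π ^ 2 * γ / (2 * j + 1)))
  refine (h1.sub h2).congr fun n => ?_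
  simp only [aSeq, sSeq, mul_pow, pow_add]
  ring

/-- The remainder-constant series `K(γ)` is summable. [cite: MullerSchiemann1987, Appendix Lemma (iii) p.284, (A.7) p.285] -/
theorem summable_remK_term (hγ : 0 < γ) :
    Summable fun n : ℕ => aSeq γ n ^ 8 * Real.exp (aSeq γ n) * (1 / 40320 + sSeq γ n / 362880) * wSeq γ n := by
  have h1 := (summable_pow_mul_exp_mul_wSeq hγ 8 (4 * π * γ)).mul_left ((4 * π * γ) ^ 8 / 40320)
  have h2 := (summable_pow_mul_exp_mul_wSeq hγ 10 (4 * π * γ)).mul_left ((4 * π * γ) ^ 8 * (8 * π ^ 2 * γ) / 362880)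
  refine (h1.add h2).congr fun n => ?_
  simp only [aSeq, sSeq, mul_pow]
  ring

/-- `K(γ) ≥ 0`. [folklore] -/
private theorem remK_nonneg (hγ : 0 < γ) : 0 ≤ remK γ := by
  unfold remK
  refine mul_nonneg (by norm_num) (tsum_nonneg fun n => ?_)
  have := aSeq_pos hγ n; have := sSeq_pos hγ n; have := wSeq_pos γ n
  positivity

/-- The series `T(θ)` of (A.7) converges (absolutely) for every real `θ`. [cite: MullerSchiemann1987, Appendix (A.7) p.285] -/
theorem summable_braceT_term (hγ : 0 < γ) (θ : ℝ) :
    Summable fun n : ℕ => (θ * Real.cosh (aSeq γ n * θ) - 2 * π * (n + 1) * Real.sinh (aSeq γ n * θ)) * wSeq γ n := by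
  have hc := (summable_pow_mul_exp_mul_wSeq hγ 0 (4 * π * γ * |θ|)).mul_left |θ|
  have hs := (summable_pow_mul_exp_mul_wSeq hγ 1 (4 * π * γ * |θ|)).mul_left (2 * π)
  refine Summable.of_norm_bounded (hc.add hs) fun n => ?_
  have hw := (wSeq_pos γ n).le
  have hexp : Real.cosh (aSeq γ n * θ) ≤ Real.exp (4 * π * γ * |θ| * ((n : ℝ) + 1)) := by
    have := cosh_le_exp_abs (aSeq γ n * θ)
    have habs : |aSeq γ n * θ| = 4 * π * γ * |θ| * ((n : ℝ) + 1) := by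
      rw [abs_mul, abs_of_pos (aSeq_pos hγ n), aSeq]; ring
    rwa [habs] at this
  have hsinh : |Real.sinh (aSeq γ n * θ)| ≤ Real.exp (4 * π * γ * |θ| * ((n : ℝ) + 1)) :=
    (abs_sinh_le_cosh _).trans hexp
  rw [Real.norm_eq_abs, abs_mul, abs_of_pos (wSeq_pos γ n)]
  have hn : (0 : ℝ) ≤ 2 * π * ((n : ℝ) + 1) := by positivity
  calc |θ * Real.cosh (aSeq γ n * θ) - 2 * π * (n + 1) * Real.sinh (aSeq γ n * θ)| * wSeq γ n
      ≤ (|θ| * Real.cosh (aSeq γ n * θ) + 2 * π * (n + 1) * |Real.sinh (aSeq γ n * θ)|) * wSeq γ n := by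
        refine mul_le_mul_of_nonneg_right ?_ hw
        calc |θ * Real.cosh (aSeq γ n * θ) - 2 * π * (n + 1) * Real.sinh (aSeq γ n * θ)|
            ≤ |θ * Real.cosh (aSeq γ n * θ)| + |2 * π * (n + 1) * Real.sinh (aSeq γ n * θ)| := abs_sub _ _
          _ = |θ| * Real.cosh (aSeq γ n * θ) + 2 * π * (n + 1) * |Real.sinh (aSeq γ n * θ)| := by
              rw [abs_mul, abs_mul, abs_of_pos (Real.cosh_pos _), abs_of_nonneg hn]
    _ ≤ (|θ| * Real.exp (4 * π * γ * |θ| * ((n : ℝ) + 1))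
          + 2 * π * (n + 1) * Real.exp (4 * π * γ * |θ| * ((n : ℝ) + 1))) * wSeq γ n := by
        gcongr
    _ = |θ| * (((n : ℝ) + 1) ^ 0 * Real.exp (4 * π * γ * |θ| * ((n : ℝ) + 1)) * wSeq γ n)
          + 2 * π * (((n : ℝ) + 1) ^ 1 * Real.exp (4 * π * γ * |θ| * ((n : ℝ) + 1)) * wSeq γ n) := by ring

/-- `h(θ) sin θ = 𝒩′ e^{−γθ²} (θ + 2T(θ))` — `h_mul_sin_eq_A7` in the notation of this section.
[cite: MullerSchiemann1987, Appendix (A.7) p.285] -/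
theorem h_mul_sin_eq_braceT (hγ : 0 < γ) (θ : ℝ) :
    h γ θ * Real.sin θ = normN' γ * Real.exp (-(γ * θ ^ 2)) * (θ + 2 * braceT γ θ) := by
  rw [h_mul_sin_eq_A7 hγ θ, braceT]
  simp only [aSeq, wSeq]

/-- The termwise Taylor remainder of the brace: for `|θ| ≤ 1`,
`|θ cosh(aθ) − 2π(n+1) sinh(aθ) − Σ_{j<4} θ^{2j+1} a^{2j}/(2j)! (1 − s/(2j+1))| ≤ |θ|⁹ a⁸ e^{a} (1/8! + s/9!)`. [folklore] -/
private theorem abs_brace_term_sub_poly_le (hγ : 0 < γ) (n : ℕ) {θ : ℝ} (hθ : |θ| ≤ 1) :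
    |(θ * Real.cosh (aSeq γ n * θ) - 2 * π * (n + 1) * Real.sinh (aSeq γ n * θ))
      - (θ * (1 - sSeq γ n) + θ ^ 3 * (aSeq γ n ^ 2 / 2 * (1 - sSeq γ n / 3))
        + θ ^ 5 * (aSeq γ n ^ 4 / 24 * (1 - sSeq γ n / 5)) + θ ^ 7 * (aSeq γ n ^ 6 / 720 * (1 - sSeq γ n / 7)))|
      ≤ |θ| ^ 9 * (aSeq γ n ^ 8 * Real.exp (aSeq γ n) * (1 / 40320 + sSeq γ n / 362880)) := by
  set a := aSeq γ n with ha_def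
  set s := sSeq γ n with hs_def
  have ha : 0 < a := aSeq_pos hγ n
  have hsa : 2 * π * (n + 1) * a = s := two_pi_mul_aSeq γ n
  have hn : (0 : ℝ) ≤ 2 * π * ((n : ℝ) + 1) := by positivity
  -- rewrite the difference as θ·Rc − 2π(n+1)·Rs
  have hid : (θ * Real.cosh (a * θ) - 2 * π * (n + 1) * Real.sinh (a * θ))
      - (θ * (1 - s) + θ ^ 3 * (a ^ 2 / 2 * (1 - s / 3))
        + θ ^ 5 * (a ^ 4 / 24 * (1 - s / 5)) + θ ^ 7 * (a ^ 6 / 720 * (1 - s / 7)))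
      = θ * (Real.cosh (a * θ) - (1 + (a * θ) ^ 2 / 2 + (a * θ) ^ 4 / 24 + (a * θ) ^ 6 / 720))
        - 2 * π * (n + 1) * (Real.sinh (a * θ) - ((a * θ) + (a * θ) ^ 3 / 6 + (a * θ) ^ 5 / 120
          + (a * θ) ^ 7 / 5040)) := by
    rw [← hsa]; ring
  rw [hid]
  have hc := abs_cosh_sub_taylor_le (a * θ)
  have hs' := abs_sinh_sub_taylor_le (a * θ)
  have hcosh : Real.cosh (a * θ) ≤ Real.exp a := by
    have h1 : Real.cosh (a * θ) ≤ Real.cosh a := by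
      rw [Real.cosh_le_cosh, abs_mul, abs_of_pos ha]
      calc a * |θ| ≤ a * 1 := mul_le_mul_of_nonneg_left hθ ha.le
        _ = a := mul_one a
    exact h1.trans ((cosh_le_exp_abs a).trans_eq (by rw [abs_of_pos ha]))
  have hθ9 : 0 ≤ |θ| ^ 9 := by positivity
  have e8 : (a * θ) ^ 8 = a ^ 8 * |θ| ^ 8 := by
    rw [mul_pow, pow_abs, abs_of_nonneg (by positivity : (0 : ℝ) ≤ θ ^ 8)]
  have e9 : |a * θ| ^ 9 = a ^ 9 * |θ| ^ 9 := by rw [abs_mul, abs_of_pos ha, mul_pow]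
  calc |θ * (Real.cosh (a * θ) - (1 + (a * θ) ^ 2 / 2 + (a * θ) ^ 4 / 24 + (a * θ) ^ 6 / 720))
        - 2 * π * (n + 1) * (Real.sinh (a * θ) - ((a * θ) + (a * θ) ^ 3 / 6 + (a * θ) ^ 5 / 120
          + (a * θ) ^ 7 / 5040))|
      ≤ |θ| * ((a * θ) ^ 8 * Real.cosh (a * θ) / 40320)
        + 2 * π * (n + 1) * (|a * θ| ^ 9 * Real.cosh (a * θ) / 362880) := by
        refine (abs_sub _ _).trans ?_
        rw [abs_mul, abs_mul, abs_of_nonneg hn]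
        gcongr
    _ ≤ |θ| * ((a * θ) ^ 8 * Real.exp a / 40320)
        + 2 * π * (n + 1) * (|a * θ| ^ 9 * Real.exp a / 362880) := by
        gcongr
    _ = |θ| ^ 9 * (a ^ 8 * Real.exp a * (1 / 40320 + (2 * π * (n + 1) * a) / 362880)) := by
        rw [e8, e9]; ring
    _ = |θ| ^ 9 * (a ^ 8 * Real.exp a * (1 / 40320 + s / 362880)) := by rw [hsa]

/-- **The brace of (A.7) to order `θ⁶` with an explicit `O(θ⁹)` remainder**: for `|θ| ≤ 1`,
`|θ + 2T(θ) − θ·(1 + b₀ + b₁θ² + b₂θ⁴ + b₃θ⁶)| ≤ K |θ|⁹` (termwise Taylor expansion of `cosh 4πγnθ` and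
`θ⁻¹ sinh 4πγnθ`, summed against the Gaussian weights). [cite: MullerSchiemann1987, Appendix Lemma (iii) p.284, (A.7) p.285] -/
theorem abs_brace_sub_poly_le (hγ : 0 < γ) {θ : ℝ} (hθ : |θ| ≤ 1) :
    |θ + 2 * braceT γ θ
        - θ * (1 + bcoef γ 0 + bcoef γ 1 * θ ^ 2 + bcoef γ 2 * θ ^ 4 + bcoef γ 3 * θ ^ 6)|
      ≤ remK γ * |θ| ^ 9 := by
  -- the four coefficient series
  set P : ℕ → ℕ → ℝ := fun j n =>
    aSeq γ n ^ (2 * j) / ((2 * j).factorial : ℝ) * (1 - sSeq γ n / (2 * j + 1)) * wSeq γ n with hP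
  have hPs : ∀ j, Summable (P j) := fun j => summable_bcoef_term hγ j
  have hb : ∀ j, bcoef γ j = 2 * ∑' n, P j n := fun j => rfl
  -- the term, its polynomial part and the remainder
  set t : ℕ → ℝ := fun n =>
    (θ * Real.cosh (aSeq γ n * θ) - 2 * π * (n + 1) * Real.sinh (aSeq γ n * θ)) * wSeq γ n with ht
  set poly : ℕ → ℝ := fun n => θ * P 0 n + θ ^ 3 * P 1 n + θ ^ 5 * P 2 n + θ ^ 7 * P 3 n with hpoly
  set M : ℕ → ℝ := fun n =>
    aSeq γ n ^ 8 * Real.exp (aSeq γ n) * (1 / 40320 + sSeq γ n / 362880) * wSeq γ n with hM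
  have hts : Summable t := summable_braceT_term hγ θ
  have hpolys : Summable poly :=
    ((((hPs 0).mul_left θ).add ((hPs 1).mul_left (θ ^ 3))).add ((hPs 2).mul_left (θ ^ 5))).add
      ((hPs 3).mul_left (θ ^ 7))
  have hMs : Summable M := summable_remK_term hγ
  have hT : braceT γ θ = ∑' n, t n := rfl
  have hK : remK γ = 2 * ∑' n, M n := rfl
  -- Σ poly = θ ΣP0 + θ³ ΣP1 + θ⁵ ΣP2 + θ⁷ ΣP3
  have hpoly_sum : ∑' n, poly n
      = θ * ∑' n, P 0 n + θ ^ 3 * ∑' n, P 1 n + θ ^ 5 * ∑' n, P 2 n + θ ^ 7 * ∑' n, P 3 n := by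
    rw [hpoly]
    rw [Summable.tsum_add ((((hPs 0).mul_left θ).add ((hPs 1).mul_left (θ ^ 3))).add ((hPs 2).mul_left (θ ^ 5)))
      ((hPs 3).mul_left (θ ^ 7)),
      Summable.tsum_add (((hPs 0).mul_left θ).add ((hPs 1).mul_left (θ ^ 3))) ((hPs 2).mul_left (θ ^ 5)),
      Summable.tsum_add ((hPs 0).mul_left θ) ((hPs 1).mul_left (θ ^ 3))]
    simp only [tsum_mul_left]
  -- termwise remainder bound
  have hrem : ∀ n, |t n - poly n| ≤ |θ| ^ 9 * M n := by
    intro n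
    have h1 := abs_brace_term_sub_poly_le hγ n hθ
    have hw := wSeq_pos γ n
    have hid : t n - poly n = ((θ * Real.cosh (aSeq γ n * θ) - 2 * π * (n + 1) * Real.sinh (aSeq γ n * θ))
      - (θ * (1 - sSeq γ n) + θ ^ 3 * (aSeq γ n ^ 2 / 2 * (1 - sSeq γ n / 3))
        + θ ^ 5 * (aSeq γ n ^ 4 / 24 * (1 - sSeq γ n / 5))
        + θ ^ 7 * (aSeq γ n ^ 6 / 720 * (1 - sSeq γ n / 7)))) * wSeq γ n := by
      simp only [ht, hpoly, hP, Nat.factorial]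
      push_cast
      ring
    rw [hid, abs_mul, abs_of_pos hw, hM]
    calc _ ≤ |θ| ^ 9 * (aSeq γ n ^ 8 * Real.exp (aSeq γ n) * (1 / 40320 + sSeq γ n / 362880)) * wSeq γ n :=
          mul_le_mul_of_nonneg_right h1 hw.le
      _ = _ := by ring
  -- sum up
  have hdiff : θ + 2 * braceT γ θ
      - θ * (1 + bcoef γ 0 + bcoef γ 1 * θ ^ 2 + bcoef γ 2 * θ ^ 4 + bcoef γ 3 * θ ^ 6)
      = 2 * ∑' n, (t n - poly n) := by
    rw [Summable.tsum_sub hts hpolys, hT, hpoly_sum, hb 0, hb 1, hb 2, hb 3]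
    ring
  rw [hdiff, abs_mul, abs_two, hK]
  have hb2 : |∑' n, (t n - poly n)| ≤ ∑' n, |θ| ^ 9 * M n := by
    have h := tsum_of_norm_bounded ((hMs.mul_left (|θ| ^ 9)).hasSum) (fun n => (Real.norm_eq_abs _).le.trans (hrem n))
    rwa [Real.norm_eq_abs] at h
  rw [tsum_mul_left] at hb2
  calc 2 * |∑' n, (t n - poly n)| ≤ 2 * (|θ| ^ 9 * ∑' n, M n) := by linarith
    _ = (2 * ∑' n, M n) * |θ| ^ 9 := by ring

end Brace


/-! ## §16 (v1.4) APPENDIX LEMMA (iii): `−ln h(θ) = (γ − ⅙ + ρ₁)θ² + ½(−1/90 + ρ₂)θ⁴ + ⅓(−1/945 + ρ₃)θ⁶ + O(θ⁸)` -/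

section LemmaIII

variable {γ : ℝ}

/-! ### §16.1 Elementary inequalities -/

/-- For `0 ≤ t ≤ 1`: `|e₀ + e₁t + ⋯ + e₅t⁵| ≤ |e₀| + ⋯ + |e₅|`. [folklore] -/
private theorem abs_poly5_le (e₀ e₁ e₂ e₃ e₄ e₅ : ℝ) {t : ℝ} (ht0 : 0 ≤ t) (ht1 : t ≤ 1) :
    |e₀ + e₁ * t + e₂ * t ^ 2 + e₃ * t ^ 3 + e₄ * t ^ 4 + e₅ * t ^ 5|
      ≤ |e₀| + |e₁| + |e₂| + |e₃| + |e₄| + |e₅| := by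
  have hp : ∀ i : ℕ, t ^ i ≤ 1 := fun i => pow_le_one₀ ht0 ht1
  have hk : ∀ (e : ℝ) (i : ℕ), |e * t ^ i| ≤ |e| := fun e i => by
    rw [abs_mul, abs_of_nonneg (pow_nonneg ht0 i)]
    exact mul_le_of_le_one_right (abs_nonneg e) (hp i)
  have h1 : |e₁ * t| ≤ |e₁| := by simpa using hk e₁ 1
  calc |e₀ + e₁ * t + e₂ * t ^ 2 + e₃ * t ^ 3 + e₄ * t ^ 4 + e₅ * t ^ 5|
      ≤ |e₀ + e₁ * t + e₂ * t ^ 2 + e₃ * t ^ 3 + e₄ * t ^ 4| + |e₅ * t ^ 5| := abs_add_le _ _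
    _ ≤ |e₀ + e₁ * t + e₂ * t ^ 2 + e₃ * t ^ 3| + |e₄ * t ^ 4| + |e₅ * t ^ 5| := by
        gcongr; exact abs_add_le _ _
    _ ≤ |e₀ + e₁ * t + e₂ * t ^ 2| + |e₃ * t ^ 3| + |e₄ * t ^ 4| + |e₅ * t ^ 5| := by
        gcongr; exact abs_add_le _ _
    _ ≤ |e₀ + e₁ * t| + |e₂ * t ^ 2| + |e₃ * t ^ 3| + |e₄ * t ^ 4| + |e₅ * t ^ 5| := by
        gcongr; exact abs_add_le _ _
    _ ≤ |e₀| + |e₁ * t| + |e₂ * t ^ 2| + |e₃ * t ^ 3| + |e₄ * t ^ 4| + |e₅ * t ^ 5| := by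
        gcongr; exact abs_add_le _ _
    _ ≤ |e₀| + |e₁| + |e₂| + |e₃| + |e₄| + |e₅| := by
        linarith [h1, hk e₂ 2, hk e₃ 3, hk e₄ 4, hk e₅ 5]

/-- The cofactor bound: `|p| ≤ P`, `|r| ≤ R` ⇒ `|1 − p − r/2 + p² + pr + r²/3| ≤ 1 + P + R/2 + P² + PR + R²/3`. [folklore] -/
private theorem abs_cofactor_le {p r P R : ℝ} (hp : |p| ≤ P) (hr : |r| ≤ R) :
    |1 - p - r / 2 + p ^ 2 + p * r + r ^ 2 / 3| ≤ 1 + P + R / 2 + P ^ 2 + P * R + R ^ 2 / 3 := by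
  have hP : 0 ≤ P := (abs_nonneg p).trans hp
  have hR : 0 ≤ R := (abs_nonneg r).trans hr
  have h2 : |p ^ 2| ≤ P ^ 2 := by rw [abs_pow]; exact pow_le_pow_left₀ (abs_nonneg p) hp 2
  have h3 : |p * r| ≤ P * R := by rw [abs_mul]; exact mul_le_mul hp hr (abs_nonneg r) hP
  have h4 : |r ^ 2 / 3| ≤ R ^ 2 / 3 := by
    rw [abs_div, abs_pow, abs_of_pos (by norm_num : (0:ℝ) < 3)]
    exact div_le_div_of_nonneg_right (pow_le_pow_left₀ (abs_nonneg r) hr 2) (by norm_num)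
  have h5 : |r / 2| ≤ R / 2 := by
    rw [abs_div, abs_of_pos (by norm_num : (0:ℝ) < 2)]; linarith
  calc |1 - p - r / 2 + p ^ 2 + p * r + r ^ 2 / 3|
      ≤ |1 - p - r / 2 + p ^ 2 + p * r| + |r ^ 2 / 3| := abs_add_le _ _
    _ ≤ |1 - p - r / 2 + p ^ 2| + |p * r| + |r ^ 2 / 3| := by gcongr; exact abs_add_le _ _
    _ ≤ |1 - p - r / 2| + |p ^ 2| + |p * r| + |r ^ 2 / 3| := by gcongr; exact abs_add_le _ _
    _ ≤ |1 - p| + |r / 2| + |p ^ 2| + |p * r| + |r ^ 2 / 3| := by gcongr; exact abs_sub _ _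
    _ ≤ |(1 : ℝ)| + |p| + |r / 2| + |p ^ 2| + |p * r| + |r ^ 2 / 3| := by gcongr; exact abs_sub _ _
    _ ≤ 1 + P + R / 2 + P ^ 2 + P * R + R ^ 2 / 3 := by rw [abs_one]; gcongr

/-- `|x + x²/2 + x³/3 + log(1 − x)| ≤ |x|⁴/(1 − |x|)` for `|x| < 1` (Mathlib's `Real.abs_log_sub_add_sum_range_le`
at `n = 3`). [folklore] -/
private theorem abs_log_one_sub_add_cubic_le {x : ℝ} (hx : |x| < 1) :
    |x + x ^ 2 / 2 + x ^ 3 / 3 + Real.log (1 - x)| ≤ |x| ^ 4 / (1 - |x|) := by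
  have h := Real.abs_log_sub_add_sum_range_le hx 3
  have hs : ∑ i ∈ Finset.range 3, x ^ (i + 1) / (i + 1) = x + x ^ 2 / 2 + x ^ 3 / 3 := by
    simp [Finset.sum_range_succ]
    norm_num
  rw [hs] at h
  exact h

/-- `|log(1 + u) − (u − u²/2 + u³/3)| ≤ |u|⁴/(1 − |u|)` for `|u| < 1`. [folklore] -/
private theorem abs_log_one_add_sub_cubic_le {u : ℝ} (hu : |u| < 1) :
    |Real.log (1 + u) - (u - u ^ 2 / 2 + u ^ 3 / 3)| ≤ |u| ^ 4 / (1 - |u|) := by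
  have h := abs_log_one_sub_add_cubic_le (x := -u) (by rwa [abs_neg])
  rw [abs_neg] at h
  calc |Real.log (1 + u) - (u - u ^ 2 / 2 + u ^ 3 / 3)|
      = |(-u) + (-u) ^ 2 / 2 + (-u) ^ 3 / 3 + Real.log (1 - -u)| := by
        rw [sub_neg_eq_add]; congr 1; ring
    _ ≤ |u| ^ 4 / (1 - |u|) := h

/-! ### §16.2 `ln(sin θ/θ) = −θ²/6 − θ⁴/180 − θ⁶/2835 + O(θ⁸)` -/

/-- `cosh 1 ≤ 2`. [folklore] -/
private theorem cosh_one_le_two : Real.cosh 1 ≤ 2 := by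
  rw [Real.cosh_eq]
  have h1 : Real.exp 1 < 2.7182818286 := Real.exp_one_lt_d9
  have h2 : Real.exp (-1) ≤ 1 := by
    rw [Real.exp_neg]; exact inv_le_one_of_one_le₀ (by linarith [Real.add_one_le_exp (1:ℝ)])
  linarith

set_option maxHeartbeats 400000 in -- one long explicit-constant estimate (2× the default budget)
/-- **`ln(sin θ/θ)` to order `θ⁶` with an explicit remainder**: for `0 < |θ| ≤ 1`,
`|ln(sin θ/θ) + θ²/6 + θ⁴/180 + θ⁶/2835| ≤ θ⁸/400` — the source of the printed constants `−⅙`, `½·(−1/90) = −1/180`,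
`⅓·(−1/945) = −1/2835` in Lemma (iii) (the `sin θ` denominator of (A.1)/(A.7)).
[cite: MullerSchiemann1987, Appendix Lemma (iii) p.284] -/
theorem abs_log_sin_div_add_le {θ : ℝ} (hθ0 : θ ≠ 0) (hθ : |θ| ≤ 1) :
    |Real.log (Real.sin θ / θ) + θ ^ 2 / 6 + θ ^ 4 / 180 + θ ^ 6 / 2835| ≤ θ ^ 8 / 400 := by
  set t : ℝ := θ ^ 2 with ht
  have ht0 : 0 ≤ t := by positivity
  have ht1 : t ≤ 1 := by
    have : θ ^ 2 ≤ 1 := by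
      have h := pow_le_one₀ (abs_nonneg θ) hθ (n := 2)
      rwa [pow_abs, abs_of_nonneg (by positivity : (0:ℝ) ≤ θ ^ 2)] at h
    simpa [ht] using this
  have hθabs : 0 < |θ| := abs_pos.mpr hθ0
  -- the `sin` remainder
  obtain ⟨e₁, he₁⟩ : ∃ e₁ : ℝ, Real.sin θ - (θ - θ ^ 3 / 6 + θ ^ 5 / 120 - θ ^ 7 / 5040) = e₁ := ⟨_, rfl⟩
  have he₁b : |e₁| ≤ |θ| ^ 9 / 181440 := by
    have h1 : |e₁| ≤ |θ| ^ 9 * Real.cosh θ / 362880 := by rw [← he₁]; exact abs_sin_sub_taylor_le θ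
    have hcosh : Real.cosh θ ≤ 2 := by
      have : Real.cosh θ ≤ Real.cosh 1 := by rw [Real.cosh_le_cosh, abs_one]; exact hθ
      exact this.trans cosh_one_le_two
    calc |e₁| ≤ |θ| ^ 9 * Real.cosh θ / 362880 := h1
      _ ≤ |θ| ^ 9 * 2 / 362880 := by gcongr
      _ = |θ| ^ 9 / 181440 := by ring
  -- v, v₀, e
  set v₀ : ℝ := t / 6 - t ^ 2 / 120 + t ^ 3 / 5040 with hv₀
  obtain ⟨e, he⟩ : ∃ e : ℝ, -(e₁ / θ) = e := ⟨_, rfl⟩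
  obtain ⟨v, hv⟩ : ∃ v : ℝ, v₀ + e = v := ⟨_, rfl⟩
  have hsin : Real.sin θ / θ = 1 - v := by
    rw [← hv, ← he, ← he₁, hv₀, ht]
    field_simp
    ring
  have heb : |e| ≤ t ^ 4 / 181440 := by
    rw [← he, abs_neg, abs_div]
    rw [div_le_iff₀ hθabs]
    have : t ^ 4 = |θ| ^ 8 := by
      rw [ht, show (θ ^ 2) ^ 4 = θ ^ 8 by ring, pow_abs, abs_of_nonneg (by positivity : (0:ℝ) ≤ θ ^ 8)]
    rw [this]
    calc |e₁| ≤ |θ| ^ 9 / 181440 := he₁b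
      _ = |θ| ^ 8 / 181440 * |θ| := by ring
  have hv₀b : |v₀| ≤ t * (1 / 6 + 1 / 120 + 1 / 5040) := by
    rw [hv₀]
    have e1 : t / 6 - t ^ 2 / 120 + t ^ 3 / 5040 = t * (1 / 6 + (-(1 / 120)) * t + (1 / 5040) * t ^ 2) := by ring
    rw [e1, abs_mul, abs_of_nonneg ht0]
    refine mul_le_mul_of_nonneg_left ?_ ht0
    calc |1 / 6 + (-(1 / 120)) * t + (1 / 5040) * t ^ 2|
        ≤ |1 / 6 + (-(1 / 120)) * t| + |(1 / 5040) * t ^ 2| := abs_add_le _ _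
      _ ≤ |(1:ℝ) / 6| + |(-(1 / 120)) * t| + |(1 / 5040) * t ^ 2| := by gcongr; exact abs_add_le _ _
      _ ≤ 1 / 6 + 1 / 120 + 1 / 5040 := by
          have h1 : |(-(1 / 120 : ℝ)) * t| ≤ 1 / 120 := by
            rw [abs_mul, abs_neg, abs_of_nonneg ht0, abs_of_pos (by norm_num : (0:ℝ) < 1 / 120)]
            nlinarith
          have h2 : |(1 / 5040 : ℝ) * t ^ 2| ≤ 1 / 5040 := by
            rw [abs_mul, abs_of_pos (by norm_num : (0:ℝ) < 1 / 5040), abs_of_nonneg (by positivity)]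
            nlinarith
          rw [abs_of_pos (by norm_num : (0:ℝ) < 1 / 6)]
          linarith
  have hvb : |v| ≤ t / 5 := by
    have ht4 : t ^ 4 ≤ t := by
      calc t ^ 4 ≤ t ^ 1 := pow_le_pow_of_le_one ht0 ht1 (by norm_num)
        _ = t := pow_one t
    calc |v| ≤ |v₀| + |e| := by rw [← hv]; exact abs_add_le _ _
      _ ≤ t * (1 / 6 + 1 / 120 + 1 / 5040) + t ^ 4 / 181440 := add_le_add hv₀b heb
      _ ≤ t / 5 := by nlinarith
  have hv1 : |v| < 1 := by linarith
  have hv5 : |v| ≤ 1 / 5 := by linarith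
  -- the log remainder
  have hlog : |v + v ^ 2 / 2 + v ^ 3 / 3 + Real.log (1 - v)| ≤ t ^ 4 / 500 := by
    have h1 := abs_log_one_sub_add_cubic_le hv1
    have hden : |v| ^ 4 / (1 - |v|) ≤ (t / 5) ^ 4 / (1 - 1 / 5) := by
      have hnum : |v| ^ 4 ≤ (t / 5) ^ 4 := pow_le_pow_left₀ (abs_nonneg v) hvb 4
      calc |v| ^ 4 / (1 - |v|) ≤ (t / 5) ^ 4 / (1 - |v|) :=
            div_le_div_of_nonneg_right hnum (by linarith)
        _ ≤ (t / 5) ^ 4 / (1 - 1 / 5) :=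
            div_le_div_of_nonneg_left (by positivity) (by norm_num) (by linarith)
    calc _ ≤ |v| ^ 4 / (1 - |v|) := h1
      _ ≤ (t / 5) ^ 4 / (1 - 1 / 5) := hden
      _ = t ^ 4 / 500 := by ring
  -- the algebra
  have hq : v₀ + v₀ ^ 2 / 2 + v₀ ^ 3 / 3 = t / 6 + t ^ 2 / 180 + t ^ 3 / 2835
      + t ^ 4 * ((-(11 / 67200)) + (1 / 64800) * t + (-(23 / 31752000)) * t ^ 2 + (31 / 1524096000) * t ^ 3
        + (-(1 / 3048192000)) * t ^ 4 + (1 / 384072192000) * t ^ 5) := by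
    rw [hv₀]; ring
  have hqb : |(-(11 / 67200) : ℝ) + (1 / 64800) * t + (-(23 / 31752000)) * t ^ 2 + (31 / 1524096000) * t ^ 3
        + (-(1 / 3048192000)) * t ^ 4 + (1 / 384072192000) * t ^ 5| ≤ 1 / 5000 := by
    refine (abs_poly5_le _ _ _ _ _ _ ht0 ht1).trans ?_
    norm_num [abs_of_pos, abs_neg]
  have hve : v + v ^ 2 / 2 + v ^ 3 / 3 = (v₀ + v₀ ^ 2 / 2 + v₀ ^ 3 / 3)
      + e * (1 - (-v₀) - (-e) / 2 + (-v₀) ^ 2 + (-v₀) * (-e) + (-e) ^ 2 / 3) := by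
    rw [← hv]; ring
  have hcof : |1 - (-v₀) - (-e) / 2 + (-v₀) ^ 2 + (-v₀) * (-e) + (-e) ^ 2 / 3|
      ≤ 1 + 1 / 5 + (1 / 5) / 2 + (1 / 5) ^ 2 + (1 / 5) * (1 / 5) + (1 / 5) ^ 2 / 3 := by
    have hv₀5 : |(-v₀)| ≤ 1 / 5 := by
      rw [abs_neg]; calc |v₀| ≤ t * (1 / 6 + 1 / 120 + 1 / 5040) := hv₀b
        _ ≤ 1 / 5 := by nlinarith
    have he5 : |(-e)| ≤ 1 / 5 := by
      rw [abs_neg]; calc |e| ≤ t ^ 4 / 181440 := heb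
        _ ≤ 1 / 5 := by
            have : t ^ 4 ≤ 1 := pow_le_one₀ ht0 ht1
            linarith
    exact abs_cofactor_le hv₀5 he5
  -- assemble
  have hmain : Real.log (Real.sin θ / θ) + θ ^ 2 / 6 + θ ^ 4 / 180 + θ ^ 6 / 2835
      = (v + v ^ 2 / 2 + v ^ 3 / 3 + Real.log (1 - v))
        - t ^ 4 * ((-(11 / 67200)) + (1 / 64800) * t + (-(23 / 31752000)) * t ^ 2 + (31 / 1524096000) * t ^ 3
          + (-(1 / 3048192000)) * t ^ 4 + (1 / 384072192000) * t ^ 5)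
        - e * (1 - (-v₀) - (-e) / 2 + (-v₀) ^ 2 + (-v₀) * (-e) + (-e) ^ 2 / 3) := by
    rw [hsin, hve, hq, ht]; ring
  rw [hmain]
  have ht8 : θ ^ 8 = t ^ 4 := by rw [ht]; ring
  rw [ht8]
  have hA := hlog
  have hB : |t ^ 4 * ((-(11 / 67200)) + (1 / 64800) * t + (-(23 / 31752000)) * t ^ 2 + (31 / 1524096000) * t ^ 3
          + (-(1 / 3048192000)) * t ^ 4 + (1 / 384072192000) * t ^ 5)| ≤ t ^ 4 * (1 / 5000) := by
    rw [abs_mul, abs_of_nonneg (by positivity : (0:ℝ) ≤ t ^ 4)]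
    exact mul_le_mul_of_nonneg_left hqb (by positivity)
  have hC : |e * (1 - (-v₀) - (-e) / 2 + (-v₀) ^ 2 + (-v₀) * (-e) + (-e) ^ 2 / 3)| ≤ t ^ 4 / 181440 * 2 := by
    rw [abs_mul]
    refine mul_le_mul heb (hcof.trans (by norm_num)) (abs_nonneg _) (by positivity)
  calc _ ≤ |v + v ^ 2 / 2 + v ^ 3 / 3 + Real.log (1 - v)
          - t ^ 4 * ((-(11 / 67200)) + (1 / 64800) * t + (-(23 / 31752000)) * t ^ 2 + (31 / 1524096000) * t ^ 3
            + (-(1 / 3048192000)) * t ^ 4 + (1 / 384072192000) * t ^ 5)|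
        + |e * (1 - (-v₀) - (-e) / 2 + (-v₀) ^ 2 + (-v₀) * (-e) + (-e) ^ 2 / 3)| := abs_sub _ _
    _ ≤ |v + v ^ 2 / 2 + v ^ 3 / 3 + Real.log (1 - v)|
        + |t ^ 4 * ((-(11 / 67200)) + (1 / 64800) * t + (-(23 / 31752000)) * t ^ 2 + (31 / 1524096000) * t ^ 3
            + (-(1 / 3048192000)) * t ^ 4 + (1 / 384072192000) * t ^ 5)|
        + |e * (1 - (-v₀) - (-e) / 2 + (-v₀) ^ 2 + (-v₀) * (-e) + (-e) ^ 2 / 3)| := by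
        gcongr; exact abs_sub _ _
    _ ≤ t ^ 4 / 500 + t ^ 4 * (1 / 5000) + t ^ 4 / 181440 * 2 := by gcongr
    _ ≤ t ^ 4 / 400 := by nlinarith [pow_nonneg ht0 4]

/-! ### §16.3 The cubic logarithm of the perturbed polynomial -/

/-- Pure algebra: with `p = c₁t + c₂t² + c₃t³`, `u = p + r`,
`(u − u²/2 + u³/3) − (c₁t + (c₂ − c₁²/2)t² + (c₃ − c₁c₂ + c₁³/3)t³) = t⁴·q₂(t) + r·(1 − p − r/2 + p² + pr + r²/3)`, whence a
bound `≤ C (t⁴ + |r|)` for `0 ≤ t ≤ 1`, `|r| ≤ R`. [folklore] -/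
private theorem abs_cubic_comp_sub_le (c₁ c₂ c₃ R : ℝ) : ∃ C : ℝ, 0 ≤ C ∧ ∀ t r : ℝ, 0 ≤ t → t ≤ 1 → |r| ≤ R →
    |((c₁ * t + c₂ * t ^ 2 + c₃ * t ^ 3 + r) - (c₁ * t + c₂ * t ^ 2 + c₃ * t ^ 3 + r) ^ 2 / 2
        + (c₁ * t + c₂ * t ^ 2 + c₃ * t ^ 3 + r) ^ 3 / 3)
      - (c₁ * t + (c₂ - c₁ ^ 2 / 2) * t ^ 2 + (c₃ - c₁ * c₂ + c₁ ^ 3 / 3) * t ^ 3)|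
      ≤ C * (t ^ 4 + |r|) := by
  set P : ℝ := |c₁| + |c₂| + |c₃| with hPdef
  have hP0 : 0 ≤ P := by positivity
  set Q : ℝ := |c₁ ^ 2 * c₂ - c₂ ^ 2 / 2 - c₁ * c₃| + |c₁ ^ 2 * c₃ + c₁ * c₂ ^ 2 - c₂ * c₃|
    + |c₂ ^ 3 / 3 + 2 * c₁ * c₂ * c₃ - c₃ ^ 2 / 2| + |c₁ * c₃ ^ 2 + c₂ ^ 2 * c₃| + |c₂ * c₃ ^ 2| + |c₃ ^ 3 / 3|
    with hQdef
  have hQ0 : 0 ≤ Q := by positivity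
  by_cases hR : 0 ≤ R
  · set D : ℝ := 1 + P + R / 2 + P ^ 2 + P * R + R ^ 2 / 3 with hDdef
    have hD0 : 0 ≤ D := by positivity
    refine ⟨Q + D, by positivity, fun t r ht0 ht1 hr => ?_⟩
    set p : ℝ := c₁ * t + c₂ * t ^ 2 + c₃ * t ^ 3 with hp
    have hid : ((p + r) - (p + r) ^ 2 / 2 + (p + r) ^ 3 / 3)
        - (c₁ * t + (c₂ - c₁ ^ 2 / 2) * t ^ 2 + (c₃ - c₁ * c₂ + c₁ ^ 3 / 3) * t ^ 3)
        = t ^ 4 * ((c₁ ^ 2 * c₂ - c₂ ^ 2 / 2 - c₁ * c₃) + (c₁ ^ 2 * c₃ + c₁ * c₂ ^ 2 - c₂ * c₃) * t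
          + (c₂ ^ 3 / 3 + 2 * c₁ * c₂ * c₃ - c₃ ^ 2 / 2) * t ^ 2 + (c₁ * c₃ ^ 2 + c₂ ^ 2 * c₃) * t ^ 3
          + (c₂ * c₃ ^ 2) * t ^ 4 + (c₃ ^ 3 / 3) * t ^ 5)
          + r * (1 - p - r / 2 + p ^ 2 + p * r + r ^ 2 / 3) := by
      rw [hp]; ring
    have hpP : |p| ≤ P := by
      rw [hp, hPdef]
      calc |c₁ * t + c₂ * t ^ 2 + c₃ * t ^ 3| ≤ |c₁ * t + c₂ * t ^ 2| + |c₃ * t ^ 3| := abs_add_le _ _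
        _ ≤ |c₁ * t| + |c₂ * t ^ 2| + |c₃ * t ^ 3| := by gcongr; exact abs_add_le _ _
        _ ≤ |c₁| + |c₂| + |c₃| := by
            have hk : ∀ (e : ℝ) (i : ℕ), |e * t ^ i| ≤ |e| := fun e i => by
              rw [abs_mul, abs_of_nonneg (pow_nonneg ht0 i)]
              exact mul_le_of_le_one_right (abs_nonneg e) (pow_le_one₀ ht0 ht1)
            have h1 : |c₁ * t| ≤ |c₁| := by simpa using hk c₁ 1
            linarith [h1, hk c₂ 2, hk c₃ 3]
    rw [hid]
    calc _ ≤ |t ^ 4 * ((c₁ ^ 2 * c₂ - c₂ ^ 2 / 2 - c₁ * c₃) + (c₁ ^ 2 * c₃ + c₁ * c₂ ^ 2 - c₂ * c₃) * t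
          + (c₂ ^ 3 / 3 + 2 * c₁ * c₂ * c₃ - c₃ ^ 2 / 2) * t ^ 2 + (c₁ * c₃ ^ 2 + c₂ ^ 2 * c₃) * t ^ 3
          + (c₂ * c₃ ^ 2) * t ^ 4 + (c₃ ^ 3 / 3) * t ^ 5)|
          + |r * (1 - p - r / 2 + p ^ 2 + p * r + r ^ 2 / 3)| := abs_add_le _ _
      _ ≤ t ^ 4 * Q + |r| * D := by
          apply add_le_add
          · rw [abs_mul, abs_of_nonneg (by positivity : (0:ℝ) ≤ t ^ 4)]
            exact mul_le_mul_of_nonneg_left (abs_poly5_le _ _ _ _ _ _ ht0 ht1) (by positivity)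
          · rw [abs_mul]
            exact mul_le_mul_of_nonneg_left (abs_cofactor_le hpP hr) (abs_nonneg r)
      _ ≤ (Q + D) * (t ^ 4 + |r|) := by
          nlinarith [abs_nonneg r, pow_nonneg ht0 4]
  · refine ⟨0, le_rfl, fun t r _ _ hr => ?_⟩
    exact absurd ((abs_nonneg r).trans hr) hR

/-! ### §16.4 The coefficients `c_j = 𝒩′ b_j` and `ρ₁, ρ₂, ρ₃` -/

/-- `c_j = 𝒩′ b_j` — the Taylor coefficients of the normalised brace `𝒩′(1 + 2Σ[…]) = 1 + c₁θ² + c₂θ⁴ + c₃θ⁶ + O(θ⁸)`.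
[cite: MullerSchiemann1987, Appendix Lemma (iii) p.284, (A.7) p.285] -/
noncomputable def ccoef (γ : ℝ) (j : ℕ) : ℝ := normN' γ * bcoef γ j

/-- `ρ₁ = −c₁`. [cite: MullerSchiemann1987, Appendix Lemma (iii) p.284] -/
noncomputable def rho1 (γ : ℝ) : ℝ := -ccoef γ 1

/-- `ρ₂ = c₁² − 2c₂`. [cite: MullerSchiemann1987, Appendix Lemma (iii) p.284] -/
noncomputable def rho2 (γ : ℝ) : ℝ := ccoef γ 1 ^ 2 - 2 * ccoef γ 2

/-- `ρ₃ = −3c₃ + 3c₁c₂ − c₁³`. [cite: MullerSchiemann1987, Appendix Lemma (iii) p.284] -/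
noncomputable def rho3 (γ : ℝ) : ℝ := -3 * ccoef γ 3 + 3 * ccoef γ 1 * ccoef γ 2 - ccoef γ 1 ^ 3

/-- **`𝒩′ (1 + b₀) = 1`**: the normalisation `h(0) = 1` in the coefficients of this section
(`1 + b₀ = 1 + 2Σ_{n≥1}(1 − 8π²γn²)e^{−4π²γn²} = Σ_{n∈ℤ}(1 − 8π²γn²)e^{−4π²γn²} = 𝒩′⁻¹`, `normN'_eq_inv_tsum`).
[cite: MullerSchiemann1987, Appendix (A.7), (A.9) p.285] -/
theorem normN'_mul_one_add_bcoef_zero (hγ : 0 < γ) : normN' γ * (1 + bcoef γ 0) = 1 := by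
  have hπ : 0 < π := Real.pi_pos
  set f : ℤ → ℝ := fun n => (1 - 8 * π ^ 2 * γ * n ^ 2) * Real.exp (-(4 * π ^ 2 * γ * n ^ 2)) with hf
  have hN : normN' γ = (∑' n : ℤ, f n)⁻¹ := normN'_eq_inv_tsum hγ
  have hpos : 0 < ∑' n : ℤ, f n := by
    have hN' : 0 < normN' γ := by
      rw [normN']; exact mul_pos (by positivity) (normN_pos hγ)
    rw [hN] at hN'
    exact inv_pos.mp hN'
  have hsum : Summable f := by
    by_contra hns
    rw [tsum_eq_zero_of_not_summable hns] at hpos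
    exact lt_irrefl _ hpos
  have hsum1 : Summable fun n : ℕ => f ((n : ℤ) + 1) :=
    hsum.comp_injective (i := fun n : ℕ => (n : ℤ) + 1) fun a b hab => by simpa using hab
  have hsum2 : Summable fun n : ℕ => f (-((n : ℤ) + 1)) := by
    refine hsum1.congr fun n => ?_
    simp only [hf, Int.cast_neg, neg_sq]
  have hsplit : ∑' n : ℤ, f n = (∑' n : ℕ, f ((n : ℤ) + 1)) + f 0 + ∑' n : ℕ, f (-((n : ℤ) + 1)) :=
    tsum_of_add_one_of_neg_add_one hsum1 hsum2
  have hf0 : f 0 = 1 := by simp [hf]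
  have hev : ∑' n : ℕ, f (-((n : ℤ) + 1)) = ∑' n : ℕ, f ((n : ℤ) + 1) :=
    tsum_congr fun n => by simp only [hf, Int.cast_neg, neg_sq]
  have hterm : ∀ n : ℕ, f ((n : ℤ) + 1)
      = aSeq γ n ^ (2 * 0) / ((2 * 0).factorial : ℝ) * (1 - sSeq γ n / (2 * (0:ℕ) + 1)) * wSeq γ n := by
    intro n
    simp only [hf, sSeq, wSeq, Nat.factorial, mul_zero, pow_zero]
    push_cast
    ring
  have hb0 : bcoef γ 0 = 2 * ∑' n : ℕ, f ((n : ℤ) + 1) := by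
    rw [bcoef]; congr 1; exact tsum_congr fun n => (hterm n).symm
  have htot : ∑' n : ℤ, f n = 1 + bcoef γ 0 := by
    rw [hsplit, hf0, hev, hb0]; ring
  rw [hN, htot]
  exact inv_mul_cancel₀ (by rw [← htot]; exact hpos.ne')

/-! ### §16.5 Lemma (iii), the expansion -/

set_option maxHeartbeats 400000 in -- one long explicit-constant estimate (2× the default budget)
/-- **APPENDIX LEMMA (iii) — explicit form.** For every `γ > 0` there are `θ₀ > 0` and `C` with
`|−ln h(θ) − [(γ − ⅙ + ρ₁)θ² + ½(−1/90 + ρ₂)θ⁴ + ⅓(−1/945 + ρ₃)θ⁶]| ≤ C θ⁸` for `|θ| ≤ θ₀`, where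
`ρ₁ = −c₁`, `ρ₂ = c₁² − 2c₂`, `ρ₃ = −3c₃ + 3c₁c₂ − c₁³`, `c_j = 𝒩′ b_j` (`rho1`, `rho2`, `rho3`, `ccoef`, `bcoef`). Proof as
printed («From (A.7) we read off (iii)»): `−ln h = γθ² + ln(sin θ/θ) − ln(1 + c₁θ² + c₂θ⁴ + c₃θ⁶ + O(θ⁸))` by (A.7) and
`𝒩′(1 + b₀) = 1`, then `ln(sin θ/θ) = −θ²/6 − θ⁴/180 − θ⁶/2835 + O(θ⁸)` and `ln(1+u) = u − u²/2 + u³/3 + O(u⁴)`.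
[cite: MullerSchiemann1987, Appendix Lemma (iii) p.284, proof p.285 L.18] -/
theorem abs_neg_log_h_sub_taylor_le (hγ : 0 < γ) : ∃ θ₀ : ℝ, 0 < θ₀ ∧ ∃ C : ℝ, ∀ θ : ℝ, |θ| ≤ θ₀ →
    |-Real.log (h γ θ) - ((γ - 1 / 6 + rho1 γ) * θ ^ 2 + (1 / 2) * (-(1 / 90) + rho2 γ) * θ ^ 4
        + (1 / 3) * (-(1 / 945) + rho3 γ) * θ ^ 6)| ≤ C * θ ^ 8 := by
  have hπ : 0 < π := Real.pi_pos
  -- constants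
  set c₁ := ccoef γ 1 with hc₁
  set c₂ := ccoef γ 2 with hc₂
  set c₃ := ccoef γ 3 with hc₃
  set P : ℝ := |c₁| + |c₂| + |c₃| with hP
  have hN'pos : 0 < normN' γ := by rw [normN']; exact mul_pos (by positivity) (normN_pos hγ)
  set R : ℝ := normN' γ * remK γ with hR
  have hR0 : 0 ≤ R := mul_nonneg hN'pos.le (remK_nonneg hγ)
  obtain ⟨C₁, hC₁0, hC₁⟩ := abs_cubic_comp_sub_le c₁ c₂ c₃ R
  set θ₀ : ℝ := 1 / (2 * (P + R) + 2) with hθ₀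
  have hPR0 : 0 ≤ P + R := by positivity
  have hθ₀pos : 0 < θ₀ := by rw [hθ₀]; positivity
  have hθ₀le : θ₀ ≤ 1 / 2 := by
    rw [hθ₀]; apply div_le_div_of_nonneg_left (by norm_num) (by norm_num) (by linarith)
  refine ⟨θ₀, hθ₀pos, 1 / 400 + 2 * (P + R) ^ 4 + C₁ * (1 + R), fun θ hθ => ?_⟩
  have hθ1 : |θ| ≤ 1 := hθ.trans (hθ₀le.trans (by norm_num))
  rcases eq_or_ne θ 0 with rfl | hθne
  · -- θ = 0: both sides vanish
    simp [h_zero hγ]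
  -- 0 < |θ| ≤ θ₀ ≤ 1/2
  set t : ℝ := θ ^ 2 with ht
  have ht0 : 0 ≤ t := by positivity
  have htpos : 0 < t := by positivity
  have ht1 : t ≤ θ₀ := by
    have h1 : θ ^ 2 = |θ| ^ 2 := (sq_abs θ).symm
    rw [ht, h1]
    calc |θ| ^ 2 ≤ θ₀ ^ 2 := pow_le_pow_left₀ (abs_nonneg θ) hθ 2
      _ ≤ θ₀ := by nlinarith
  have ht1' : t ≤ 1 := ht1.trans (hθ₀le.trans (by norm_num))
  -- sin θ / θ > 0
  have hθπ : |θ| < π := lt_of_le_of_lt hθ1 (by linarith [Real.pi_gt_three])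
  have hsinθ : 0 < Real.sin θ / θ := by
    rcases lt_or_gt_of_ne hθne with hneg | hpos
    · have : Real.sin θ < 0 := Real.sin_neg_of_neg_of_neg_pi_lt hneg (by
        have := neg_abs_le θ; rw [abs_of_neg hneg] at hθπ; linarith)
      exact div_pos_of_neg_of_neg this hneg
    · have : 0 < Real.sin θ := Real.sin_pos_of_pos_of_lt_pi hpos (by
        rw [abs_of_pos hpos] at hθπ; exact hθπ)
      exact div_pos this hpos
  have hsinne : Real.sin θ ≠ 0 := by
    intro h0; rw [h0, zero_div] at hsinθ; exact lt_irrefl _ hsinθ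
  -- the brace remainder
  obtain ⟨E, hE⟩ : ∃ E : ℝ, θ + 2 * braceT γ θ
      - θ * (1 + bcoef γ 0 + bcoef γ 1 * θ ^ 2 + bcoef γ 2 * θ ^ 4 + bcoef γ 3 * θ ^ 6) = E := ⟨_, rfl⟩
  have hEb : |E| ≤ remK γ * |θ| ^ 9 := by rw [← hE]; exact abs_brace_sub_poly_le hγ hθ1
  obtain ⟨r, hr⟩ : ∃ r : ℝ, normN' γ * E / θ = r := ⟨_, rfl⟩
  have hθabs : 0 < |θ| := abs_pos.mpr hθne
  have hrb : |r| ≤ R * t ^ 4 := by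
    rw [← hr, abs_div, abs_mul, abs_of_pos hN'pos, div_le_iff₀ hθabs, hR]
    have : t ^ 4 * |θ| = |θ| ^ 9 := by
      rw [ht, ← sq_abs]; ring
    calc normN' γ * |E| ≤ normN' γ * (remK γ * |θ| ^ 9) := mul_le_mul_of_nonneg_left hEb hN'pos.le
      _ = normN' γ * remK γ * t ^ 4 * |θ| := by rw [← this]; ring
  have hrR : |r| ≤ R := hrb.trans (by
    have : t ^ 4 ≤ 1 := pow_le_one₀ ht0 ht1'
    nlinarith)
  -- u and 1 + u
  obtain ⟨u, hu⟩ : ∃ u : ℝ, c₁ * t + c₂ * t ^ 2 + c₃ * t ^ 3 + r = u := ⟨_, rfl⟩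
  have h1u : 1 + u = normN' γ * (θ + 2 * braceT γ θ) / θ := by
    have hb0 := normN'_mul_one_add_bcoef_zero hγ
    have hsplit : θ + 2 * braceT γ θ
        = E + θ * (1 + bcoef γ 0 + bcoef γ 1 * θ ^ 2 + bcoef γ 2 * θ ^ 4 + bcoef γ 3 * θ ^ 6) := by
      rw [← hE]; ring
    have hpoly : normN' γ * (θ * (1 + bcoef γ 0 + bcoef γ 1 * θ ^ 2 + bcoef γ 2 * θ ^ 4 + bcoef γ 3 * θ ^ 6)) / θ
        = normN' γ * (1 + bcoef γ 0) + normN' γ * bcoef γ 1 * θ ^ 2 + normN' γ * bcoef γ 2 * (θ ^ 2) ^ 2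
          + normN' γ * bcoef γ 3 * (θ ^ 2) ^ 3 := by
      field_simp
    rw [hsplit, mul_add, add_div, hpoly, hb0, ← hu, ← hr, hc₁, hc₂, hc₃, ccoef, ccoef, ccoef, ht]
    ring
  -- h factorised
  have hA7 := h_mul_sin_eq_braceT hγ θ
  have hhpos := h_pos hγ θ
  have h1u_pos : 0 < 1 + u := by
    rw [h1u]
    have : normN' γ * (θ + 2 * braceT γ θ) = h γ θ * Real.sin θ / Real.exp (-(γ * θ ^ 2)) := by
      rw [hA7]; field_simp
    rw [this, div_div, mul_comm (Real.exp _), ← div_div, mul_div_assoc]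
    exact div_pos (mul_pos hhpos hsinθ) (Real.exp_pos _)
  have hlogh : -Real.log (h γ θ) = γ * θ ^ 2 + Real.log (Real.sin θ / θ) - Real.log (1 + u) := by
    have hfac : h γ θ = Real.exp (-(γ * θ ^ 2)) * (Real.sin θ / θ)⁻¹ * (1 + u) := by
      rw [h1u]
      field_simp
      rw [hA7]; ring
    rw [hfac, Real.log_mul (mul_ne_zero (Real.exp_pos _).ne' (inv_ne_zero hsinθ.ne')) h1u_pos.ne',
      Real.log_mul (Real.exp_pos _).ne' (inv_ne_zero hsinθ.ne'), Real.log_exp, Real.log_inv]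
    ring
  -- |u| ≤ 1/2
  have hub : |u| ≤ (P + R) * t := by
    rw [← hu]
    have htle : ∀ i : ℕ, t ^ (i + 1) ≤ t := fun i => by
      calc t ^ (i + 1) = t ^ i * t := pow_succ t i
        _ ≤ 1 * t := mul_le_mul_of_nonneg_right (pow_le_one₀ ht0 ht1') ht0
        _ = t := one_mul t
    have hk : ∀ (e : ℝ) (i : ℕ), |e * t ^ (i + 1)| ≤ |e| * t := fun e i => by
      rw [abs_mul, abs_of_nonneg (pow_nonneg ht0 _)]
      exact mul_le_mul_of_nonneg_left (htle i) (abs_nonneg e)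
    calc |c₁ * t + c₂ * t ^ 2 + c₃ * t ^ 3 + r| ≤ |c₁ * t + c₂ * t ^ 2 + c₃ * t ^ 3| + |r| := abs_add_le _ _
      _ ≤ |c₁ * t| + |c₂ * t ^ 2| + |c₃ * t ^ 3| + |r| := by
          gcongr
          exact (abs_add_le _ _).trans (by gcongr; exact abs_add_le _ _)
      _ ≤ |c₁| * t + |c₂| * t + |c₃| * t + R * t ^ 4 := by
          gcongr
          · simpa using hk c₁ 0
          · simpa using hk c₂ 1
          · simpa using hk c₃ 2
      _ ≤ (P + R) * t := by
          have : t ^ 4 ≤ t := by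
            calc t ^ 4 ≤ t ^ 1 := pow_le_pow_of_le_one ht0 ht1' (by norm_num)
              _ = t := pow_one t
          rw [hP]; nlinarith
  have hu2 : |u| ≤ 1 / 2 := by
    have h1 : (P + R) * t ≤ (P + R) * θ₀ := mul_le_mul_of_nonneg_left ht1 hPR0
    have h2 : (P + R) * θ₀ ≤ 1 / 2 := by
      rw [hθ₀]
      rw [show (P + R) * (1 / (2 * (P + R) + 2)) = (P + R) / (2 * (P + R) + 2) by ring,
        div_le_iff₀ (by positivity)]
      linarith
    linarith
  -- log(1+u) remainder
  have hlog1u : |Real.log (1 + u) - (u - u ^ 2 / 2 + u ^ 3 / 3)| ≤ 2 * (P + R) ^ 4 * t ^ 4 := by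
    have h1 := abs_log_one_add_sub_cubic_le (show |u| < 1 by linarith)
    have h2 : |u| ^ 4 / (1 - |u|) ≤ 2 * |u| ^ 4 := by
      rw [div_le_iff₀ (by linarith)]
      have := mul_le_mul_of_nonneg_left hu2 (pow_nonneg (abs_nonneg u) 4)
      nlinarith [this, pow_nonneg (abs_nonneg u) 4]
    have h3 : |u| ^ 4 ≤ ((P + R) * t) ^ 4 := pow_le_pow_left₀ (abs_nonneg u) hub 4
    calc _ ≤ |u| ^ 4 / (1 - |u|) := h1
      _ ≤ 2 * |u| ^ 4 := h2
      _ ≤ 2 * ((P + R) * t) ^ 4 := by linarith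
      _ = 2 * (P + R) ^ 4 * t ^ 4 := by ring
  -- the three pieces
  have hLS := abs_log_sin_div_add_le hθne hθ1
  have hALG := hC₁ t r ht0 ht1' hrR
  -- identity
  have hid : -Real.log (h γ θ) - ((γ - 1 / 6 + rho1 γ) * θ ^ 2 + (1 / 2) * (-(1 / 90) + rho2 γ) * θ ^ 4
        + (1 / 3) * (-(1 / 945) + rho3 γ) * θ ^ 6)
      = (Real.log (Real.sin θ / θ) + θ ^ 2 / 6 + θ ^ 4 / 180 + θ ^ 6 / 2835)
        - (Real.log (1 + u) - (u - u ^ 2 / 2 + u ^ 3 / 3))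
        - (((c₁ * t + c₂ * t ^ 2 + c₃ * t ^ 3 + r) - (c₁ * t + c₂ * t ^ 2 + c₃ * t ^ 3 + r) ^ 2 / 2
            + (c₁ * t + c₂ * t ^ 2 + c₃ * t ^ 3 + r) ^ 3 / 3)
          - (c₁ * t + (c₂ - c₁ ^ 2 / 2) * t ^ 2 + (c₃ - c₁ * c₂ + c₁ ^ 3 / 3) * t ^ 3))
        - r * 0 := by
    rw [hlogh, rho1, rho2, rho3, ← hc₁, ← hc₂, ← hc₃, ← hu, ht]; ring
  rw [hid, mul_zero, sub_zero]
  have ht8 : θ ^ 8 = t ^ 4 := by rw [ht]; ring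
  calc _ ≤ |Real.log (Real.sin θ / θ) + θ ^ 2 / 6 + θ ^ 4 / 180 + θ ^ 6 / 2835
          - (Real.log (1 + u) - (u - u ^ 2 / 2 + u ^ 3 / 3))|
        + |((c₁ * t + c₂ * t ^ 2 + c₃ * t ^ 3 + r) - (c₁ * t + c₂ * t ^ 2 + c₃ * t ^ 3 + r) ^ 2 / 2
            + (c₁ * t + c₂ * t ^ 2 + c₃ * t ^ 3 + r) ^ 3 / 3)
          - (c₁ * t + (c₂ - c₁ ^ 2 / 2) * t ^ 2 + (c₃ - c₁ * c₂ + c₁ ^ 3 / 3) * t ^ 3)| := abs_sub _ _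
    _ ≤ |Real.log (Real.sin θ / θ) + θ ^ 2 / 6 + θ ^ 4 / 180 + θ ^ 6 / 2835|
        + |Real.log (1 + u) - (u - u ^ 2 / 2 + u ^ 3 / 3)|
        + |((c₁ * t + c₂ * t ^ 2 + c₃ * t ^ 3 + r) - (c₁ * t + c₂ * t ^ 2 + c₃ * t ^ 3 + r) ^ 2 / 2
            + (c₁ * t + c₂ * t ^ 2 + c₃ * t ^ 3 + r) ^ 3 / 3)
          - (c₁ * t + (c₂ - c₁ ^ 2 / 2) * t ^ 2 + (c₃ - c₁ * c₂ + c₁ ^ 3 / 3) * t ^ 3)| := by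
        gcongr; exact abs_sub _ _
    _ ≤ θ ^ 8 / 400 + 2 * (P + R) ^ 4 * t ^ 4 + C₁ * (t ^ 4 + |r|) := by gcongr
    _ ≤ θ ^ 8 / 400 + 2 * (P + R) ^ 4 * t ^ 4 + C₁ * (t ^ 4 + R * t ^ 4) := by
        gcongr
    _ = (1 / 400 + 2 * (P + R) ^ 4 + C₁ * (1 + R)) * θ ^ 8 := by rw [ht8]; ring

/-- **APPENDIX LEMMA (iii) as printed**: for `γ ∈ ℝ₊`,
`−ln h(θ) = (γ − ⅙ + ρ₁)θ² + ½(−1/90 + ρ₂)θ⁴ + ⅓(−1/945 + ρ₃)θ⁶ + O(θ⁸)` (`θ → 0`), with the `ρ_j = ρ_j(γ)` of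
`rho1`/`rho2`/`rho3`; their large-`γ` size `ρ_j = O(γ^{2j+1} e^{−4π²γ})` is §17. [cite: MullerSchiemann1987, Appendix Lemma (iii) p.284] -/
theorem neg_log_h_taylor_isBigO (hγ : 0 < γ) :
    (fun θ : ℝ => -Real.log (h γ θ) - ((γ - 1 / 6 + rho1 γ) * θ ^ 2 + (1 / 2) * (-(1 / 90) + rho2 γ) * θ ^ 4
        + (1 / 3) * (-(1 / 945) + rho3 γ) * θ ^ 6)) =O[𝓝 0] fun θ : ℝ => θ ^ 8 := by
  obtain ⟨θ₀, hθ₀, C, hC⟩ := abs_neg_log_h_sub_taylor_le hγ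
  refine Asymptotics.IsBigO.of_bound C ?_
  have hmem : Metric.closedBall (0 : ℝ) θ₀ ∈ 𝓝 (0 : ℝ) := Metric.closedBall_mem_nhds 0 hθ₀
  filter_upwards [hmem] with θ hθ
  rw [Metric.mem_closedBall, dist_zero_right, Real.norm_eq_abs] at hθ
  rw [Real.norm_eq_abs, Real.norm_eq_abs, abs_of_nonneg (by positivity : (0:ℝ) ≤ θ ^ 8)]
  exact hC θ hθ

end LemmaIII


/-! ## §17 (v1.4) LEMMA (iii), the rates: `ρ_j = O(γ^{2j+1} e^{−4π²γ})` for `γ → ∞` -/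

section RhoBounds

variable {γ : ℝ}

/-- `e^{1 − 8π²} ≤ 1/2`. [folklore] -/
private theorem exp_one_sub_le_half : Real.exp (1 - 8 * π ^ 2) ≤ 1 / 2 := by
  have hπ3 : (3 : ℝ) < π := Real.pi_gt_three
  have h1 : 1 - 8 * π ^ 2 ≤ -1 := by nlinarith
  have h2 : Real.exp (1 - 8 * π ^ 2) ≤ Real.exp (-1) := Real.exp_le_exp.mpr h1
  have h3 : Real.exp (-1) ≤ 1 / 2 := by
    rw [Real.exp_neg, inv_le_comm₀ (Real.exp_pos _) (by norm_num : (0:ℝ) < 1 / 2)]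
    have := Real.add_one_le_exp (1:ℝ)
    norm_num at this ⊢; linarith
  exact h2.trans h3

/-- For `γ ≥ 1`, `k ≤ 8`, `n ∈ ℕ`: `(n+1)^k w_n ≤ 8!·e·e^{−4π²γ}·(e^{1−8π²})ⁿ`. [folklore] -/
private theorem pow_mul_wSeq_le (hγ : 1 ≤ γ) {k : ℕ} (hk : k ≤ 8) (n : ℕ) :
    ((n : ℝ) + 1) ^ k * wSeq γ n
      ≤ 40320 * Real.exp 1 * Real.exp (-(4 * π ^ 2 * γ)) * Real.exp (1 - 8 * π ^ 2) ^ n := by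
  have hπ : 0 < π := Real.pi_pos
  have hy1 : (1 : ℝ) ≤ (n : ℝ) + 1 := by
    have : (0:ℝ) ≤ n := n.cast_nonneg
    linarith
  have hy0 : (0 : ℝ) ≤ (n : ℝ) + 1 := by positivity
  -- (n+1)^k ≤ (n+1)^8 ≤ 8! e^{n+1}
  have h1 : ((n : ℝ) + 1) ^ k ≤ ((n : ℝ) + 1) ^ 8 := pow_le_pow_right₀ hy1 hk
  have h2 : ((n : ℝ) + 1) ^ 8 ≤ 40320 * Real.exp ((n : ℝ) + 1) := by
    have := Real.pow_div_factorial_le_exp ((n : ℝ) + 1) hy0 8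
    rw [div_le_iff₀ (by positivity)] at this
    have hf : ((8).factorial : ℝ) = 40320 := by norm_num [Nat.factorial]
    rw [hf] at this
    linarith
  -- w_n ≤ e^{-4π²γ} e^{-8π² n}
  have h3 : wSeq γ n ≤ Real.exp (-(4 * π ^ 2 * γ)) * Real.exp (-(8 * π ^ 2 * n)) := by
    rw [wSeq, ← Real.exp_add]
    apply Real.exp_le_exp.mpr
    have hn : (0 : ℝ) ≤ n := n.cast_nonneg
    nlinarith [mul_nonneg (mul_nonneg (by positivity : (0:ℝ) ≤ 8 * π ^ 2) hn) (sub_nonneg.mpr hγ),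
      mul_nonneg (by positivity : (0:ℝ) ≤ 4 * π ^ 2 * γ) (sq_nonneg (n : ℝ))]
  have h4 : Real.exp ((n : ℝ) + 1) * Real.exp (-(8 * π ^ 2 * n))
      = Real.exp 1 * Real.exp (1 - 8 * π ^ 2) ^ n := by
    rw [← Real.exp_nat_mul, ← Real.exp_add, ← Real.exp_add]
    congr 1; ring
  calc ((n : ℝ) + 1) ^ k * wSeq γ n
      ≤ (40320 * Real.exp ((n : ℝ) + 1)) * (Real.exp (-(4 * π ^ 2 * γ)) * Real.exp (-(8 * π ^ 2 * n))) :=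
        mul_le_mul (h1.trans h2) h3 (wSeq_pos γ n).le (by positivity)
    _ = 40320 * Real.exp (-(4 * π ^ 2 * γ)) * (Real.exp ((n : ℝ) + 1) * Real.exp (-(8 * π ^ 2 * n))) := by
        ring
    _ = 40320 * Real.exp 1 * Real.exp (-(4 * π ^ 2 * γ)) * Real.exp (1 - 8 * π ^ 2) ^ n := by
        rw [h4]; ring

/-- For `γ ≥ 1`, `k ≤ 8`: `Σ_n (n+1)^k w_n ≤ 8!·6·e^{−4π²γ}`. [folklore] -/
private theorem tsum_pow_mul_wSeq_le (hγ : 1 ≤ γ) {k : ℕ} (hk : k ≤ 8) :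
    ∑' n : ℕ, ((n : ℝ) + 1) ^ k * wSeq γ n ≤ 241920 * Real.exp (-(4 * π ^ 2 * γ)) := by
  have hγ0 : 0 < γ := by linarith
  set r : ℝ := Real.exp (1 - 8 * π ^ 2) with hr
  have hr0 : 0 ≤ r := (Real.exp_pos _).le
  have hr1 : r ≤ 1 / 2 := exp_one_sub_le_half
  have hgeo : Summable fun n : ℕ => r ^ n := summable_geometric_of_lt_one hr0 (by linarith)
  have hgeo_le : ∑' n : ℕ, r ^ n ≤ 2 := by
    rw [tsum_geometric_of_lt_one hr0 (by linarith), inv_le_comm₀ (by linarith) (by norm_num : (0 : ℝ) < 2)]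
    linarith
  set A : ℝ := 40320 * Real.exp 1 * Real.exp (-(4 * π ^ 2 * γ)) with hA
  have hA0 : 0 ≤ A := by positivity
  have hle : ∀ n : ℕ, ((n : ℝ) + 1) ^ k * wSeq γ n ≤ A * r ^ n := fun n => pow_mul_wSeq_le hγ hk n
  have h1 : ∑' n : ℕ, ((n : ℝ) + 1) ^ k * wSeq γ n ≤ ∑' n : ℕ, A * r ^ n :=
    Summable.tsum_le_tsum hle (summable_pow_mul_wSeq hγ0 k) (hgeo.mul_left A)
  rw [tsum_mul_left] at h1
  have he : Real.exp 1 ≤ 3 := by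
    have := Real.exp_one_lt_d9; linarith
  calc _ ≤ A * ∑' n : ℕ, r ^ n := h1
    _ ≤ A * 2 := mul_le_mul_of_nonneg_left hgeo_le hA0
    _ = 80640 * Real.exp 1 * Real.exp (-(4 * π ^ 2 * γ)) := by rw [hA]; ring
    _ ≤ 80640 * 3 * Real.exp (-(4 * π ^ 2 * γ)) := by gcongr
    _ = 241920 * Real.exp (-(4 * π ^ 2 * γ)) := by ring

/-- The constant in `|b_j| ≤ C_b(j) γ^{2j+1} e^{−4π²γ}`: `C_b(j) = 483840 · 16π² (4π)^{2j}/(2j)!`. [folklore] -/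
noncomputable def Cb (j : ℕ) : ℝ := 483840 * (16 * π ^ 2 * (4 * π) ^ (2 * j) / ((2 * j).factorial : ℝ))

/-- `C_b(j) ≥ 0`. [folklore] -/
private theorem Cb_nonneg (j : ℕ) : 0 ≤ Cb j := by unfold Cb; positivity

/-- **`|b_j| ≤ C_b(j) γ^{2j+1} e^{−4π²γ}` for `γ ≥ 1`, `j ≤ 3`** — each term of `b_j` is bounded by
`2 a_n^{2j} s_n w_n/(2j)! = 16π²(4π)^{2j}/(2j)! · γ^{2j+1} (n+1)^{2j+2} w_n` and `Σ (n+1)^{2j+2} w_n ≤ 8!·6·e^{−4π²γ}`.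
[cite: MullerSchiemann1987, Appendix Lemma (iii) p.284] -/
theorem abs_bcoef_le (hγ : 1 ≤ γ) {j : ℕ} (hj : j ≤ 3) :
    |bcoef γ j| ≤ Cb j * γ ^ (2 * j + 1) * Real.exp (-(4 * π ^ 2 * γ)) := by
  have hπ : 0 < π := Real.pi_pos
  have hπ3 : (3 : ℝ) < π := Real.pi_gt_three
  have hγ0 : 0 < γ := by linarith
  set D : ℝ := 16 * π ^ 2 * (4 * π) ^ (2 * j) / ((2 * j).factorial : ℝ) with hD
  have hD0 : 0 ≤ D := by positivity
  set f : ℕ → ℝ := fun n =>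
    aSeq γ n ^ (2 * j) / ((2 * j).factorial : ℝ) * (1 - sSeq γ n / (2 * j + 1)) * wSeq γ n with hf
  have hfs : Summable f := summable_bcoef_term hγ0 j
  -- termwise bound
  have hterm : ∀ n : ℕ, |f n| ≤ D * γ ^ (2 * j + 1) * (((n : ℝ) + 1) ^ (2 * j + 2) * wSeq γ n) := by
    intro n
    have ha := aSeq_pos hγ0 n
    have hs := sSeq_pos hγ0 n
    have hw := wSeq_pos γ n
    have hs1 : 1 ≤ sSeq γ n := by
      rw [sSeq]
      have : (1:ℝ) ≤ ((n:ℝ) + 1) ^ 2 := by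
        have h0 : (0:ℝ) ≤ n := n.cast_nonneg
        nlinarith
      nlinarith [mul_nonneg (by positivity : (0:ℝ) ≤ 8 * π ^ 2) (sub_nonneg.mpr hγ)]
    have hfac : (0 : ℝ) < ((2 * j).factorial : ℝ) := by exact_mod_cast Nat.factorial_pos _
    have hj1 : (0 : ℝ) < 2 * j + 1 := by positivity
    have hbr : |1 - sSeq γ n / (2 * j + 1)| ≤ 2 * sSeq γ n := by
      calc |1 - sSeq γ n / (2 * j + 1)| ≤ |(1:ℝ)| + |sSeq γ n / (2 * j + 1)| := abs_sub _ _
        _ = 1 + sSeq γ n / (2 * j + 1) := by rw [abs_one, abs_of_pos (div_pos hs hj1)]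
        _ ≤ 1 + sSeq γ n := by
            gcongr
            exact div_le_self hs.le (by linarith)
        _ ≤ 2 * sSeq γ n := by linarith
    have e1 : |f n| = aSeq γ n ^ (2 * j) / ((2 * j).factorial : ℝ) * |1 - sSeq γ n / (2 * j + 1)| * wSeq γ n := by
      simp only [hf, abs_mul, abs_div, abs_of_pos ha, abs_of_pos hw, abs_pow, Nat.abs_cast]
    rw [e1]
    have e2 : aSeq γ n ^ (2 * j) / ((2 * j).factorial : ℝ) * (2 * sSeq γ n) * wSeq γ n
        = D * γ ^ (2 * j + 1) * (((n : ℝ) + 1) ^ (2 * j + 2) * wSeq γ n) := by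
      simp only [aSeq, sSeq, hD, mul_pow, pow_add, pow_one]
      field_simp
      ring
    calc aSeq γ n ^ (2 * j) / ((2 * j).factorial : ℝ) * |1 - sSeq γ n / (2 * j + 1)| * wSeq γ n
        ≤ aSeq γ n ^ (2 * j) / ((2 * j).factorial : ℝ) * (2 * sSeq γ n) * wSeq γ n := by
          gcongr
      _ = _ := e2
  -- sum
  have hk : 2 * j + 2 ≤ 8 := by omega
  have hS := tsum_pow_mul_wSeq_le hγ hk
  have hmaj : Summable fun n : ℕ => D * γ ^ (2 * j + 1) * (((n : ℝ) + 1) ^ (2 * j + 2) * wSeq γ n) :=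
    (summable_pow_mul_wSeq hγ0 (2 * j + 2)).mul_left _
  have h1 : |∑' n, f n| ≤ D * γ ^ (2 * j + 1) * ∑' n : ℕ, ((n : ℝ) + 1) ^ (2 * j + 2) * wSeq γ n := by
    have h := tsum_of_norm_bounded hmaj.hasSum (fun n => (Real.norm_eq_abs _).le.trans (hterm n))
    rw [Real.norm_eq_abs, tsum_mul_left] at h
    exact h
  rw [bcoef, abs_mul, abs_two]
  have hγp : 0 ≤ γ ^ (2 * j + 1) := by positivity
  calc 2 * |∑' n, f n| ≤ 2 * (D * γ ^ (2 * j + 1) * ∑' n : ℕ, ((n : ℝ) + 1) ^ (2 * j + 2) * wSeq γ n) := by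
        linarith
    _ ≤ 2 * (D * γ ^ (2 * j + 1) * (241920 * Real.exp (-(4 * π ^ 2 * γ)))) := by
        gcongr
    _ = Cb j * γ ^ (2 * j + 1) * Real.exp (-(4 * π ^ 2 * γ)) := by rw [Cb, hD]; ring

/-- `𝒩′ ≤ 2` for `γ ≥ 1` (from `normN'_le` and `64π²γ ≤ e^{4π²γ}`). [cite: MullerSchiemann1987, Appendix (A.9) p.285] -/
theorem normN'_le_two (hγ : 1 ≤ γ) : normN' γ ≤ 2 := by
  have h1 := normN'_le hγ
  have h2 : 64 * π ^ 2 * γ * Real.exp (-(4 * π ^ 2 * γ)) ≤ 1 := by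
    rw [Real.exp_neg, ← div_eq_mul_inv, div_le_one (Real.exp_pos _)]
    exact sixtyfour_le_exp hγ
  linarith

/-- `γ e^{−4π²γ} ≤ 1` for `γ ≥ 1`. [folklore] -/
private theorem mul_exp_neg_le_one (hγ : 1 ≤ γ) : γ * Real.exp (-(4 * π ^ 2 * γ)) ≤ 1 := by
  have hπ3 : (3 : ℝ) < π := Real.pi_gt_three
  have h := sixtyfour_le_exp hγ
  rw [Real.exp_neg, ← div_eq_mul_inv, div_le_one (Real.exp_pos _)]
  have hπ2 : (1 : ℝ) ≤ π ^ 2 := by nlinarith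
  have hγ0 : (0 : ℝ) ≤ γ := by linarith
  have : γ ≤ 64 * π ^ 2 * γ := by nlinarith [mul_le_mul_of_nonneg_right hπ2 hγ0]
  linarith

/-- `|c_j| ≤ 2 C_b(j) γ^{2j+1} e^{−4π²γ}` for `γ ≥ 1`, `j ≤ 3`. [cite: MullerSchiemann1987, Appendix Lemma (iii) p.284] -/
theorem abs_ccoef_le (hγ : 1 ≤ γ) {j : ℕ} (hj : j ≤ 3) :
    |ccoef γ j| ≤ 2 * Cb j * γ ^ (2 * j + 1) * Real.exp (-(4 * π ^ 2 * γ)) := by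
  have hγ0 : 0 < γ := by linarith
  have hN0 : 0 < normN' γ := by rw [normN']; exact mul_pos (by positivity) (normN_pos hγ0)
  rw [ccoef, abs_mul, abs_of_pos hN0]
  have h1 := abs_bcoef_le hγ hj
  have h2 := normN'_le_two hγ
  have h0 : 0 ≤ Cb j * γ ^ (2 * j + 1) * Real.exp (-(4 * π ^ 2 * γ)) := by
    have := Cb_nonneg j; positivity
  calc normN' γ * |bcoef γ j| ≤ 2 * (Cb j * γ ^ (2 * j + 1) * Real.exp (-(4 * π ^ 2 * γ))) :=
        mul_le_mul h2 h1 (abs_nonneg _) (by norm_num)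
    _ = _ := by ring

/-- **`ρ₁ = O(γ³ e^{−4π²γ})`, explicit: `|ρ₁| ≤ 2C_b(1) γ³ e^{−4π²γ}` for `γ ≥ 1`.**
[cite: MullerSchiemann1987, Appendix Lemma (iii) p.284] -/
theorem abs_rho1_le (hγ : 1 ≤ γ) : |rho1 γ| ≤ 2 * Cb 1 * γ ^ 3 * Real.exp (-(4 * π ^ 2 * γ)) := by
  rw [rho1, abs_neg]
  simpa using abs_ccoef_le hγ (j := 1) (by norm_num)

/-- **`ρ₂ = O(γ⁵ e^{−4π²γ})`, explicit: `|ρ₂| ≤ (4C_b(1)² + 4C_b(2)) γ⁵ e^{−4π²γ}` for `γ ≥ 1`** (`c₁² = O(γ⁶e^{−8π²γ})` is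
absorbed using `γe^{−4π²γ} ≤ 1`). [cite: MullerSchiemann1987, Appendix Lemma (iii) p.284] -/
theorem abs_rho2_le (hγ : 1 ≤ γ) :
    |rho2 γ| ≤ (4 * Cb 1 ^ 2 + 4 * Cb 2) * γ ^ 5 * Real.exp (-(4 * π ^ 2 * γ)) := by
  have hγ0 : 0 < γ := by linarith
  set E : ℝ := Real.exp (-(4 * π ^ 2 * γ)) with hE
  have hE0 : 0 < E := Real.exp_pos _
  have h1 : |ccoef γ 1| ≤ 2 * Cb 1 * γ ^ 3 * E := by simpa [hE] using abs_ccoef_le hγ (j := 1) (by norm_num)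
  have h2 : |ccoef γ 2| ≤ 2 * Cb 2 * γ ^ 5 * E := by simpa [hE] using abs_ccoef_le hγ (j := 2) (by norm_num)
  have hγE : γ * E ≤ 1 := mul_exp_neg_le_one hγ
  have hC1 := Cb_nonneg 1
  have hC2 := Cb_nonneg 2
  have hsq : |ccoef γ 1| ^ 2 ≤ (2 * Cb 1 * γ ^ 3 * E) ^ 2 := pow_le_pow_left₀ (abs_nonneg _) h1 2
  have hsq' : (2 * Cb 1 * γ ^ 3 * E) ^ 2 ≤ 4 * Cb 1 ^ 2 * γ ^ 5 * E := by
    have : (2 * Cb 1 * γ ^ 3 * E) ^ 2 = 4 * Cb 1 ^ 2 * γ ^ 5 * E * (γ * E) := by ring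
    rw [this]
    have h0 : 0 ≤ 4 * Cb 1 ^ 2 * γ ^ 5 * E := by positivity
    nlinarith
  rw [rho2]
  calc |ccoef γ 1 ^ 2 - 2 * ccoef γ 2| ≤ |ccoef γ 1 ^ 2| + |2 * ccoef γ 2| := abs_sub _ _
    _ = |ccoef γ 1| ^ 2 + 2 * |ccoef γ 2| := by rw [abs_pow, abs_mul, abs_two]
    _ ≤ 4 * Cb 1 ^ 2 * γ ^ 5 * E + 2 * (2 * Cb 2 * γ ^ 5 * E) := by
        gcongr
        · exact hsq.trans hsq'
    _ = (4 * Cb 1 ^ 2 + 4 * Cb 2) * γ ^ 5 * E := by ring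

/-- **`ρ₃ = O(γ⁷ e^{−4π²γ})`, explicit: `|ρ₃| ≤ (6C_b(3) + 12C_b(1)C_b(2) + 8C_b(1)³) γ⁷ e^{−4π²γ}` for `γ ≥ 1`.**
[cite: MullerSchiemann1987, Appendix Lemma (iii) p.284] -/
theorem abs_rho3_le (hγ : 1 ≤ γ) :
    |rho3 γ| ≤ (6 * Cb 3 + 12 * Cb 1 * Cb 2 + 8 * Cb 1 ^ 3) * γ ^ 7 * Real.exp (-(4 * π ^ 2 * γ)) := by
  have hγ0 : 0 < γ := by linarith
  set E : ℝ := Real.exp (-(4 * π ^ 2 * γ)) with hE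
  have hE0 : 0 < E := Real.exp_pos _
  have h1 : |ccoef γ 1| ≤ 2 * Cb 1 * γ ^ 3 * E := by simpa [hE] using abs_ccoef_le hγ (j := 1) (by norm_num)
  have h2 : |ccoef γ 2| ≤ 2 * Cb 2 * γ ^ 5 * E := by simpa [hE] using abs_ccoef_le hγ (j := 2) (by norm_num)
  have h3 : |ccoef γ 3| ≤ 2 * Cb 3 * γ ^ 7 * E := by simpa [hE] using abs_ccoef_le hγ (j := 3) (by norm_num)
  have hγE : γ * E ≤ 1 := mul_exp_neg_le_one hγ
  have hγE0 : 0 ≤ γ * E := by positivity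
  have hC1 := Cb_nonneg 1
  have hC2 := Cb_nonneg 2
  have hC3 := Cb_nonneg 3
  have ha1 := abs_nonneg (ccoef γ 1)
  have ha2 := abs_nonneg (ccoef γ 2)
  -- products
  have hp12 : |ccoef γ 1| * |ccoef γ 2| ≤ 4 * Cb 1 * Cb 2 * γ ^ 7 * E := by
    calc |ccoef γ 1| * |ccoef γ 2| ≤ (2 * Cb 1 * γ ^ 3 * E) * (2 * Cb 2 * γ ^ 5 * E) :=
          mul_le_mul h1 h2 ha2 (by positivity)
      _ = 4 * Cb 1 * Cb 2 * γ ^ 7 * E * (γ * E) := by ring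
      _ ≤ 4 * Cb 1 * Cb 2 * γ ^ 7 * E * 1 := by gcongr
      _ = _ := by ring
  have hp111 : |ccoef γ 1| ^ 3 ≤ 8 * Cb 1 ^ 3 * γ ^ 7 * E := by
    calc |ccoef γ 1| ^ 3 ≤ (2 * Cb 1 * γ ^ 3 * E) ^ 3 := pow_le_pow_left₀ ha1 h1 3
      _ = 8 * Cb 1 ^ 3 * γ ^ 7 * E * ((γ * E) * (γ * E)) := by ring
      _ ≤ 8 * Cb 1 ^ 3 * γ ^ 7 * E * (1 * 1) := by gcongr
      _ = _ := by ring
  rw [rho3]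
  calc |-3 * ccoef γ 3 + 3 * ccoef γ 1 * ccoef γ 2 - ccoef γ 1 ^ 3|
      ≤ |-3 * ccoef γ 3 + 3 * ccoef γ 1 * ccoef γ 2| + |ccoef γ 1 ^ 3| := abs_sub _ _
    _ ≤ |-3 * ccoef γ 3| + |3 * ccoef γ 1 * ccoef γ 2| + |ccoef γ 1 ^ 3| := by gcongr; exact abs_add_le _ _
    _ = 3 * |ccoef γ 3| + 3 * (|ccoef γ 1| * |ccoef γ 2|) + |ccoef γ 1| ^ 3 := by
        have e1 : |-3 * ccoef γ 3| = 3 * |ccoef γ 3| := by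
          rw [abs_mul, abs_neg, abs_of_pos (by norm_num : (0:ℝ) < 3)]
        have e2 : |3 * ccoef γ 1 * ccoef γ 2| = 3 * (|ccoef γ 1| * |ccoef γ 2|) := by
          rw [abs_mul, abs_mul, abs_of_pos (by norm_num : (0:ℝ) < 3)]; ring
        rw [e1, e2, abs_pow]
    _ ≤ 3 * (2 * Cb 3 * γ ^ 7 * E) + 3 * (4 * Cb 1 * Cb 2 * γ ^ 7 * E) + 8 * Cb 1 ^ 3 * γ ^ 7 * E := by
        gcongr
    _ = (6 * Cb 3 + 12 * Cb 1 * Cb 2 + 8 * Cb 1 ^ 3) * γ ^ 7 * E := by ring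

/-- **LEMMA (iii), the rates as printed: `ρ₁ = O(γ³e^{−4π²γ})`, `ρ₂ = O(γ⁵e^{−4π²γ})`, `ρ₃ = O(γ⁷e^{−4π²γ})` for
`γ → ∞`** (`ρ_j = O(γ^{2j+1} e^{−4π²γ})`). [cite: MullerSchiemann1987, Appendix Lemma (iii) p.284] -/
theorem rho1_isBigO : rho1 =O[atTop] fun γ : ℝ => γ ^ 3 * Real.exp (-(4 * π ^ 2 * γ)) := by
  refine Asymptotics.IsBigO.of_bound (2 * Cb 1) ?_
  filter_upwards [eventually_ge_atTop (1 : ℝ)] with γ hγ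
  rw [Real.norm_eq_abs, Real.norm_eq_abs, abs_of_nonneg (mul_nonneg (pow_nonneg (by linarith) 3) (Real.exp_pos _).le)]
  have := abs_rho1_le hγ; linarith

/-- `ρ₂ = O(γ⁵ e^{−4π²γ})` for `γ → ∞`. [cite: MullerSchiemann1987, Appendix Lemma (iii) p.284] -/
theorem rho2_isBigO : rho2 =O[atTop] fun γ : ℝ => γ ^ 5 * Real.exp (-(4 * π ^ 2 * γ)) := by
  refine Asymptotics.IsBigO.of_bound (4 * Cb 1 ^ 2 + 4 * Cb 2) ?_
  filter_upwards [eventually_ge_atTop (1 : ℝ)] with γ hγ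
  rw [Real.norm_eq_abs, Real.norm_eq_abs, abs_of_nonneg (mul_nonneg (pow_nonneg (by linarith) 5) (Real.exp_pos _).le)]
  have := abs_rho2_le hγ; linarith

/-- `ρ₃ = O(γ⁷ e^{−4π²γ})` for `γ → ∞`. [cite: MullerSchiemann1987, Appendix Lemma (iii) p.284] -/
theorem rho3_isBigO : rho3 =O[atTop] fun γ : ℝ => γ ^ 7 * Real.exp (-(4 * π ^ 2 * γ)) := by
  refine Asymptotics.IsBigO.of_bound (6 * Cb 3 + 12 * Cb 1 * Cb 2 + 8 * Cb 1 ^ 3) ?_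
  filter_upwards [eventually_ge_atTop (1 : ℝ)] with γ hγ
  rw [Real.norm_eq_abs, Real.norm_eq_abs, abs_of_nonneg (mul_nonneg (pow_nonneg (by linarith) 7) (Real.exp_pos _).le)]
  have := abs_rho3_le hγ; linarith

end RhoBounds

end HeatKernel

end MullerSchiemann1987

end Literature.MathematicalPhysics.QuantumFieldTheory
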